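import Literature.MathematicalPhysics.QuantumFieldTheory.Balaban1983to89.T4CombHolderWindow

/-!
# `Balaban1983to89.T4CombSecondDifference` — SECOND LATTICE DIFFERENCES ACROSS TEETH of the relative comb defect
# (the parallel-ladder recursion of `T4RelativeCombGradient` §3 one level up), at the honest rate, and the
# DISCHARGE of the second-difference slot `σ` of `T4CombHolderWindow.windowData_comb_secondDiff` (cell row
# T4-O3.E-NE1′-OG1′-RESID-R3c*, node O3, estimate NE1′, located obligation O-G1′; residual (R3c) of GAPS G-pv24g11-1
# = residual (R2) of GAPS G-pv24g10-1)

PRINTED (all COPY — quotations certified in the header of `T4CombHolderWindow` (GAPS C-pv24g11-1, cross-read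
C-adv4-86) and of `T4BirthChartTransport` (C-pv20-33); NOT re-read by this seat; B8 = [Balaban1985RegularSpaces],
B9 = [Balaban1985BackgroundPropagators], B12 = [Balaban1987RG1]):
* B9 p. 396: "|A| < O(1)Mα₀(L^jη)^{−1}, |∇^ηA| < O(1)Mα₀(L^jη)^{−2} on □, where O(1)M is a size of □ in T_{L−j};
  (3.35) |∂^{η*}∂^ηA| < O(1)Mα₀(L^jη)^{−3} on □. (3.36)"; "U satisfies the condition (3.35), and |A′| <
  α₁(L^jη)^{−1}, |∇^η_UA′| < α₁(L^jη)^{−2} on Ω_j, j = 0, …, k; (3.37) U satisfies (3.35), (3.36), A′ satisfies (3.37)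
  and |D^{η*}_UD^η_UA′| < α₁(L^jη)^{−3} on Ω_j, j = 0, …, k. (3.38)"
  [cite: Balaban1985BackgroundPropagators, (3.35)–(3.38) p. 396]
* B8 p. 82: "… U₁ = U′u^{−1} satisfies the conditions U₁ = e^{iηA}, |A| < B₁(α₀ + α₁)(L^jη)^{−1}, |∇^η_{U₀}A| <
  B₁(α₀ + α₁)(L^jη)^{−2}, ‖A‖_{1,β} < B₂(β₀)(α₀ + α₁)(L^jη)^{−2−β}, β ≦ β₀ < 1, on Ω_j, j = 0, 1, …, k, (1.36)"
  [cite: Balaban1985RegularSpaces, (1.36) p. 82]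
* B9 p. 397: "the Hölder norms ‖A‖_α = max_μ sup_{x,x′:|x−x′|≤1} (1/|x′ − x|^α)|R(U(Γ_{x,x′}))A_μ(x′) − A_μ(x)|, (3.40)
  ‖A‖_{1,α} = ‖∇A‖_α = max_{μ,ν} sup_{x,x′:|x−x′|≤1} (1/|x′ − x|^α)|R(U(Γ_{x,x′}))(D_μA_ν)(x′) − (D_μA_ν)(x)|"
  [cite: Balaban1985BackgroundPropagators, (3.40) p. 397]
* B12 p. 276: "(3.31) |𝐀|, |∇^η𝐀|, ‖𝐀‖_{1,β} < α₂ on □₀"  [cite: Balaban1987RG1, (3.31) p. 276]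

HONEST FRAMING (cell `pub-balaban`, T4-DAG PAGE 1).  The cell's T4 target is the existence AND uniqueness of the
continuum limit of Bałaban's unit-scale averaged loop expectations on a FINITE four-torus, at rung (B)+1 of the cell's
ladder — CONDITIONAL on the perturbative β-function hypothesis BetaPertH and on the running-coupling hypotheses
(B)/(B^μ) wherever a consumer uses them (none is used IN this file); it is NOT an infinite-volume statement, NOT the
Yang–Mills mass gap and NOT the Clay problem.  NO statement about Bałaban's renormalization-group objects is asserted:
every curvature / gradient / second-gradient datum below is a HYPOTHESIS SHAPE (a block sup binder).

THE QUESTION LEFT (GAPS G-pv24g11-1, residual (R3c), verbatim): "(R3c) = (R2) of G-pv24g10-1 UNCHANGED: the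
second-difference datum σ across teeth for the comb defect deviation (the parallel-ladder recursion of
`T4RelativeCombGradient` §3 one level up), which by `interp_exponent` is exactly what feeds the Hölder slot at the
printed rate θ^{2+β}; without it the discharged window (`windowData_comb_raw`) has the CRUDE entry and `crude_needs`
records the θ^β loss".  Upstream state: `T4CombHolderWindow.windowData_comb_secondDiff` takes the second-difference
bound `σ` of the zero-extended block deviation `(U₁^g − U₀)|_{B(z)}` as the HYPOTHESIS `hσ`; `interp_hol_entry` shows
that `σ ≤ a₂θ³` together with the first-difference entry `≤ a₁θ²` gives the Hölder entry at the printed rate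
`θ^{2+β}`; the comb lineage (`T4RelativeCombGradient`) bounds FIRST differences only.

WHAT THIS FILE DOES (bookkeeping on the existing seam; every analytic input stays a hypothesis).
§0 [folklore] a 2×2-GRID DIFFERENCE CALCULUS in a normed ring: `GridBnd f₀₀ f₁₀ f₀₁ f₁₁ A δ δδ` (values `≤ A`, the
   four first differences `≤ δ`, the mixed second difference `f₁₁ − f₁₀ − f₀₁ + f₀₀ ≤ δδ`), its PRODUCT RULE
   (`(AB, δB + Aδ′, δδ·B + 2δδ′ + A·δδ′)` — the discrete Leibniz rule for `∂_μ∂_ρ(fg)`), its INVERSE RULE for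
   unitary-like units (`(1, δ, δδ + 2δ²)` — `u⁻¹ − v⁻¹ = u⁻¹(v − u)v⁻¹` twice), constant and one-directional grids;
   and the LADDER-MAP ALGEBRA of the second order: for the one-square map `F(X) = a⁻¹(Q·X·P⁻¹)a` of
   `T4RelativeLadder.ladderMap` — the split `F(X) = F(X − 1) + (1 + a⁻¹(Q − P)P⁻¹a)` (`ladderMap_eq_dev`), the
   first difference of two ladder maps on a general element (`norm_mapDiff_le`: `‖Y‖(‖Q′−Q‖ + ‖P′−P‖ + 2‖a′−a‖)`),
   the MIXED SECOND DIFFERENCE OF FOUR LADDER MAPS on a near-identity element (`norm_mapDD_le`: `‖X − 1‖·mapHess +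
   devHess`, the value-at-`1` part carrying the deviation `E = Q − P` LINEARLY), and the four-term second-order split
   `Σ± F_{ab}(X_{ab}) = F₁₁(Δ²X) + [F₁₁−F₁₀](Δ_μX) + [F₁₁−F₀₁](Δ_ρX) + (Δ²F)(X₀₀)` (`ladderMap_dd_split`) with its bound
   `norm_dd_four_ladders_le`: `≤ T + secondSrc`, the inherited second difference `T` entering with coefficient
   EXACTLY `1` (`‖F₁₁(·)‖ ≤ ‖·‖`).
§1 lattice helpers (tree-likeness under steps above, block membership of dominated / shifted offsets).
§2 ONE PROPAGATION STEP for the mixed second difference `Δ_μΔ_ρ W` of the comb defect across two directions `μ, ρ`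
   above the peeling direction (`norm_second_step_le`): the four bonds over `z+k, z+k+e_μ, z+k+e_ρ, z+k+e_μ+e_ρ` are
   the tops of four PARALLEL ladder squares (`T4RelativeCombGradient.defect_rung_eq_ladderMap`), so `‖Δ²W(z+k)‖ ≤
   ‖Δ²W(y)‖ + secondSrc(s, b, G, γU, γP, γE, γγU, γγP, γγE)` with `y = z + pred′k`, sources = PLAIN first AND second
   lattice differences of the square data (base rail `γU, γγU`; base plaquette `γP, γγP`; gauge-fixed deviation
   `γE, γγE`) times zeroth/first-order quantities (`b ≥ ‖W(y) − 1‖`, `G ≥` first differences of `W`, `s ≥ ‖E‖`).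
§3 THE FOOT: below the cross length the second difference is either the `ρ`-DIFFERENCE OF THE LOCAL tree-direction
   difference (`norm_second_foot_le`: `≤ secondFoot = G(s + 2q₀ + 2τ) + 2γU(b + s) + γE + γP(2b + s)`,
   `T4RelativeLadder.norm_ladderMap_sub_self_le` / `norm_ladderMap_sub_ladderMap_le`) or ZERO (both `μ, ρ ≥ ν`:
   four tree bonds, `second_diff_eq_zero_of_isTree`).
§4 UNROLLED (induction on the cross length `crossLen k (min μ ρ) ν ≤ C = (d−1)(L−1)`): `norm_second_diff_le`: for
   interior `y, y+e_μ+e_ρ+e_ν ∈ B(z)`, `‖W(y+e_μ+e_ρ) − W(y+e_μ) − W(y+e_ρ) + W(y)‖ ≤ secondW := secondFoot(C·s, …) +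
   C·secondSrc(s, C·s, …)`.
§5 THE DISCHARGE: `norm_second_fdiff_blockDev_le` bounds `‖∂_μ D(y+e_ρ) − ∂_μ D(y)‖` for the zero-extended block
   deviation `D = blockDev L z g U₀ U₁`, `g` = the relative comb gauge (BY NAME), in EXACTLY the binder shape of the
   hypothesis `hσ` of `T4CombHolderWindow.windowData_comb_secondDiff`, with `σ := secondDev = secondW + 2Gγ_U +
   C·s·γγU` (product rule on `D = (W − 1)·U₀`, `T4CombHolderWindow.dev_eq_defect`); `windowData_comb_second` (the
   window data with the INTERPOLATED Hölder entry, `σ` discharged) and the end-to-end corollary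
   `block_transport_comb_window_second` (`T4CombHolderWindow.block_transport_window`, BY NAME).
§6 [arith] THE RATE (cell reading, `θ = L^{−j} ∈ (0, 1]`, `c ≥ 1`, master count `C·θ ≤ c`): under block sup
   data at the rates `C·s, s, q₀, τ ≤ cθ`, `G, γU, γP ≤ cθ²`, `γE, γγU, γγP ≤ cθ³`, `γγE ≤ cθ⁴` the discharged `σ`
   satisfies `σ ≤ 73c⁴·θ³` (`secondDev_le_rate`; 29 monomials, each at least cubic) — the input format of
   `T4CombHolderWindow.interp_hol_entry` (`h₂ : σ ≤ a₂θ³`), hence the Hölder slot at the printed rate `θ^{2+β}`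
   (`hol_entry_second_rate`), and the whole discharged window sits inside the `θ`-INDEPENDENT multiple
   `c + 2c² + (4c²)^{1−β}(73c⁴)^β` of the printed window `printWin θ β = (θ, θ², θ^{2+β})` (`winN_printWin_second_le`)
   — the `θ^β` loss of the crude entry (`T4CombHolderWindow.crude_needs`) is gone.  Whether Bałaban's fields obey the
   dictionary with a `j`-independent `c` is what (3.35)–(3.38)/(1.36) say about HIS (covariant) objects; not proved here.
§7 non-vacuity (the flat pair over `ℝ` inhabits every hypothesis with all constants `0`, and the bound is `0`).
§8 (v1.1, append-only) THE FIRST-ORDER LETTERS RE-PLUMBED BY NAME: `windowData_comb_second_raw` /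
   `block_transport_comb_window_second_raw` take only the RAW first-order block sups `s, q₀, q₁, τ₀, τ₁, γU, γ₀, γ₁`
   of `T4CombHolderWindow.windowData_comb_raw` plus the three second-order letters `γγU, γγP, γγE`, with
   `G := G_raw` (`T4RelativeCombGradient.norm_gradient_le_raw`), `γP := γ₀`, `γE := γE_raw = γ₁ + γ₀ +
   2q₁(τ₀ + C·s + τ₁)` (`T4RelativeCombGradient.deviation_gradient_le`) plugged LETTER FOR LETTER; [arith] under the
   PLAQUETTE-LEVEL dictionary `D₂` (`s, q₀, q₁, γU ≤ cθ²`, `τ₀, τ₁ ≤ cθ`, `γ₀, γ₁, γγU, γγP ≤ cθ³`, `γγE ≤ cθ⁴`,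
   `Cθ ≤ c`; plaquette data one power of `θ` above bond data) `G_raw ≤ 21c⁴θ²` (`gradPoly_le_rate`), `γE_raw ≤
   8c⁴θ³` (`devGradPoly_le_rate`), so §6 applies with the constant `c' = 21c⁴`: `σ_raw ≤ 73(21c⁴)⁴θ³`
   (`secondDev_raw_le_rate`) and the raw window sits inside `a(21c⁴, β)`× the printed window
   (`winN_printWin_second_raw_le`) — the composition from raw first-order sups typed as ONE theorem; `γγE` (and
   `γγU, γγP`) remain hypotheses.

HONEST SCOPE / NOT CLAIMED.  (a) PLAIN lattice differences of `R`-valued bond variables (no covariant `∇_U`, no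
parallel transport in quotients — print (3.36)/(3.38)/(3.40) has both); (b) second differences are the MIXED
axis-parallel ones `Δ_μΔ_ρ` over one block `B(z)` (incl. `μ = ρ`), unitary-like pairs only, no patching across
blocks, no complex gauge group; (c) the SECOND-GRADIENT INPUTS `γγU` (base bonds), `γγP` (base plaquettes), `γγE`
(gauge-fixed deviation field) are HYPOTHESES (block sup binders) — `γγE` is NOT discharged from raw data here (the
first-gradient analogue `γE` was, in `T4RelativeCombGradient.deviation_gradient_le`; the second-order re-combing
bookkeeping is left as the recorded residual), and `G` is not re-derived but consumed by name (the datum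
`T4RelativeCombGradient.norm_gradient_le(_raw)` supplies it; §5 leaves that plumbing to the caller exactly as in
`T4CombHolderWindow.windowData_comb_raw`, §8 (v1.1) does it inside the file); (d) the rate table of §6 is a CELL READING of the printed scales (as
`T4CombHolderWindow.printWin`), not print, and no regime claim is made about Bałaban's configurations; (e) constants
are explicit polynomials, not optimised (`O(20)` monomials); (f) NOT summit progress: rung (B)+1 bookkeeping on a
FINITE torus ≠ infinite volume / mass gap / Clay.

NOVELTY / NEAREST PRINT (records, NOT sources).  Inside the series: (3.36)/(3.38) are the printed second-gradient
format this file's `σ` is the cell-side lattice stand-in for; the relative comb construction for TWO configurations and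
its difference calculus are cell-side (GAPS C-pv04g14-2, C-pv24g10-1, C-pv24g11-1: no printed counterpart located).
Outside the series: as recorded in `T4CombHolderWindow` (Chevyrev, CMP 372 (2019) §4, ONE configuration, d = 2 —
named as precedent only; nothing of it is used) and in the cell record `t4/T4-LITERATURE.md` v19 §1.38 (Federbush III,
CMP 110 (1987), one-configuration non-abelian lattice Stokes / homotopy bounds — a precedent for telescoping SHAPES
only, named per the t4-lit NOTE of 2026-08-19; not read into and not used in this file).

LABELS.  [printed] = quoted above (COPY); [folklore] = elementary normed-ring algebra / lattice bookkeeping on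
abstract data; [cell reading] = the scale dictionary of §6; (arith) = real arithmetic.  IMPORTS BY NAME ONLY
(one-writer files of other lineages are never edited): `T4CombHolderWindow` (pv24, this lineage: `fdiff`, `blockDev`,
`dev_eq_defect`, `WindowData`, `windowData_comb_secondDiff`, `block_transport_window`, `winN`, `printWin`,
`interp_hol_entry`), `T4RelativeCombGradient` (pv24: `defect_rung_eq_ladderMap`, the offset/peeling lemmas, `crossLen`,
`norm_ladderMap_le`), `T4RelativeComb` (pv04: `Cfg`, `plaq`, `gaugeAct`, `combGauge`, `defect`, `defect_tree`,
`PlaqSup`, `ladderLen_le`, `norm_defect_sub_one_le_ladderLen`), `T4RelativeLadder` (pv04: `ladderMap`,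
`norm_ladderMap_sub_self_le`, `norm_ladderMap_sub_ladderMap_le`, `norm_inv_sub_inv_le`), `T4BlockTransport`
(t4-ne1p-p1: `Fld`, `val`, `BlockRel`), `T4BirthChartTransport` (pv20: `GaugeInvariant`, `BirthSlice`),
`B8Lemma1Lattice` (`e`, `site`, `InBlock`).
-/

namespace Literature.MathematicalPhysics.QuantumFieldTheory.Balaban1983to89.T4CombSecondDifference

open B8Lemma1Lattice (e site site_add_single InBlock inBlock_site_iff exists_offset_of_inBlock)
open T4RelativeLadder (UnitaryLike norm_mul_unit_le norm_unit_mul_le ladderMap ladderMap_sub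
  norm_ladderMap_sub_self_le norm_ladderMap_sub_ladderMap_le norm_inv_sub_inv_le)
open T4RelativeComb (Cfg gaugeAct plaq unitaryLike_gaugeAct unitaryLike_plaq IsTree low low_ne_zero pred' pred'_le
  pred'_add_single combGauge unitaryLike_combGauge defect defect_tree ladderLen ladderLen_le PlaqSup
  norm_defect_sub_one_le_ladderLen)
open T4RelativeCombGradient (norm_ladderMap_le isTree_add_single_self low_add_single_self pred'_add_single_self
  low_add_single_of_lt pred'_add_single_of_lt inBlock_of_lt crossLen crossLen_le_ladderLen eq_zero_of_crossLen_eq_zero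
  low_lt_of_crossLen_ne_zero crossLen_eq_succ unitaryLike_defect defect_rung_eq_ladderMap combGauge_self)
open T4CombHolderWindow (inBlock_add_of_add_add fdiff fdiff_apply Win winN WindowData blockDev blockDev_of_inBlock
  dev_eq_defect windowData_comb_secondDiff wMove wN block_transport_window printWin interp_hol_entry
  winN_printWin_le_iff)
open T4BlockTransport (Fld val BlockRel)
open T4BirthChartTransport (GaugeInvariant BirthSlice)

variable {R : Type*} [NormedRing R] {d : ℕ}

/-- [folklore] Sites of the `d`-dimensional lattice (= `B8Lemma1Lattice.Site`). -/
abbrev Site (d : ℕ) : Type := Fin d → ℤ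

/-! ## §0  [folklore] The 2×2-grid difference calculus and the second-order ladder-map algebra -/

section Grid

/-- [folklore] BOUNDS OF A 2×2 GRID of ring elements `f_{ab}`, `a` = shift in the first direction, `b` = in the
second: all four values have norm `≤ A`, the four first differences along the edges of the grid have norm `≤ δ`, and
the MIXED SECOND DIFFERENCE `f₁₁ − f₁₀ − f₀₁ + f₀₀` has norm `≤ δδ`. -/
structure GridBnd (f₀₀ f₁₀ f₀₁ f₁₁ : R) (A δ δδ : ℝ) : Prop where
  n₀₀ : ‖f₀₀‖ ≤ A
  n₁₀ : ‖f₁₀‖ ≤ A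
  n₀₁ : ‖f₀₁‖ ≤ A
  n₁₁ : ‖f₁₁‖ ≤ A
  d₁₀ : ‖f₁₀ - f₀₀‖ ≤ δ
  d₁₁ : ‖f₁₁ - f₀₁‖ ≤ δ
  d₀₁ : ‖f₀₁ - f₀₀‖ ≤ δ
  d₁₁' : ‖f₁₁ - f₁₀‖ ≤ δ
  dd : ‖f₁₁ - f₁₀ - f₀₁ + f₀₀‖ ≤ δδ

namespace GridBnd

variable {f₀₀ f₁₀ f₀₁ f₁₁ g₀₀ g₁₀ g₀₁ g₁₁ : R} {A B δ δ' δδ δδ' : ℝ}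

/-- [folklore] The three bounds of a grid are nonnegative. -/
theorem nonneg (h : GridBnd f₀₀ f₁₀ f₀₁ f₁₁ A δ δδ) : 0 ≤ A ∧ 0 ≤ δ ∧ 0 ≤ δδ :=
  ⟨(norm_nonneg _).trans h.n₀₀, (norm_nonneg _).trans h.d₁₀, (norm_nonneg _).trans h.dd⟩

/-- [folklore] Weakening the bounds. -/
theorem mono (h : GridBnd f₀₀ f₁₀ f₀₁ f₁₁ A δ δδ) {A₁ δ₁ δδ₁ : ℝ} (hA : A ≤ A₁) (hδ : δ ≤ δ₁) (hδδ : δδ ≤ δδ₁) :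
    GridBnd f₀₀ f₁₀ f₀₁ f₁₁ A₁ δ₁ δδ₁ :=
  ⟨h.n₀₀.trans hA, h.n₁₀.trans hA, h.n₀₁.trans hA, h.n₁₁.trans hA, h.d₁₀.trans hδ, h.d₁₁.trans hδ, h.d₀₁.trans hδ,
    h.d₁₁'.trans hδ, h.dd.trans hδδ⟩

/-- [folklore] The second difference in the other grouping: `(f₁₁ − f₀₁) − (f₁₀ − f₀₀)`. -/
theorem dd' (h : GridBnd f₀₀ f₁₀ f₀₁ f₁₁ A δ δδ) : ‖(f₁₁ - f₀₁) - (f₁₀ - f₀₀)‖ ≤ δδ := by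
  rw [show (f₁₁ - f₀₁) - (f₁₀ - f₀₀) = f₁₁ - f₁₀ - f₀₁ + f₀₀ by abel]; exact h.dd

/-- [folklore] A CONSTANT grid: `(‖Y‖, 0, 0)`. -/
theorem const (Y : R) : GridBnd Y Y Y Y ‖Y‖ 0 0 where
  n₀₀ := le_rfl
  n₁₀ := le_rfl
  n₀₁ := le_rfl
  n₁₁ := le_rfl
  d₁₀ := by simp
  d₁₁ := by simp
  d₀₁ := by simp
  d₁₁' := by simp
  dd := by rw [show Y - Y - Y + Y = 0 by abel]; simp

/-- [folklore] A grid varying in the SECOND direction only (`f₀₀ = f₁₀ = f`, `f₀₁ = f₁₁ = f′`): `(A, ‖f′ − f‖, 0)`. -/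
theorem pair {f f' : R} (hf : ‖f‖ ≤ A) (hf' : ‖f'‖ ≤ A) (hd : ‖f' - f‖ ≤ δ) : GridBnd f f f' f' A δ 0 where
  n₀₀ := hf
  n₁₀ := hf
  n₀₁ := hf'
  n₁₁ := hf'
  d₁₀ := by rw [sub_self, norm_zero]; exact (norm_nonneg _).trans hd
  d₁₁ := by rw [sub_self, norm_zero]; exact (norm_nonneg _).trans hd
  d₀₁ := hd
  d₁₁' := hd
  dd := by rw [show f' - f - f' + f = 0 by abel]; simp

/-- [folklore] THE PRODUCT RULE (discrete Leibniz rule for the mixed second difference):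
`Δ²(fg) = (Δ²f)·g₁₁ + (Δ_a f)(y)·(Δ_b g)(y+e_a) + (Δ_b f)(y)·(Δ_a g)(y+e_b) + f₀₀·(Δ²g)`, so the product grid has bounds
`(A·B, δ·B + A·δ′, δδ·B + 2δδ′ + A·δδ′)`. -/
theorem mul (hf : GridBnd f₀₀ f₁₀ f₀₁ f₁₁ A δ δδ) (hg : GridBnd g₀₀ g₁₀ g₀₁ g₁₁ B δ' δδ') :
    GridBnd (f₀₀ * g₀₀) (f₁₀ * g₁₀) (f₀₁ * g₀₁) (f₁₁ * g₁₁) (A * B) (δ * B + A * δ') (δδ * B + 2 * δ * δ' + A * δδ') := by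
  obtain ⟨hA, hδ, hδδ⟩ := hf.nonneg
  have val : ∀ {x y : R}, ‖x‖ ≤ A → ‖y‖ ≤ B → ‖x * y‖ ≤ A * B := fun hx hy =>
    (norm_mul_le _ _).trans (mul_le_mul hx hy (norm_nonneg _) hA)
  have dif : ∀ {x x' y y' : R}, ‖x‖ ≤ A → ‖y'‖ ≤ B → ‖x' - x‖ ≤ δ → ‖y' - y‖ ≤ δ' →
      ‖x' * y' - x * y‖ ≤ δ * B + A * δ' := by
    intro x x' y y' hx hy' hdx hdy
    rw [show x' * y' - x * y = (x' - x) * y' + x * (y' - y) by noncomm_ring]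
    exact (norm_add_le _ _).trans (add_le_add
      ((norm_mul_le _ _).trans (mul_le_mul hdx hy' (norm_nonneg _) hδ))
      ((norm_mul_le _ _).trans (mul_le_mul hx hdy (norm_nonneg _) hA)))
  refine ⟨val hf.n₀₀ hg.n₀₀, val hf.n₁₀ hg.n₁₀, val hf.n₀₁ hg.n₀₁, val hf.n₁₁ hg.n₁₁,
    dif hf.n₀₀ hg.n₁₀ hf.d₁₀ hg.d₁₀, dif hf.n₀₁ hg.n₁₁ hf.d₁₁ hg.d₁₁, dif hf.n₀₀ hg.n₀₁ hf.d₀₁ hg.d₀₁,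
    dif hf.n₁₀ hg.n₁₁ hf.d₁₁' hg.d₁₁', ?_⟩
  rw [show f₁₁ * g₁₁ - f₁₀ * g₁₀ - f₀₁ * g₀₁ + f₀₀ * g₀₀ =
      (f₁₁ - f₁₀ - f₀₁ + f₀₀) * g₁₁ + (f₁₀ - f₀₀) * (g₁₁ - g₁₀) + (f₀₁ - f₀₀) * (g₁₁ - g₀₁) +
        f₀₀ * (g₁₁ - g₁₀ - g₀₁ + g₀₀) by noncomm_ring]
  calc _ ≤ ‖(f₁₁ - f₁₀ - f₀₁ + f₀₀) * g₁₁‖ + ‖(f₁₀ - f₀₀) * (g₁₁ - g₁₀)‖ + ‖(f₀₁ - f₀₀) * (g₁₁ - g₀₁)‖ +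
        ‖f₀₀ * (g₁₁ - g₁₀ - g₀₁ + g₀₀)‖ := (norm_add_le _ _).trans (add_le_add norm_add₃_le le_rfl)
    _ ≤ δδ * B + δ * δ' + δ * δ' + A * δδ' :=
        add_le_add (add_le_add (add_le_add
          ((norm_mul_le _ _).trans (mul_le_mul hf.dd hg.n₁₁ (norm_nonneg _) hδδ))
          ((norm_mul_le _ _).trans (mul_le_mul hf.d₁₀ hg.d₁₁' (norm_nonneg _) hδ)))
          ((norm_mul_le _ _).trans (mul_le_mul hf.d₀₁ hg.d₁₁ (norm_nonneg _) hδ)))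
          ((norm_mul_le _ _).trans (mul_le_mul hf.n₀₀ hg.dd (norm_nonneg _) hA))
    _ = δδ * B + 2 * δ * δ' + A * δδ' := by ring

/-- [folklore] `u⁻¹ − v⁻¹ = u⁻¹·(v − u)·v⁻¹` for units. -/
theorem inv_sub_inv (a b : Rˣ) : ((a⁻¹ : Rˣ) : R) - ((b⁻¹ : Rˣ) : R) = ((a⁻¹ : Rˣ) : R) * ((b : R) - a) * ((b⁻¹ : Rˣ) : R) := by
  rw [mul_sub, sub_mul, Units.mul_inv_cancel_right, Units.inv_mul, one_mul]

/-- [folklore] THE INVERSE RULE for a grid of UNITARY-LIKE units (`‖u‖, ‖u⁻¹‖ ≤ 1`): the grid of inverses has bounds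
`(1, δ, δδ + 2δ²)` — first differences by `T4RelativeLadder.norm_inv_sub_inv_le`; for the second difference,
`u₁₁⁻¹ − u₁₀⁻¹ − u₀₁⁻¹ + u₀₀⁻¹ = u₁₁⁻¹(u₁₀ − u₁₁)u₁₀⁻¹ − u₀₁⁻¹(u₀₀ − u₀₁)u₀₀⁻¹`, a difference of triple products handled
by the Leibniz split (two cross terms `δ·δ`, one term carrying `Δ²u`). -/
theorem inv {u₀₀ u₁₀ u₀₁ u₁₁ : Rˣ} (h₀₀ : UnitaryLike u₀₀) (h₁₀ : UnitaryLike u₁₀) (h₀₁ : UnitaryLike u₀₁)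
    (h₁₁ : UnitaryLike u₁₁) (h : GridBnd (u₀₀ : R) u₁₀ u₀₁ u₁₁ 1 δ δδ) :
    GridBnd ((u₀₀⁻¹ : Rˣ) : R) ((u₁₀⁻¹ : Rˣ) : R) ((u₀₁⁻¹ : Rˣ) : R) ((u₁₁⁻¹ : Rˣ) : R) 1 δ (δδ + 2 * δ * δ) := by
  obtain ⟨-, hδ, -⟩ := h.nonneg
  refine ⟨h₀₀.2, h₁₀.2, h₀₁.2, h₁₁.2, (norm_inv_sub_inv_le h₁₀ h₀₀).trans h.d₁₀,
    (norm_inv_sub_inv_le h₁₁ h₀₁).trans h.d₁₁, (norm_inv_sub_inv_le h₀₁ h₀₀).trans h.d₀₁,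
    (norm_inv_sub_inv_le h₁₁ h₁₀).trans h.d₁₁', ?_⟩
  have e1 : ((u₁₁⁻¹ : Rˣ) : R) - ((u₁₀⁻¹ : Rˣ) : R) - ((u₀₁⁻¹ : Rˣ) : R) + ((u₀₀⁻¹ : Rˣ) : R) =
      (((u₁₁⁻¹ : Rˣ) : R) - ((u₁₀⁻¹ : Rˣ) : R)) - (((u₀₁⁻¹ : Rˣ) : R) - ((u₀₀⁻¹ : Rˣ) : R)) := by abel
  rw [e1, inv_sub_inv u₁₁ u₁₀, inv_sub_inv u₀₁ u₀₀]
  rw [show ((u₁₁⁻¹ : Rˣ) : R) * ((u₁₀ : R) - u₁₁) * ((u₁₀⁻¹ : Rˣ) : R) -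
        ((u₀₁⁻¹ : Rˣ) : R) * ((u₀₀ : R) - u₀₁) * ((u₀₀⁻¹ : Rˣ) : R) =
      (((u₁₁⁻¹ : Rˣ) : R) - ((u₀₁⁻¹ : Rˣ) : R)) * ((u₁₀ : R) - u₁₁) * ((u₁₀⁻¹ : Rˣ) : R) +
        ((u₀₁⁻¹ : Rˣ) : R) * (((u₁₀ : R) - u₁₁) - ((u₀₀ : R) - u₀₁)) * ((u₁₀⁻¹ : Rˣ) : R) +
        ((u₀₁⁻¹ : Rˣ) : R) * ((u₀₀ : R) - u₀₁) * (((u₁₀⁻¹ : Rˣ) : R) - ((u₀₀⁻¹ : Rˣ) : R)) by noncomm_ring]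
  have t1 : ‖(((u₁₁⁻¹ : Rˣ) : R) - ((u₀₁⁻¹ : Rˣ) : R)) * ((u₁₀ : R) - u₁₁) * ((u₁₀⁻¹ : Rˣ) : R)‖ ≤ δ * δ := by
    refine (norm_mul_unit_le h₁₀.inv _).trans ((norm_mul_le _ _).trans ?_)
    rw [norm_sub_rev (u₁₀ : R)]
    exact mul_le_mul ((norm_inv_sub_inv_le h₁₁ h₀₁).trans h.d₁₁) h.d₁₁' (norm_nonneg _) hδ
  have t2 : ‖((u₀₁⁻¹ : Rˣ) : R) * (((u₁₀ : R) - u₁₁) - ((u₀₀ : R) - u₀₁)) * ((u₁₀⁻¹ : Rˣ) : R)‖ ≤ δδ := by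
    refine (norm_mul_unit_le h₁₀.inv _).trans ((norm_unit_mul_le h₀₁.inv _).trans ?_)
    rw [show ((u₁₀ : R) - u₁₁) - ((u₀₀ : R) - u₀₁) = -((u₁₁ : R) - u₁₀ - u₀₁ + u₀₀) by abel, norm_neg]
    exact h.dd
  have t3 : ‖((u₀₁⁻¹ : Rˣ) : R) * ((u₀₀ : R) - u₀₁) * (((u₁₀⁻¹ : Rˣ) : R) - ((u₀₀⁻¹ : Rˣ) : R))‖ ≤ δ * δ := by
    rw [mul_assoc]
    refine (norm_unit_mul_le h₀₁.inv _).trans ((norm_mul_le _ _).trans ?_)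
    rw [norm_sub_rev (u₀₀ : R)]
    exact mul_le_mul h.d₀₁ ((norm_inv_sub_inv_le h₁₀ h₀₀).trans h.d₁₀) (norm_nonneg _) hδ
  calc _ ≤ _ := norm_add₃_le
    _ ≤ δ * δ + δδ + δ * δ := add_le_add (add_le_add t1 t2) t3
    _ = δδ + 2 * δ * δ := by ring

end GridBnd

/-- [folklore] `‖Q′ − Q‖ ≤ ‖E′ − E‖ + ‖P′ − P‖` for `E = Q − P`. -/
theorem norm_sub_le_of_dev {Q Q' P P' : R} {γE γP : ℝ} (hE : ‖(Q' - P') - (Q - P)‖ ≤ γE) (hP : ‖P' - P‖ ≤ γP) :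
    ‖Q' - Q‖ ≤ γE + γP := by
  rw [show Q' - Q = ((Q' - P') - (Q - P)) + (P' - P) by abel]
  exact (norm_add_le _ _).trans (add_le_add hE hP)

/-- [folklore] The same for mixed second differences: `‖Δ²Q‖ ≤ ‖Δ²E‖ + ‖Δ²P‖`. -/
theorem norm_dd_le_of_dev {Q₀₀ Q₁₀ Q₀₁ Q₁₁ P₀₀ P₁₀ P₀₁ P₁₁ : R} {γγE γγP : ℝ}
    (hE : ‖(Q₁₁ - P₁₁) - (Q₁₀ - P₁₀) - (Q₀₁ - P₀₁) + (Q₀₀ - P₀₀)‖ ≤ γγE)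
    (hP : ‖P₁₁ - P₁₀ - P₀₁ + P₀₀‖ ≤ γγP) : ‖Q₁₁ - Q₁₀ - Q₀₁ + Q₀₀‖ ≤ γγE + γγP := by
  rw [show Q₁₁ - Q₁₀ - Q₀₁ + Q₀₀ =
    ((Q₁₁ - P₁₁) - (Q₁₀ - P₁₀) - (Q₀₁ - P₀₁) + (Q₀₀ - P₀₀)) + (P₁₁ - P₁₀ - P₀₁ + P₀₀) by abel]
  exact (norm_add_le _ _).trans (add_le_add hE hP)

/-- [folklore] The grid of the configuration-`1` plaquettes `Q` from the grid of the gauge-fixed deviations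
`E = Q − P` (`(s, γE, γγE)`) and the grid of the base plaquettes `P` (`(1, γP, γγP)`): `(1, γE + γP, γγE + γγP)`. -/
theorem GridBnd.of_dev {Q₀₀ Q₁₀ Q₀₁ Q₁₁ P₀₀ P₁₀ P₀₁ P₁₁ : Rˣ} (hQ₀₀ : UnitaryLike Q₀₀) (hQ₁₀ : UnitaryLike Q₁₀)
    (hQ₀₁ : UnitaryLike Q₀₁) (hQ₁₁ : UnitaryLike Q₁₁) {s γE γγE γP γγP : ℝ}
    (gE : GridBnd ((Q₀₀ : R) - P₀₀) ((Q₁₀ : R) - P₁₀) ((Q₀₁ : R) - P₀₁) ((Q₁₁ : R) - P₁₁) s γE γγE)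
    (gP : GridBnd (P₀₀ : R) P₁₀ P₀₁ P₁₁ 1 γP γγP) :
    GridBnd (Q₀₀ : R) Q₁₀ Q₀₁ Q₁₁ 1 (γE + γP) (γγE + γγP) :=
  ⟨hQ₀₀.1, hQ₁₀.1, hQ₀₁.1, hQ₁₁.1, norm_sub_le_of_dev gE.d₁₀ gP.d₁₀, norm_sub_le_of_dev gE.d₁₁ gP.d₁₁,
    norm_sub_le_of_dev gE.d₀₁ gP.d₀₁, norm_sub_le_of_dev gE.d₁₁' gP.d₁₁', norm_dd_le_of_dev gE.dd gP.dd⟩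

/-- [folklore] THE VALUE OF THE LADDER MAP AT `1`, split off: `F(X) = F(X − 1) + (a⁻¹·((Q − P)·P⁻¹)·a + 1)`
(`F(1) = a⁻¹QP⁻¹a = 1 + a⁻¹(Q − P)P⁻¹a`). -/
theorem ladderMap_eq_dev (a Q P : Rˣ) (X : R) :
    ladderMap a Q P X =
      ladderMap a Q P (X - 1) + (((a⁻¹ : Rˣ) : R) * (((Q : R) - P) * ((P⁻¹ : Rˣ) : R)) * a + 1) := by
  have key : ladderMap a Q P X - ladderMap a Q P (X - 1) - ((a⁻¹ : Rˣ) : R) * (((Q : R) - P) * ((P⁻¹ : Rˣ) : R)) * a =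
      ((a⁻¹ : Rˣ) : R) * ((P : R) * ((P⁻¹ : Rˣ) : R)) * a := by
    simp only [ladderMap]; noncomm_ring
  rw [Units.mul_inv, mul_one, Units.inv_mul] at key
  calc ladderMap a Q P X = (ladderMap a Q P X - ladderMap a Q P (X - 1) -
          ((a⁻¹ : Rˣ) : R) * (((Q : R) - P) * ((P⁻¹ : Rˣ) : R)) * a) +
        (ladderMap a Q P (X - 1) + ((a⁻¹ : Rˣ) : R) * (((Q : R) - P) * ((P⁻¹ : Rˣ) : R)) * a) := by abel
    _ = 1 + (ladderMap a Q P (X - 1) + ((a⁻¹ : Rˣ) : R) * (((Q : R) - P) * ((P⁻¹ : Rˣ) : R)) * a) := by rw [key]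
    _ = _ := by abel

/-- [folklore] FIRST DIFFERENCE OF TWO LADDER MAPS ON A GENERAL ELEMENT (unitary-like data):
`‖F′(Y) − F(Y)‖ ≤ ‖Y‖·(‖Q′ − Q‖ + ‖P′ − P‖ + 2‖a′ − a‖)` — the product rule of §0 on the five factors
`a⁻¹·Q·Y·P⁻¹·a`. -/
theorem norm_mapDiff_le {a a' Q Q' P P' : Rˣ} (ha : UnitaryLike a) (ha' : UnitaryLike a') (hQ : UnitaryLike Q)
    (hQ' : UnitaryLike Q') (hP : UnitaryLike P) (hP' : UnitaryLike P') (Y : R) :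
    ‖ladderMap a' Q' P' Y - ladderMap a Q P Y‖ ≤
      ‖Y‖ * (‖(Q' : R) - Q‖ + ‖(P' : R) - P‖ + 2 * ‖(a' : R) - a‖) := by
  have ga : GridBnd (a : R) a a' a' 1 ‖(a' : R) - a‖ 0 := GridBnd.pair ha.1 ha'.1 le_rfl
  have gQ : GridBnd (Q : R) Q Q' Q' 1 ‖(Q' : R) - Q‖ 0 := GridBnd.pair hQ.1 hQ'.1 le_rfl
  have gP : GridBnd (P : R) P P' P' 1 ‖(P' : R) - P‖ 0 := GridBnd.pair hP.1 hP'.1 le_rfl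
  have g := ((ga.inv ha ha ha' ha').mul ((gQ.mul (GridBnd.const Y)).mul (gP.inv hP hP hP' hP'))).mul ga
  simp only [ladderMap]
  refine g.d₀₁.trans (le_of_eq ?_)
  ring

/-- [folklore] (arith) THE SECOND-ORDER COEFFICIENT OF `Δ²F` ON THE SMALL ELEMENT `X − 1`: with rails `(1, γU, γγU)`,
base plaquettes `(1, γP, γγP)`, deviations `(s, γE, γγE)` — `Σ` (second gradients) `+` (first gradients)². -/
def mapHess (γU γP γE γγU γγP γγE : ℝ) : ℝ :=
  γγE + 2 * γγP + 2 * γγU + 4 * γP ^ 2 + 4 * γU ^ 2 + 2 * γP * γE + 4 * γU * γE + 8 * γU * γP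

/-- [folklore] (arith) THE SECOND DIFFERENCE OF THE VALUE AT `1`, `Δ²(a⁻¹(Q − P)P⁻¹a)`: LINEAR in the deviation grid
`(s, γE, γγE)` — every monomial carries `s`, `γE` or `γγE`. -/
def devHess (s γU γP γE γγU γγP γγE : ℝ) : ℝ :=
  γγE + 2 * γP * γE + 4 * γU * γE + s * (γγP + 2 * γγU + 2 * γP ^ 2 + 4 * γU * γP + 4 * γU ^ 2)

/-- [folklore] (arith) The first-order coefficient of `[F′ − F]` in terms of the gradient data (`‖Q′ − Q‖ ≤ γE + γP`). -/
def mapGrad (γU γP γE : ℝ) : ℝ := γE + 2 * γP + 2 * γU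

/-- [folklore] THE MIXED SECOND DIFFERENCE OF FOUR LADDER MAPS ON ONE NEAR-IDENTITY ELEMENT:
`‖F₁₁(X) − F₁₀(X) − F₀₁(X) + F₀₀(X)‖ ≤ ‖X − 1‖·mapHess + devHess` — split `F_{ab}(X) = F_{ab}(X − 1) + (1 +
a⁻¹(Q−P)P⁻¹a)_{ab}` (`ladderMap_eq_dev`; the `1`'s cancel in `Δ²`), then the product and inverse rules of §0 on the
five-factor resp. four-factor products.  NO bare second gradient of the rails or base plaquettes survives without a
factor `‖X − 1‖` or a deviation factor — the point of the rate bookkeeping of §6. -/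
theorem norm_mapDD_le {a₀₀ a₁₀ a₀₁ a₁₁ Q₀₀ Q₁₀ Q₀₁ Q₁₁ P₀₀ P₁₀ P₀₁ P₁₁ : Rˣ}
    (ha₀₀ : UnitaryLike a₀₀) (ha₁₀ : UnitaryLike a₁₀) (ha₀₁ : UnitaryLike a₀₁) (ha₁₁ : UnitaryLike a₁₁)
    (hQ₀₀ : UnitaryLike Q₀₀) (hQ₁₀ : UnitaryLike Q₁₀) (hQ₀₁ : UnitaryLike Q₀₁) (hQ₁₁ : UnitaryLike Q₁₁)
    (hP₀₀ : UnitaryLike P₀₀) (hP₁₀ : UnitaryLike P₁₀) (hP₀₁ : UnitaryLike P₀₁) (hP₁₁ : UnitaryLike P₁₁)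
    {s γU γP γE γγU γγP γγE : ℝ}
    (ga : GridBnd (a₀₀ : R) a₁₀ a₀₁ a₁₁ 1 γU γγU) (gP : GridBnd (P₀₀ : R) P₁₀ P₀₁ P₁₁ 1 γP γγP)
    (gE : GridBnd ((Q₀₀ : R) - P₀₀) ((Q₁₀ : R) - P₁₀) ((Q₀₁ : R) - P₀₁) ((Q₁₁ : R) - P₁₁) s γE γγE) (X : R) :
    ‖ladderMap a₁₁ Q₁₁ P₁₁ X - ladderMap a₁₀ Q₁₀ P₁₀ X - ladderMap a₀₁ Q₀₁ P₀₁ X + ladderMap a₀₀ Q₀₀ P₀₀ X‖ ≤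
      ‖X - 1‖ * mapHess γU γP γE γγU γγP γγE + devHess s γU γP γE γγU γγP γγE := by
  have gai := ga.inv ha₀₀ ha₁₀ ha₀₁ ha₁₁
  have gPi := gP.inv hP₀₀ hP₁₀ hP₀₁ hP₁₁
  have gQ := GridBnd.of_dev hQ₀₀ hQ₁₀ hQ₀₁ hQ₁₁ gE gP
  have g₁ := ((gai.mul ((gQ.mul (GridBnd.const (X - 1))).mul gPi)).mul ga).dd
  have g₂ := ((gai.mul (gE.mul gPi)).mul ga).dd
  have e : ladderMap a₁₁ Q₁₁ P₁₁ X - ladderMap a₁₀ Q₁₀ P₁₀ X - ladderMap a₀₁ Q₀₁ P₀₁ X + ladderMap a₀₀ Q₀₀ P₀₀ X =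
      (ladderMap a₁₁ Q₁₁ P₁₁ (X - 1) - ladderMap a₁₀ Q₁₀ P₁₀ (X - 1) - ladderMap a₀₁ Q₀₁ P₀₁ (X - 1) +
          ladderMap a₀₀ Q₀₀ P₀₀ (X - 1)) +
        (((a₁₁⁻¹ : Rˣ) : R) * (((Q₁₁ : R) - P₁₁) * ((P₁₁⁻¹ : Rˣ) : R)) * a₁₁ -
          ((a₁₀⁻¹ : Rˣ) : R) * (((Q₁₀ : R) - P₁₀) * ((P₁₀⁻¹ : Rˣ) : R)) * a₁₀ -
          ((a₀₁⁻¹ : Rˣ) : R) * (((Q₀₁ : R) - P₀₁) * ((P₀₁⁻¹ : Rˣ) : R)) * a₀₁ +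
          ((a₀₀⁻¹ : Rˣ) : R) * (((Q₀₀ : R) - P₀₀) * ((P₀₀⁻¹ : Rˣ) : R)) * a₀₀) := by
    rw [ladderMap_eq_dev a₁₁ Q₁₁ P₁₁ X, ladderMap_eq_dev a₁₀ Q₁₀ P₁₀ X, ladderMap_eq_dev a₀₁ Q₀₁ P₀₁ X,
      ladderMap_eq_dev a₀₀ Q₀₀ P₀₀ X]
    abel
  rw [e]
  simp only [ladderMap]
  refine (norm_add_le _ _).trans (add_le_add (g₁.trans (le_of_eq ?_)) (g₂.trans (le_of_eq ?_)))
  · simp only [mapHess]; ring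
  · simp only [devHess]; ring

/-- [folklore] THE SECOND-ORDER SPLIT of the mixed second difference of four ladder maps applied to four elements
(linearity of each map):
`Σ± F_{ab}(X_{ab}) = F₁₁(Δ²X) + [F₁₁ − F₁₀](X₁₀ − X₀₀) + [F₁₁ − F₀₁](X₀₁ − X₀₀) + (Δ²F)(X₀₀)`. -/
theorem ladderMap_dd_split (a₀₀ a₁₀ a₀₁ a₁₁ Q₀₀ Q₁₀ Q₀₁ Q₁₁ P₀₀ P₁₀ P₀₁ P₁₁ : Rˣ) (X₀₀ X₁₀ X₀₁ X₁₁ : R) :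
    ladderMap a₁₁ Q₁₁ P₁₁ X₁₁ - ladderMap a₁₀ Q₁₀ P₁₀ X₁₀ - ladderMap a₀₁ Q₀₁ P₀₁ X₀₁ + ladderMap a₀₀ Q₀₀ P₀₀ X₀₀ =
      ladderMap a₁₁ Q₁₁ P₁₁ (X₁₁ - X₁₀ - X₀₁ + X₀₀) +
        (ladderMap a₁₁ Q₁₁ P₁₁ (X₁₀ - X₀₀) - ladderMap a₁₀ Q₁₀ P₁₀ (X₁₀ - X₀₀)) +
        (ladderMap a₁₁ Q₁₁ P₁₁ (X₀₁ - X₀₀) - ladderMap a₀₁ Q₀₁ P₀₁ (X₀₁ - X₀₀)) +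
        (ladderMap a₁₁ Q₁₁ P₁₁ X₀₀ - ladderMap a₁₀ Q₁₀ P₁₀ X₀₀ - ladderMap a₀₁ Q₀₁ P₀₁ X₀₀ +
          ladderMap a₀₀ Q₀₀ P₀₀ X₀₀) := by
  rw [show X₁₁ - X₁₀ - X₀₁ + X₀₀ = (X₁₁ - X₁₀) - (X₀₁ - X₀₀) by abel]
  simp only [← ladderMap_sub]
  abel

/-- [folklore] (arith) THE SECOND-ORDER SOURCE OF ONE PROPAGATION STEP: `2·G·mapGrad + b·mapHess + devHess`. -/
def secondSrc (s b G γU γP γE γγU γγP γγE : ℝ) : ℝ :=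
  2 * (G * mapGrad γU γP γE) + b * mapHess γU γP γE γγU γγP γγE + devHess s γU γP γE γγU γγP γγE

/-- [folklore] THE MIXED SECOND DIFFERENCE OF FOUR LADDER MAPS APPLIED TO A GRID OF NEAR-IDENTITY ELEMENTS (the
algebraic core of one propagation step): rails `(1, γU, γγU)`, base plaquettes `(1, γP, γγP)`, deviations
`(s, γE, γγE)`, `‖X₀₀ − 1‖ ≤ b`, first differences of `X` at the foot `≤ G`, `‖Δ²X‖ ≤ T` ⟹
`‖Σ± F_{ab}(X_{ab})‖ ≤ T + secondSrc` — the inherited second difference `T` enters with coefficient `1`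
(`T4RelativeCombGradient.norm_ladderMap_le`), everything else is second order in the data. -/
theorem norm_dd_four_ladders_le {a₀₀ a₁₀ a₀₁ a₁₁ Q₀₀ Q₁₀ Q₀₁ Q₁₁ P₀₀ P₁₀ P₀₁ P₁₁ : Rˣ}
    (ha₀₀ : UnitaryLike a₀₀) (ha₁₀ : UnitaryLike a₁₀) (ha₀₁ : UnitaryLike a₀₁) (ha₁₁ : UnitaryLike a₁₁)
    (hQ₀₀ : UnitaryLike Q₀₀) (hQ₁₀ : UnitaryLike Q₁₀) (hQ₀₁ : UnitaryLike Q₀₁) (hQ₁₁ : UnitaryLike Q₁₁)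
    (hP₀₀ : UnitaryLike P₀₀) (hP₁₀ : UnitaryLike P₁₀) (hP₀₁ : UnitaryLike P₀₁) (hP₁₁ : UnitaryLike P₁₁)
    {X₀₀ X₁₀ X₀₁ X₁₁ : R} {s b G T γU γP γE γγU γγP γγE : ℝ}
    (ga : GridBnd (a₀₀ : R) a₁₀ a₀₁ a₁₁ 1 γU γγU) (gP : GridBnd (P₀₀ : R) P₁₀ P₀₁ P₁₁ 1 γP γγP)
    (gE : GridBnd ((Q₀₀ : R) - P₀₀) ((Q₁₀ : R) - P₁₀) ((Q₀₁ : R) - P₀₁) ((Q₁₁ : R) - P₁₁) s γE γγE)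
    (hX : ‖X₀₀ - 1‖ ≤ b) (hYμ : ‖X₁₀ - X₀₀‖ ≤ G) (hYρ : ‖X₀₁ - X₀₀‖ ≤ G) (hT : ‖X₁₁ - X₁₀ - X₀₁ + X₀₀‖ ≤ T) :
    ‖ladderMap a₁₁ Q₁₁ P₁₁ X₁₁ - ladderMap a₁₀ Q₁₀ P₁₀ X₁₀ - ladderMap a₀₁ Q₀₁ P₀₁ X₀₁ + ladderMap a₀₀ Q₀₀ P₀₀ X₀₀‖ ≤
      T + secondSrc s b G γU γP γE γγU γγP γγE := by
  obtain ⟨-, hγU0, hγγU0⟩ := ga.nonneg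
  obtain ⟨-, hγP0, hγγP0⟩ := gP.nonneg
  obtain ⟨hs0, hγE0, hγγE0⟩ := gE.nonneg
  have hG0 : 0 ≤ G := (norm_nonneg _).trans hYμ
  have gQ := GridBnd.of_dev hQ₀₀ hQ₁₀ hQ₀₁ hQ₁₁ gE gP
  have hai := ga.inv ha₀₀ ha₁₀ ha₀₁ ha₁₁
  have hPi := gP.inv hP₀₀ hP₁₀ hP₀₁ hP₁₁
  rw [ladderMap_dd_split]
  have t1 : ‖ladderMap a₁₁ Q₁₁ P₁₁ (X₁₁ - X₁₀ - X₀₁ + X₀₀)‖ ≤ T := (norm_ladderMap_le ha₁₁ hQ₁₁ hP₁₁ _).trans hT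
  have t2 : ‖ladderMap a₁₁ Q₁₁ P₁₁ (X₁₀ - X₀₀) - ladderMap a₁₀ Q₁₀ P₁₀ (X₁₀ - X₀₀)‖ ≤ G * mapGrad γU γP γE := by
    refine (norm_mapDiff_le ha₁₀ ha₁₁ hQ₁₀ hQ₁₁ hP₁₀ hP₁₁ _).trans (mul_le_mul hYμ ?_ (by positivity) hG0)
    have := gQ.d₁₁'; have := gP.d₁₁'; have := ga.d₁₁'
    simp only [mapGrad]; linarith
  have t3 : ‖ladderMap a₁₁ Q₁₁ P₁₁ (X₀₁ - X₀₀) - ladderMap a₀₁ Q₀₁ P₀₁ (X₀₁ - X₀₀)‖ ≤ G * mapGrad γU γP γE := by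
    refine (norm_mapDiff_le ha₀₁ ha₁₁ hQ₀₁ hQ₁₁ hP₀₁ hP₁₁ _).trans (mul_le_mul hYρ ?_ (by positivity) hG0)
    have := gQ.d₁₁; have := gP.d₁₁; have := ga.d₁₁
    simp only [mapGrad]; linarith
  have t4 := norm_mapDD_le ha₀₀ ha₁₀ ha₀₁ ha₁₁ hQ₀₀ hQ₁₀ hQ₀₁ hQ₁₁ hP₀₀ hP₁₀ hP₀₁ hP₁₁ ga gP gE X₀₀
  have hmh : 0 ≤ mapHess γU γP γE γγU γγP γγE := by simp only [mapHess]; positivity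
  have t4' : ‖X₀₀ - 1‖ * mapHess γU γP γE γγU γγP γγE ≤ b * mapHess γU γP γE γγU γγP γγE :=
    mul_le_mul_of_nonneg_right hX hmh
  calc _ ≤ _ := (norm_add_le _ _).trans (add_le_add norm_add₃_le le_rfl)
    _ ≤ T + G * mapGrad γU γP γE + G * mapGrad γU γP γE +
          (b * mapHess γU γP γE γγU γγP γγE + devHess s γU γP γE γγU γγP γγE) :=
        add_le_add (add_le_add (add_le_add t1 t2) t3) (t4.trans (add_le_add t4' le_rfl))
    _ = _ := by simp only [secondSrc]; ring

/-- [folklore] THE FOOT SPLIT: `F′(X′) − F(X) − X′ + X = [F′(X′ − X) − (X′ − X)] + [F′(X) − F(X)]`. -/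
theorem ladderMap_d_split (a a' Q Q' P P' : Rˣ) (X X' : R) :
    ladderMap a' Q' P' X' - ladderMap a Q P X - X' + X =
      (ladderMap a' Q' P' (X' - X) - (X' - X)) + (ladderMap a' Q' P' X - ladderMap a Q P X) := by
  rw [← ladderMap_sub]; abel

/-- [folklore] (arith) THE FOOT BOUND `G(s + 2q₀ + 2τ) + 2γU(b + s) + γE + γP(2b + s)`. -/
def secondFoot (b s q₀ τ G γU γP γE : ℝ) : ℝ :=
  G * (s + 2 * q₀ + 2 * τ) + (2 * γU * (b + s) + γE + γP * (2 * b + s))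

/-- [folklore] THE FOOT, ALGEBRAIC FORM: for unitary-like data and a unitary-like near-identity `X` (`‖X − 1‖ ≤ b`),
`‖X′ − X‖ ≤ G`, deviations `‖Q − P‖, ‖Q′ − P′‖ ≤ s`, `‖P′ − 1‖ ≤ q₀`, `‖a′ − 1‖ ≤ τ`, gradients `‖a′ − a‖ ≤ γU`,
`‖(Q′−P′) − (Q−P)‖ ≤ γE`, `‖P′ − P‖ ≤ γP`:  `‖F′(X′) − F(X) − X′ + X‖ ≤ secondFoot b s q₀ τ G γU γP γE`
(`T4RelativeLadder.norm_ladderMap_sub_self_le` on the first difference `X′ − X`,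
`T4RelativeLadder.norm_ladderMap_sub_ladderMap_le` on `X`). -/
theorem norm_foot_le {a a' Q Q' P P' W : Rˣ} (ha : UnitaryLike a) (ha' : UnitaryLike a') (hQ' : UnitaryLike Q')
    (hP : UnitaryLike P) (hP' : UnitaryLike P') (hW : UnitaryLike W) (X' : R) {b s q₀ τ G γU γP γE : ℝ}
    (hY : ‖X' - W‖ ≤ G) (hE : ‖(Q : R) - P‖ ≤ s) (hE' : ‖(Q' : R) - P'‖ ≤ s) (hP1 : ‖(P' : R) - 1‖ ≤ q₀)
    (ha1 : ‖(a' : R) - 1‖ ≤ τ) (haa : ‖(a' : R) - a‖ ≤ γU) (hX : ‖(W : R) - 1‖ ≤ b)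
    (hEE : ‖((Q' : R) - P') - ((Q : R) - P)‖ ≤ γE) (hPP : ‖(P' : R) - P‖ ≤ γP) :
    ‖ladderMap a' Q' P' X' - ladderMap a Q P (W : R) - X' + W‖ ≤ secondFoot b s q₀ τ G γU γP γE := by
  have hG0 : 0 ≤ G := (norm_nonneg _).trans hY
  have hγU0 : 0 ≤ γU := (norm_nonneg _).trans haa
  have hγP0 : 0 ≤ γP := (norm_nonneg _).trans hPP
  have hb0 : 0 ≤ b := (norm_nonneg _).trans hX
  have hs0 : 0 ≤ s := (norm_nonneg _).trans hE
  have hQ1 : ‖(Q' : R) - 1‖ ≤ s + q₀ := by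
    rw [show (Q' : R) - 1 = ((Q' : R) - P') + ((P' : R) - 1) by abel]
    exact (norm_add_le _ _).trans (add_le_add hE' hP1)
  rw [ladderMap_d_split]
  have t1 : ‖ladderMap a' Q' P' (X' - W) - (X' - W)‖ ≤ G * (s + 2 * q₀ + 2 * τ) := by
    refine (norm_ladderMap_sub_self_le ha' hP' _).trans (mul_le_mul hY ?_ (by positivity) hG0)
    linarith
  have t2 : ‖ladderMap a' Q' P' (W : R) - ladderMap a Q P W‖ ≤ 2 * γU * (b + s) + γE + γP * (2 * b + s) := by
    refine (norm_ladderMap_sub_ladderMap_le ha ha' hQ' hP hP' hW).trans ?_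
    refine add_le_add (add_le_add ?_ hEE) ?_
    · exact mul_le_mul (by linarith) (add_le_add hX hE') (by positivity) (by positivity)
    · exact mul_le_mul hPP (by linarith) (by positivity) hγP0
  calc _ ≤ _ := norm_add_le _ _
    _ ≤ G * (s + 2 * q₀ + 2 * τ) + (2 * γU * (b + s) + γE + γP * (2 * b + s)) := add_le_add t1 t2
    _ = _ := rfl

end Grid

/-! ## §1  Lattice helpers -/

section Lattice

/-- [folklore] A unit step in a direction `μ ≥ ν` keeps the coordinates below `ν` at zero. -/
theorem isTree_add_single_of_le {k : Fin d → ℕ} {ν μ : Fin d} (hk : IsTree k ν) (h : (ν : ℕ) ≤ μ) :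
    IsTree (k + Pi.single μ 1) ν := by
  intro κ hκ
  have hne : κ ≠ μ := by intro h0; subst h0; omega
  simp [hk κ hκ, Pi.single_eq_of_ne hne]

/-- [folklore] An offset dominated coordinatewise by an offset `< L` is the offset of a block site. -/
theorem inBlock_of_le {L : ℕ} (z : Site d) {m k : Fin d → ℕ} (hm : ∀ κ, m κ < L) (hk : ∀ κ, k κ ≤ m κ) :
    InBlock L z (site z k) :=
  inBlock_of_lt z fun κ => (hk κ).trans_lt (hm κ)

/-- [folklore] BOTH `μ, ρ ≥ ν` AND `k` TREE-LIKE BELOW `ν`: all four bonds are tree bonds, the mixed second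
difference VANISHES (`T4RelativeComb.defect_tree`). -/
theorem second_diff_eq_zero_of_isTree (U₀ U₁ : Cfg d R) (z : Site d) {k : Fin d → ℕ} {μ ρ ν : Fin d}
    (hkν : IsTree k ν) (hνμ : (ν : ℕ) ≤ μ) (hνρ : (ν : ℕ) ≤ ρ) :
    (defect U₀ U₁ z (site z (k + Pi.single μ 1 + Pi.single ρ 1)) ν : R) -
        defect U₀ U₁ z (site z (k + Pi.single μ 1)) ν - defect U₀ U₁ z (site z (k + Pi.single ρ 1)) ν +
        defect U₀ U₁ z (site z k) ν = 0 := by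
  have h1 := isTree_add_single_of_le hkν hνμ
  have h2 := isTree_add_single_of_le hkν hνρ
  have h3 := isTree_add_single_of_le h1 hνρ
  rw [defect_tree U₀ U₁ z h3, defect_tree U₀ U₁ z h1, defect_tree U₀ U₁ z h2, defect_tree U₀ U₁ z hkν]
  simp

end Lattice

/-! ## §2  ACROSS two directions: ONE PROPAGATION STEP of the mixed second difference (four parallel squares) -/

section Across

variable [NormOneClass R]

/-- [folklore] ONE PROPAGATION STEP.  For `k ≠ 0` with `α = low k` below `μ`, `ρ` and `ν`, `y = z + pred′ k`: the four
bonds `⟨z+k(+e_μ)(+e_ρ), ·+e_ν⟩` are the tops of the four PARALLEL squares `(y(+e_μ)(+e_ρ); α, ν)`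
(`T4RelativeCombGradient.defect_rung_eq_ladderMap`), and by `norm_dd_four_ladders_le`
`‖Δ_μΔ_ρ W(z+k)‖ ≤ ‖Δ_μΔ_ρ W(y)‖ + secondSrc(s, b, G, γU, γP, γE, γγU, γγP, γγE)` where the inputs are block sups
(HYPOTHESES) of: the gauge-fixed deviation `s`, first AND second plain differences of the base bond variables
(`γU`, `γγU`), of the base plaquettes (`γP`, `γγP`) and of the gauge-fixed deviation field (`γE`, `γγE`), a bound `G`
on the first differences of the defect, and `b ≥ ‖W(y) − 1‖`. -/
theorem norm_second_step_le {U₀ U₁ : Cfg d R} {z : Site d} {L : ℕ} {s b G γU γP γE γγU γγP γγE : ℝ}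
    (hU₀ : ∀ x ν, UnitaryLike (U₀ x ν)) (hU₁ : ∀ x ν, UnitaryLike (U₁ x ν))
    (hs : PlaqSup L z (fun y ρ ν =>
      ‖(plaq (gaugeAct (combGauge U₀ U₁ z) U₁) y ρ ν : R) - plaq U₀ y ρ ν‖) s)
    (hG : ∀ μ ν x, InBlock L z x → InBlock L z (x + e μ) → InBlock L z (x + e μ + e ν) →
      ‖(defect U₀ U₁ z (x + e μ) ν : R) - defect U₀ U₁ z x ν‖ ≤ G)
    (hγU : ∀ μ x ρ, InBlock L z x → InBlock L z (x + e ρ) → InBlock L z (x + e μ) →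
      InBlock L z (x + e μ + e ρ) → ‖(U₀ (x + e μ) ρ : R) - U₀ x ρ‖ ≤ γU)
    (hγP : ∀ μ y ρ ν', ρ ≠ ν' → InBlock L z y → InBlock L z (y + e ρ) → InBlock L z (y + e ν') →
      InBlock L z (y + e ρ + e ν') → InBlock L z (y + e μ) → InBlock L z (y + e μ + e ρ) →
      InBlock L z (y + e μ + e ν') → InBlock L z (y + e μ + e ρ + e ν') →
      ‖(plaq U₀ (y + e μ) ρ ν' : R) - plaq U₀ y ρ ν'‖ ≤ γP)
    (hγE : ∀ μ y ρ ν', ρ ≠ ν' → InBlock L z y → InBlock L z (y + e ρ) → InBlock L z (y + e ν') →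
      InBlock L z (y + e ρ + e ν') → InBlock L z (y + e μ) → InBlock L z (y + e μ + e ρ) →
      InBlock L z (y + e μ + e ν') → InBlock L z (y + e μ + e ρ + e ν') →
      ‖((plaq (gaugeAct (combGauge U₀ U₁ z) U₁) (y + e μ) ρ ν' : R) - plaq U₀ (y + e μ) ρ ν') -
          ((plaq (gaugeAct (combGauge U₀ U₁ z) U₁) y ρ ν' : R) - plaq U₀ y ρ ν')‖ ≤ γE)
    (hγγU : ∀ μ ρ x α, InBlock L z x → InBlock L z (x + e μ + e ρ + e α) →
      ‖(U₀ (x + e μ + e ρ) α : R) - U₀ (x + e μ) α - U₀ (x + e ρ) α + U₀ x α‖ ≤ γγU)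
    (hγγP : ∀ μ ρ y α ν', α ≠ ν' → InBlock L z y → InBlock L z (y + e μ + e ρ + e α + e ν') →
      ‖(plaq U₀ (y + e μ + e ρ) α ν' : R) - plaq U₀ (y + e μ) α ν' - plaq U₀ (y + e ρ) α ν' +
          plaq U₀ y α ν'‖ ≤ γγP)
    (hγγE : ∀ μ ρ y α ν', α ≠ ν' → InBlock L z y → InBlock L z (y + e μ + e ρ + e α + e ν') →
      ‖((plaq (gaugeAct (combGauge U₀ U₁ z) U₁) (y + e μ + e ρ) α ν' : R) - plaq U₀ (y + e μ + e ρ) α ν') -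
          ((plaq (gaugeAct (combGauge U₀ U₁ z) U₁) (y + e μ) α ν' : R) - plaq U₀ (y + e μ) α ν') -
          ((plaq (gaugeAct (combGauge U₀ U₁ z) U₁) (y + e ρ) α ν' : R) - plaq U₀ (y + e ρ) α ν') +
          ((plaq (gaugeAct (combGauge U₀ U₁ z) U₁) y α ν' : R) - plaq U₀ y α ν')‖ ≤ γγE)
    (k : Fin d → ℕ) (h : ∃ ρ, k ρ ≠ 0) {μ ρ ν : Fin d} (hμ : ((low k h : Fin d) : ℕ) < μ)
    (hρ : ((low k h : Fin d) : ℕ) < ρ) (hν : ((low k h : Fin d) : ℕ) < ν)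
    (hmax : ∀ κ, (k + Pi.single μ 1 + Pi.single ρ 1 + Pi.single ν 1 : Fin d → ℕ) κ < L)
    (hb : ‖(defect U₀ U₁ z (site z (pred' k h)) ν : R) - 1‖ ≤ b) {T : ℝ}
    (hT : ‖(defect U₀ U₁ z (site z (pred' k h) + e μ + e ρ) ν : R) -
        defect U₀ U₁ z (site z (pred' k h) + e μ) ν - defect U₀ U₁ z (site z (pred' k h) + e ρ) ν +
        defect U₀ U₁ z (site z (pred' k h)) ν‖ ≤ T) :
    ‖(defect U₀ U₁ z (site z (k + Pi.single μ 1 + Pi.single ρ 1)) ν : R) -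
        defect U₀ U₁ z (site z (k + Pi.single μ 1)) ν - defect U₀ U₁ z (site z (k + Pi.single ρ 1)) ν +
        defect U₀ U₁ z (site z k) ν‖ ≤ T + secondSrc s b G γU γP γE γγU γγP γγE := by
  have hg := unitaryLike_combGauge hU₀ hU₁ z
  have hQ : ∀ y ρ' ν', UnitaryLike (plaq (gaugeAct (combGauge U₀ U₁ z) U₁) y ρ' ν') := fun y ρ' ν' =>
    unitaryLike_plaq (unitaryLike_gaugeAct hg hU₁) _ _ _
  have hP : ∀ y ρ' ν', UnitaryLike (plaq U₀ y ρ' ν') := fun y ρ' ν' => unitaryLike_plaq hU₀ _ _ _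
  have hneμ : low k h ≠ μ := fun h0 => by rw [h0] at hμ; exact lt_irrefl _ hμ
  have hneρ : low k h ≠ ρ := fun h0 => by rw [h0] at hρ; exact lt_irrefl _ hρ
  have hneν : low k h ≠ ν := fun h0 => by rw [h0] at hν; exact lt_irrefl _ hν
  have hpk : pred' k h + Pi.single (low k h) 1 = k := pred'_add_single k h
  -- the three shifted offsets and their peeling data
  have h10 : ∃ ρ', (k + Pi.single μ 1 : Fin d → ℕ) ρ' ≠ 0 :=
    ⟨low k h, by simp [Pi.single_eq_of_ne hneμ, low_ne_zero k h]⟩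
  have h01 : ∃ ρ', (k + Pi.single ρ 1 : Fin d → ℕ) ρ' ≠ 0 :=
    ⟨low k h, by simp [Pi.single_eq_of_ne hneρ, low_ne_zero k h]⟩
  have h11 : ∃ ρ', (k + Pi.single μ 1 + Pi.single ρ 1 : Fin d → ℕ) ρ' ≠ 0 :=
    ⟨low k h, by simp [Pi.single_eq_of_ne hneμ, Pi.single_eq_of_ne hneρ, low_ne_zero k h]⟩
  have low10 := low_add_single_of_lt k h hμ h10
  have pred10 := pred'_add_single_of_lt k h hμ h10
  have low01 := low_add_single_of_lt k h hρ h01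
  have pred01 := pred'_add_single_of_lt k h hρ h01
  have hρ' : ((low (k + Pi.single μ 1) h10 : Fin d) : ℕ) < ρ := by rw [low10]; exact hρ
  have low11 : low (k + Pi.single μ 1 + Pi.single ρ 1) h11 = low k h := by
    rw [low_add_single_of_lt _ h10 hρ' h11, low10]
  have pred11 : pred' (k + Pi.single μ 1 + Pi.single ρ 1) h11 = pred' k h + Pi.single μ 1 + Pi.single ρ 1 := by
    rw [pred'_add_single_of_lt _ h10 hρ' h11, pred10]
  -- the four parallel squares, as ladder maps
  have e00 := defect_rung_eq_ladderMap U₀ U₁ z k h ν hν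
  have e10 := defect_rung_eq_ladderMap U₀ U₁ z (k + Pi.single μ 1) h10 ν (by rw [low10]; exact hν)
  rw [low10, pred10] at e10
  have e01 := defect_rung_eq_ladderMap U₀ U₁ z (k + Pi.single ρ 1) h01 ν (by rw [low01]; exact hν)
  rw [low01, pred01] at e01
  have e11 := defect_rung_eq_ladderMap U₀ U₁ z (k + Pi.single μ 1 + Pi.single ρ 1) h11 ν
    (by rw [low11]; exact hν)
  rw [low11, pred11] at e11
  simp only [site_add_single] at e10 e01 e11 ⊢
  rw [e11, e10, e01, e00]
  -- the grids of the square data over the four feet `y, y+e_μ, y+e_ρ, y+e_μ+e_ρ`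
  have ga : GridBnd (U₀ (site z (pred' k h)) (low k h) : R) (U₀ (site z (pred' k h) + e μ) (low k h))
      (U₀ (site z (pred' k h) + e ρ) (low k h)) (U₀ (site z (pred' k h) + e μ + e ρ) (low k h)) 1 γU γγU := by
    refine ⟨(hU₀ _ _).1, (hU₀ _ _).1, (hU₀ _ _).1, (hU₀ _ _).1, ?_, ?_, ?_, ?_, ?_⟩
    · exact hγU μ _ _
        (by refine inBlock_of_le _ hmax fun κ => ?_; have h_aux := congrFun hpk κ; simp only [Pi.add_apply] at h_aux ⊢; omega)
        (by (try simp only [← site_add_single]); refine inBlock_of_le _ hmax fun κ => ?_; have h_aux := congrFun hpk κ; simp only [Pi.add_apply] at h_aux ⊢; omega)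
        (by (try simp only [← site_add_single]); refine inBlock_of_le _ hmax fun κ => ?_; have h_aux := congrFun hpk κ; simp only [Pi.add_apply] at h_aux ⊢; omega)
        (by (try simp only [← site_add_single]); refine inBlock_of_le _ hmax fun κ => ?_; have h_aux := congrFun hpk κ; simp only [Pi.add_apply] at h_aux ⊢; omega)
    · have := hγU μ (site z (pred' k h) + e ρ) (low k h)
        (by (try simp only [← site_add_single]); refine inBlock_of_le _ hmax fun κ => ?_; have h_aux := congrFun hpk κ; simp only [Pi.add_apply] at h_aux ⊢; omega)
        (by (try simp only [← site_add_single]); refine inBlock_of_le _ hmax fun κ => ?_; have h_aux := congrFun hpk κ; simp only [Pi.add_apply] at h_aux ⊢; omega)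
        (by (try simp only [← site_add_single]); refine inBlock_of_le _ hmax fun κ => ?_; have h_aux := congrFun hpk κ; simp only [Pi.add_apply] at h_aux ⊢; omega)
        (by (try simp only [← site_add_single]); refine inBlock_of_le _ hmax fun κ => ?_; have h_aux := congrFun hpk κ; simp only [Pi.add_apply] at h_aux ⊢; omega)
      rwa [add_right_comm _ (e ρ) (e μ)] at this
    · exact hγU ρ _ _
        (by refine inBlock_of_le _ hmax fun κ => ?_; have h_aux := congrFun hpk κ; simp only [Pi.add_apply] at h_aux ⊢; omega)
        (by (try simp only [← site_add_single]); refine inBlock_of_le _ hmax fun κ => ?_; have h_aux := congrFun hpk κ; simp only [Pi.add_apply] at h_aux ⊢; omega)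
        (by (try simp only [← site_add_single]); refine inBlock_of_le _ hmax fun κ => ?_; have h_aux := congrFun hpk κ; simp only [Pi.add_apply] at h_aux ⊢; omega)
        (by (try simp only [← site_add_single]); refine inBlock_of_le _ hmax fun κ => ?_; have h_aux := congrFun hpk κ; simp only [Pi.add_apply] at h_aux ⊢; omega)
    · exact hγU ρ (site z (pred' k h) + e μ) (low k h)
        (by (try simp only [← site_add_single]); refine inBlock_of_le _ hmax fun κ => ?_; have h_aux := congrFun hpk κ; simp only [Pi.add_apply] at h_aux ⊢; omega)
        (by (try simp only [← site_add_single]); refine inBlock_of_le _ hmax fun κ => ?_; have h_aux := congrFun hpk κ; simp only [Pi.add_apply] at h_aux ⊢; omega)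
        (by (try simp only [← site_add_single]); refine inBlock_of_le _ hmax fun κ => ?_; have h_aux := congrFun hpk κ; simp only [Pi.add_apply] at h_aux ⊢; omega)
        (by (try simp only [← site_add_single]); refine inBlock_of_le _ hmax fun κ => ?_; have h_aux := congrFun hpk κ; simp only [Pi.add_apply] at h_aux ⊢; omega)
    · exact hγγU μ ρ _ _
        (by refine inBlock_of_le _ hmax fun κ => ?_; have h_aux := congrFun hpk κ; simp only [Pi.add_apply] at h_aux ⊢; omega)
        (by (try simp only [← site_add_single]); refine inBlock_of_le _ hmax fun κ => ?_; have h_aux := congrFun hpk κ; simp only [Pi.add_apply] at h_aux ⊢; omega)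
  have gP : GridBnd (plaq U₀ (site z (pred' k h)) (low k h) ν : R) (plaq U₀ (site z (pred' k h) + e μ) (low k h) ν)
      (plaq U₀ (site z (pred' k h) + e ρ) (low k h) ν) (plaq U₀ (site z (pred' k h) + e μ + e ρ) (low k h) ν)
      1 γP γγP := by
    refine ⟨(hP _ _ _).1, (hP _ _ _).1, (hP _ _ _).1, (hP _ _ _).1, ?_, ?_, ?_, ?_, ?_⟩
    · exact hγP μ _ _ _ hneν
        (by refine inBlock_of_le _ hmax fun κ => ?_; have h_aux := congrFun hpk κ; simp only [Pi.add_apply] at h_aux ⊢; omega)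
        (by (try simp only [← site_add_single]); refine inBlock_of_le _ hmax fun κ => ?_; have h_aux := congrFun hpk κ; simp only [Pi.add_apply] at h_aux ⊢; omega)
        (by (try simp only [← site_add_single]); refine inBlock_of_le _ hmax fun κ => ?_; have h_aux := congrFun hpk κ; simp only [Pi.add_apply] at h_aux ⊢; omega)
        (by (try simp only [← site_add_single]); refine inBlock_of_le _ hmax fun κ => ?_; have h_aux := congrFun hpk κ; simp only [Pi.add_apply] at h_aux ⊢; omega)
        (by (try simp only [← site_add_single]); refine inBlock_of_le _ hmax fun κ => ?_; have h_aux := congrFun hpk κ; simp only [Pi.add_apply] at h_aux ⊢; omega)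
        (by (try simp only [← site_add_single]); refine inBlock_of_le _ hmax fun κ => ?_; have h_aux := congrFun hpk κ; simp only [Pi.add_apply] at h_aux ⊢; omega)
        (by (try simp only [← site_add_single]); refine inBlock_of_le _ hmax fun κ => ?_; have h_aux := congrFun hpk κ; simp only [Pi.add_apply] at h_aux ⊢; omega)
        (by (try simp only [← site_add_single]); refine inBlock_of_le _ hmax fun κ => ?_; have h_aux := congrFun hpk κ; simp only [Pi.add_apply] at h_aux ⊢; omega)
    · have := hγP μ (site z (pred' k h) + e ρ) (low k h) ν hneν
        (by (try simp only [← site_add_single]); refine inBlock_of_le _ hmax fun κ => ?_; have h_aux := congrFun hpk κ; simp only [Pi.add_apply] at h_aux ⊢; omega)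
        (by (try simp only [← site_add_single]); refine inBlock_of_le _ hmax fun κ => ?_; have h_aux := congrFun hpk κ; simp only [Pi.add_apply] at h_aux ⊢; omega)
        (by (try simp only [← site_add_single]); refine inBlock_of_le _ hmax fun κ => ?_; have h_aux := congrFun hpk κ; simp only [Pi.add_apply] at h_aux ⊢; omega)
        (by (try simp only [← site_add_single]); refine inBlock_of_le _ hmax fun κ => ?_; have h_aux := congrFun hpk κ; simp only [Pi.add_apply] at h_aux ⊢; omega)
        (by (try simp only [← site_add_single]); refine inBlock_of_le _ hmax fun κ => ?_; have h_aux := congrFun hpk κ; simp only [Pi.add_apply] at h_aux ⊢; omega)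
        (by (try simp only [← site_add_single]); refine inBlock_of_le _ hmax fun κ => ?_; have h_aux := congrFun hpk κ; simp only [Pi.add_apply] at h_aux ⊢; omega)
        (by (try simp only [← site_add_single]); refine inBlock_of_le _ hmax fun κ => ?_; have h_aux := congrFun hpk κ; simp only [Pi.add_apply] at h_aux ⊢; omega)
        (by (try simp only [← site_add_single]); refine inBlock_of_le _ hmax fun κ => ?_; have h_aux := congrFun hpk κ; simp only [Pi.add_apply] at h_aux ⊢; omega)
      rwa [add_right_comm _ (e ρ) (e μ)] at this
    · exact hγP ρ _ _ _ hneν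
        (by refine inBlock_of_le _ hmax fun κ => ?_; have h_aux := congrFun hpk κ; simp only [Pi.add_apply] at h_aux ⊢; omega)
        (by (try simp only [← site_add_single]); refine inBlock_of_le _ hmax fun κ => ?_; have h_aux := congrFun hpk κ; simp only [Pi.add_apply] at h_aux ⊢; omega)
        (by (try simp only [← site_add_single]); refine inBlock_of_le _ hmax fun κ => ?_; have h_aux := congrFun hpk κ; simp only [Pi.add_apply] at h_aux ⊢; omega)
        (by (try simp only [← site_add_single]); refine inBlock_of_le _ hmax fun κ => ?_; have h_aux := congrFun hpk κ; simp only [Pi.add_apply] at h_aux ⊢; omega)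
        (by (try simp only [← site_add_single]); refine inBlock_of_le _ hmax fun κ => ?_; have h_aux := congrFun hpk κ; simp only [Pi.add_apply] at h_aux ⊢; omega)
        (by (try simp only [← site_add_single]); refine inBlock_of_le _ hmax fun κ => ?_; have h_aux := congrFun hpk κ; simp only [Pi.add_apply] at h_aux ⊢; omega)
        (by (try simp only [← site_add_single]); refine inBlock_of_le _ hmax fun κ => ?_; have h_aux := congrFun hpk κ; simp only [Pi.add_apply] at h_aux ⊢; omega)
        (by (try simp only [← site_add_single]); refine inBlock_of_le _ hmax fun κ => ?_; have h_aux := congrFun hpk κ; simp only [Pi.add_apply] at h_aux ⊢; omega)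
    · exact hγP ρ (site z (pred' k h) + e μ) (low k h) ν hneν
        (by (try simp only [← site_add_single]); refine inBlock_of_le _ hmax fun κ => ?_; have h_aux := congrFun hpk κ; simp only [Pi.add_apply] at h_aux ⊢; omega)
        (by (try simp only [← site_add_single]); refine inBlock_of_le _ hmax fun κ => ?_; have h_aux := congrFun hpk κ; simp only [Pi.add_apply] at h_aux ⊢; omega)
        (by (try simp only [← site_add_single]); refine inBlock_of_le _ hmax fun κ => ?_; have h_aux := congrFun hpk κ; simp only [Pi.add_apply] at h_aux ⊢; omega)
        (by (try simp only [← site_add_single]); refine inBlock_of_le _ hmax fun κ => ?_; have h_aux := congrFun hpk κ; simp only [Pi.add_apply] at h_aux ⊢; omega)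
        (by (try simp only [← site_add_single]); refine inBlock_of_le _ hmax fun κ => ?_; have h_aux := congrFun hpk κ; simp only [Pi.add_apply] at h_aux ⊢; omega)
        (by (try simp only [← site_add_single]); refine inBlock_of_le _ hmax fun κ => ?_; have h_aux := congrFun hpk κ; simp only [Pi.add_apply] at h_aux ⊢; omega)
        (by (try simp only [← site_add_single]); refine inBlock_of_le _ hmax fun κ => ?_; have h_aux := congrFun hpk κ; simp only [Pi.add_apply] at h_aux ⊢; omega)
        (by (try simp only [← site_add_single]); refine inBlock_of_le _ hmax fun κ => ?_; have h_aux := congrFun hpk κ; simp only [Pi.add_apply] at h_aux ⊢; omega)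
    · exact hγγP μ ρ _ _ _ hneν
        (by refine inBlock_of_le _ hmax fun κ => ?_; have h_aux := congrFun hpk κ; simp only [Pi.add_apply] at h_aux ⊢; omega)
        (by (try simp only [← site_add_single]); refine inBlock_of_le _ hmax fun κ => ?_; have h_aux := congrFun hpk κ; simp only [Pi.add_apply] at h_aux ⊢; omega)
  have gE : GridBnd
      ((plaq (gaugeAct (combGauge U₀ U₁ z) U₁) (site z (pred' k h)) (low k h) ν : R) -
        plaq U₀ (site z (pred' k h)) (low k h) ν)
      ((plaq (gaugeAct (combGauge U₀ U₁ z) U₁) (site z (pred' k h) + e μ) (low k h) ν : R) -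
        plaq U₀ (site z (pred' k h) + e μ) (low k h) ν)
      ((plaq (gaugeAct (combGauge U₀ U₁ z) U₁) (site z (pred' k h) + e ρ) (low k h) ν : R) -
        plaq U₀ (site z (pred' k h) + e ρ) (low k h) ν)
      ((plaq (gaugeAct (combGauge U₀ U₁ z) U₁) (site z (pred' k h) + e μ + e ρ) (low k h) ν : R) -
        plaq U₀ (site z (pred' k h) + e μ + e ρ) (low k h) ν) s γE γγE := by
    refine ⟨?_, ?_, ?_, ?_, ?_, ?_, ?_, ?_, ?_⟩
    · exact hs _ _ _ hneν
        (by refine inBlock_of_le _ hmax fun κ => ?_; have h_aux := congrFun hpk κ; simp only [Pi.add_apply] at h_aux ⊢; omega)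
        (by (try simp only [← site_add_single]); refine inBlock_of_le _ hmax fun κ => ?_; have h_aux := congrFun hpk κ; simp only [Pi.add_apply] at h_aux ⊢; omega)
        (by (try simp only [← site_add_single]); refine inBlock_of_le _ hmax fun κ => ?_; have h_aux := congrFun hpk κ; simp only [Pi.add_apply] at h_aux ⊢; omega)
        (by (try simp only [← site_add_single]); refine inBlock_of_le _ hmax fun κ => ?_; have h_aux := congrFun hpk κ; simp only [Pi.add_apply] at h_aux ⊢; omega)
    · exact hs _ _ _ hneν
        (by (try simp only [← site_add_single]); refine inBlock_of_le _ hmax fun κ => ?_; have h_aux := congrFun hpk κ; simp only [Pi.add_apply] at h_aux ⊢; omega)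
        (by (try simp only [← site_add_single]); refine inBlock_of_le _ hmax fun κ => ?_; have h_aux := congrFun hpk κ; simp only [Pi.add_apply] at h_aux ⊢; omega)
        (by (try simp only [← site_add_single]); refine inBlock_of_le _ hmax fun κ => ?_; have h_aux := congrFun hpk κ; simp only [Pi.add_apply] at h_aux ⊢; omega)
        (by (try simp only [← site_add_single]); refine inBlock_of_le _ hmax fun κ => ?_; have h_aux := congrFun hpk κ; simp only [Pi.add_apply] at h_aux ⊢; omega)
    · exact hs _ _ _ hneν
        (by (try simp only [← site_add_single]); refine inBlock_of_le _ hmax fun κ => ?_; have h_aux := congrFun hpk κ; simp only [Pi.add_apply] at h_aux ⊢; omega)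
        (by (try simp only [← site_add_single]); refine inBlock_of_le _ hmax fun κ => ?_; have h_aux := congrFun hpk κ; simp only [Pi.add_apply] at h_aux ⊢; omega)
        (by (try simp only [← site_add_single]); refine inBlock_of_le _ hmax fun κ => ?_; have h_aux := congrFun hpk κ; simp only [Pi.add_apply] at h_aux ⊢; omega)
        (by (try simp only [← site_add_single]); refine inBlock_of_le _ hmax fun κ => ?_; have h_aux := congrFun hpk κ; simp only [Pi.add_apply] at h_aux ⊢; omega)
    · exact hs _ _ _ hneν
        (by (try simp only [← site_add_single]); refine inBlock_of_le _ hmax fun κ => ?_; have h_aux := congrFun hpk κ; simp only [Pi.add_apply] at h_aux ⊢; omega)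
        (by (try simp only [← site_add_single]); refine inBlock_of_le _ hmax fun κ => ?_; have h_aux := congrFun hpk κ; simp only [Pi.add_apply] at h_aux ⊢; omega)
        (by (try simp only [← site_add_single]); refine inBlock_of_le _ hmax fun κ => ?_; have h_aux := congrFun hpk κ; simp only [Pi.add_apply] at h_aux ⊢; omega)
        (by (try simp only [← site_add_single]); refine inBlock_of_le _ hmax fun κ => ?_; have h_aux := congrFun hpk κ; simp only [Pi.add_apply] at h_aux ⊢; omega)
    · exact hγE μ _ _ _ hneν
        (by refine inBlock_of_le _ hmax fun κ => ?_; have h_aux := congrFun hpk κ; simp only [Pi.add_apply] at h_aux ⊢; omega)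
        (by (try simp only [← site_add_single]); refine inBlock_of_le _ hmax fun κ => ?_; have h_aux := congrFun hpk κ; simp only [Pi.add_apply] at h_aux ⊢; omega)
        (by (try simp only [← site_add_single]); refine inBlock_of_le _ hmax fun κ => ?_; have h_aux := congrFun hpk κ; simp only [Pi.add_apply] at h_aux ⊢; omega)
        (by (try simp only [← site_add_single]); refine inBlock_of_le _ hmax fun κ => ?_; have h_aux := congrFun hpk κ; simp only [Pi.add_apply] at h_aux ⊢; omega)
        (by (try simp only [← site_add_single]); refine inBlock_of_le _ hmax fun κ => ?_; have h_aux := congrFun hpk κ; simp only [Pi.add_apply] at h_aux ⊢; omega)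
        (by (try simp only [← site_add_single]); refine inBlock_of_le _ hmax fun κ => ?_; have h_aux := congrFun hpk κ; simp only [Pi.add_apply] at h_aux ⊢; omega)
        (by (try simp only [← site_add_single]); refine inBlock_of_le _ hmax fun κ => ?_; have h_aux := congrFun hpk κ; simp only [Pi.add_apply] at h_aux ⊢; omega)
        (by (try simp only [← site_add_single]); refine inBlock_of_le _ hmax fun κ => ?_; have h_aux := congrFun hpk κ; simp only [Pi.add_apply] at h_aux ⊢; omega)
    · have := hγE μ (site z (pred' k h) + e ρ) (low k h) ν hneν
        (by (try simp only [← site_add_single]); refine inBlock_of_le _ hmax fun κ => ?_; have h_aux := congrFun hpk κ; simp only [Pi.add_apply] at h_aux ⊢; omega)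
        (by (try simp only [← site_add_single]); refine inBlock_of_le _ hmax fun κ => ?_; have h_aux := congrFun hpk κ; simp only [Pi.add_apply] at h_aux ⊢; omega)
        (by (try simp only [← site_add_single]); refine inBlock_of_le _ hmax fun κ => ?_; have h_aux := congrFun hpk κ; simp only [Pi.add_apply] at h_aux ⊢; omega)
        (by (try simp only [← site_add_single]); refine inBlock_of_le _ hmax fun κ => ?_; have h_aux := congrFun hpk κ; simp only [Pi.add_apply] at h_aux ⊢; omega)
        (by (try simp only [← site_add_single]); refine inBlock_of_le _ hmax fun κ => ?_; have h_aux := congrFun hpk κ; simp only [Pi.add_apply] at h_aux ⊢; omega)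
        (by (try simp only [← site_add_single]); refine inBlock_of_le _ hmax fun κ => ?_; have h_aux := congrFun hpk κ; simp only [Pi.add_apply] at h_aux ⊢; omega)
        (by (try simp only [← site_add_single]); refine inBlock_of_le _ hmax fun κ => ?_; have h_aux := congrFun hpk κ; simp only [Pi.add_apply] at h_aux ⊢; omega)
        (by (try simp only [← site_add_single]); refine inBlock_of_le _ hmax fun κ => ?_; have h_aux := congrFun hpk κ; simp only [Pi.add_apply] at h_aux ⊢; omega)
      rwa [add_right_comm _ (e ρ) (e μ)] at this
    · exact hγE ρ _ _ _ hneν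
        (by refine inBlock_of_le _ hmax fun κ => ?_; have h_aux := congrFun hpk κ; simp only [Pi.add_apply] at h_aux ⊢; omega)
        (by (try simp only [← site_add_single]); refine inBlock_of_le _ hmax fun κ => ?_; have h_aux := congrFun hpk κ; simp only [Pi.add_apply] at h_aux ⊢; omega)
        (by (try simp only [← site_add_single]); refine inBlock_of_le _ hmax fun κ => ?_; have h_aux := congrFun hpk κ; simp only [Pi.add_apply] at h_aux ⊢; omega)
        (by (try simp only [← site_add_single]); refine inBlock_of_le _ hmax fun κ => ?_; have h_aux := congrFun hpk κ; simp only [Pi.add_apply] at h_aux ⊢; omega)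
        (by (try simp only [← site_add_single]); refine inBlock_of_le _ hmax fun κ => ?_; have h_aux := congrFun hpk κ; simp only [Pi.add_apply] at h_aux ⊢; omega)
        (by (try simp only [← site_add_single]); refine inBlock_of_le _ hmax fun κ => ?_; have h_aux := congrFun hpk κ; simp only [Pi.add_apply] at h_aux ⊢; omega)
        (by (try simp only [← site_add_single]); refine inBlock_of_le _ hmax fun κ => ?_; have h_aux := congrFun hpk κ; simp only [Pi.add_apply] at h_aux ⊢; omega)
        (by (try simp only [← site_add_single]); refine inBlock_of_le _ hmax fun κ => ?_; have h_aux := congrFun hpk κ; simp only [Pi.add_apply] at h_aux ⊢; omega)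
    · exact hγE ρ (site z (pred' k h) + e μ) (low k h) ν hneν
        (by (try simp only [← site_add_single]); refine inBlock_of_le _ hmax fun κ => ?_; have h_aux := congrFun hpk κ; simp only [Pi.add_apply] at h_aux ⊢; omega)
        (by (try simp only [← site_add_single]); refine inBlock_of_le _ hmax fun κ => ?_; have h_aux := congrFun hpk κ; simp only [Pi.add_apply] at h_aux ⊢; omega)
        (by (try simp only [← site_add_single]); refine inBlock_of_le _ hmax fun κ => ?_; have h_aux := congrFun hpk κ; simp only [Pi.add_apply] at h_aux ⊢; omega)
        (by (try simp only [← site_add_single]); refine inBlock_of_le _ hmax fun κ => ?_; have h_aux := congrFun hpk κ; simp only [Pi.add_apply] at h_aux ⊢; omega)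
        (by (try simp only [← site_add_single]); refine inBlock_of_le _ hmax fun κ => ?_; have h_aux := congrFun hpk κ; simp only [Pi.add_apply] at h_aux ⊢; omega)
        (by (try simp only [← site_add_single]); refine inBlock_of_le _ hmax fun κ => ?_; have h_aux := congrFun hpk κ; simp only [Pi.add_apply] at h_aux ⊢; omega)
        (by (try simp only [← site_add_single]); refine inBlock_of_le _ hmax fun κ => ?_; have h_aux := congrFun hpk κ; simp only [Pi.add_apply] at h_aux ⊢; omega)
        (by (try simp only [← site_add_single]); refine inBlock_of_le _ hmax fun κ => ?_; have h_aux := congrFun hpk κ; simp only [Pi.add_apply] at h_aux ⊢; omega)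
    · exact hγγE μ ρ _ _ _ hneν
        (by refine inBlock_of_le _ hmax fun κ => ?_; have h_aux := congrFun hpk κ; simp only [Pi.add_apply] at h_aux ⊢; omega)
        (by (try simp only [← site_add_single]); refine inBlock_of_le _ hmax fun κ => ?_; have h_aux := congrFun hpk κ; simp only [Pi.add_apply] at h_aux ⊢; omega)
  -- the first differences of the defect at the foot
  have hYμ : ‖(defect U₀ U₁ z (site z (pred' k h) + e μ) ν : R) - defect U₀ U₁ z (site z (pred' k h)) ν‖ ≤ G :=
    hG μ ν _
        (by refine inBlock_of_le _ hmax fun κ => ?_; have h_aux := congrFun hpk κ; simp only [Pi.add_apply] at h_aux ⊢; omega)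
        (by (try simp only [← site_add_single]); refine inBlock_of_le _ hmax fun κ => ?_; have h_aux := congrFun hpk κ; simp only [Pi.add_apply] at h_aux ⊢; omega)
        (by (try simp only [← site_add_single]); refine inBlock_of_le _ hmax fun κ => ?_; have h_aux := congrFun hpk κ; simp only [Pi.add_apply] at h_aux ⊢; omega)
  have hYρ : ‖(defect U₀ U₁ z (site z (pred' k h) + e ρ) ν : R) - defect U₀ U₁ z (site z (pred' k h)) ν‖ ≤ G :=
    hG ρ ν _
        (by refine inBlock_of_le _ hmax fun κ => ?_; have h_aux := congrFun hpk κ; simp only [Pi.add_apply] at h_aux ⊢; omega)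
        (by (try simp only [← site_add_single]); refine inBlock_of_le _ hmax fun κ => ?_; have h_aux := congrFun hpk κ; simp only [Pi.add_apply] at h_aux ⊢; omega)
        (by (try simp only [← site_add_single]); refine inBlock_of_le _ hmax fun κ => ?_; have h_aux := congrFun hpk κ; simp only [Pi.add_apply] at h_aux ⊢; omega)
  exact norm_dd_four_ladders_le (hU₀ _ _) (hU₀ _ _) (hU₀ _ _) (hU₀ _ _) (hQ _ _ _) (hQ _ _ _) (hQ _ _ _)
    (hQ _ _ _) (hP _ _ _) (hP _ _ _) (hP _ _ _) (hP _ _ _) ga gP gE hb hYμ hYρ hT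

end Across

/-! ## §3  THE FOOT: the `ρ`-difference of the LOCAL tree-direction difference, or zero -/

section Foot

variable [NormOneClass R]

/-- [folklore] THE FOOT for `μ < ν`, `μ ≤ ρ`, `k` tree-like below `μ` (cross length zero): the bonds over `z+k` and
`z+k+e_ρ` are TREE-LIKE below `μ`, so `W(z+k+e_μ) = F(W(z+k))`, `W(z+k+e_ρ+e_μ) = F′(W(z+k+e_ρ))` are LOCAL ladder
steps in direction `μ` (`T4RelativeCombGradient.pred'_add_single_self`), and `Δ_μΔ_ρW(z+k) = [F′(X′−X) − (X′−X)] +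
[F′(X) − F(X)]` is bounded by `secondFoot (C·s) s q₀ τ G γU γP γE` (`norm_foot_le`, with `‖X − 1‖ ≤ C·s` from the
master count `T4RelativeComb.norm_defect_sub_one_le_ladderLen`, `C = (d−1)(L−1)`). -/
theorem norm_second_foot_le {U₀ U₁ : Cfg d R} {z : Site d} {L : ℕ} {s q₀ τ G γU γP γE : ℝ}
    (hU₀ : ∀ x ν, UnitaryLike (U₀ x ν)) (hU₁ : ∀ x ν, UnitaryLike (U₁ x ν))
    (hs : PlaqSup L z (fun y ρ ν =>
      ‖(plaq (gaugeAct (combGauge U₀ U₁ z) U₁) y ρ ν : R) - plaq U₀ y ρ ν‖) s)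
    (hq₀ : PlaqSup L z (fun y ρ ν => ‖(plaq U₀ y ρ ν : R) - 1‖) q₀)
    (hτ : ∀ x ρ, InBlock L z x → InBlock L z (x + e ρ) → ‖(U₀ x ρ : R) - 1‖ ≤ τ)
    (hG : ∀ μ ν x, InBlock L z x → InBlock L z (x + e μ) → InBlock L z (x + e μ + e ν) →
      ‖(defect U₀ U₁ z (x + e μ) ν : R) - defect U₀ U₁ z x ν‖ ≤ G)
    (hγU : ∀ μ x ρ, InBlock L z x → InBlock L z (x + e ρ) → InBlock L z (x + e μ) →
      InBlock L z (x + e μ + e ρ) → ‖(U₀ (x + e μ) ρ : R) - U₀ x ρ‖ ≤ γU)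
    (hγP : ∀ μ y ρ ν', ρ ≠ ν' → InBlock L z y → InBlock L z (y + e ρ) → InBlock L z (y + e ν') →
      InBlock L z (y + e ρ + e ν') → InBlock L z (y + e μ) → InBlock L z (y + e μ + e ρ) →
      InBlock L z (y + e μ + e ν') → InBlock L z (y + e μ + e ρ + e ν') →
      ‖(plaq U₀ (y + e μ) ρ ν' : R) - plaq U₀ y ρ ν'‖ ≤ γP)
    (hγE : ∀ μ y ρ ν', ρ ≠ ν' → InBlock L z y → InBlock L z (y + e ρ) → InBlock L z (y + e ν') →
      InBlock L z (y + e ρ + e ν') → InBlock L z (y + e μ) → InBlock L z (y + e μ + e ρ) →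
      InBlock L z (y + e μ + e ν') → InBlock L z (y + e μ + e ρ + e ν') →
      ‖((plaq (gaugeAct (combGauge U₀ U₁ z) U₁) (y + e μ) ρ ν' : R) - plaq U₀ (y + e μ) ρ ν') -
          ((plaq (gaugeAct (combGauge U₀ U₁ z) U₁) y ρ ν' : R) - plaq U₀ y ρ ν')‖ ≤ γE)
    (hs0 : 0 ≤ s) {k : Fin d → ℕ} {μ ρ ν : Fin d} (hkμ : IsTree k μ) (hμν : (μ : ℕ) < ν) (hμρ : (μ : ℕ) ≤ ρ)
    (hmax : ∀ κ, (k + Pi.single μ 1 + Pi.single ρ 1 + Pi.single ν 1 : Fin d → ℕ) κ < L) :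
    ‖(defect U₀ U₁ z (site z (k + Pi.single μ 1 + Pi.single ρ 1)) ν : R) -
        defect U₀ U₁ z (site z (k + Pi.single μ 1)) ν - defect U₀ U₁ z (site z (k + Pi.single ρ 1)) ν +
        defect U₀ U₁ z (site z k) ν‖ ≤
      secondFoot (((d : ℝ) - 1) * ((L : ℝ) - 1) * s) s q₀ τ G γU γP γE := by
  have hg := unitaryLike_combGauge hU₀ hU₁ z
  have hQ : ∀ y ρ' ν', UnitaryLike (plaq (gaugeAct (combGauge U₀ U₁ z) U₁) y ρ' ν') := fun y ρ' ν' =>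
    unitaryLike_plaq (unitaryLike_gaugeAct hg hU₁) _ _ _
  have hP : ∀ y ρ' ν', UnitaryLike (plaq U₀ y ρ' ν') := fun y ρ' ν' => unitaryLike_plaq hU₀ _ _ _
  have hneν : μ ≠ ν := fun h0 => by rw [h0] at hμν; exact lt_irrefl _ hμν
  have hk : ∀ κ, k κ < L := fun κ => lt_of_le_of_lt (by simp only [Pi.add_apply]; omega) (hmax κ)
  have hkν : k ν + 1 < L := by
    have := hmax ν; simp only [Pi.add_apply, Pi.single_eq_same] at this; omega
  have hX : ‖(defect U₀ U₁ z (site z k) ν : R) - 1‖ ≤ ((d : ℝ) - 1) * ((L : ℝ) - 1) * s :=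
    (norm_defect_sub_one_le_ladderLen hU₀ hU₁ hs k hk ν hkν).trans
      (mul_le_mul_of_nonneg_right (ladderLen_le hk ν) hs0)
  -- the two LOCAL ladder squares `(z+k; μ, ν)` and `(z+k+e_ρ; μ, ν)`
  have hk'μ : IsTree (k + Pi.single ρ 1) μ := isTree_add_single_of_le hkμ hμρ
  have h1 : ∃ ρ', (k + Pi.single μ 1 : Fin d → ℕ) ρ' ≠ 0 :=
    ⟨μ, by simp only [Pi.add_apply, Pi.single_eq_same]; omega⟩
  have h2 : ∃ ρ', (k + Pi.single ρ 1 + Pi.single μ 1 : Fin d → ℕ) ρ' ≠ 0 :=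
    ⟨μ, by simp only [Pi.add_apply, Pi.single_eq_same]; omega⟩
  have e1 := defect_rung_eq_ladderMap U₀ U₁ z (k + Pi.single μ 1) h1 ν
    (by rw [low_add_single_self hkμ h1]; exact hμν)
  rw [low_add_single_self hkμ h1, pred'_add_single_self hkμ h1] at e1
  have e2 := defect_rung_eq_ladderMap U₀ U₁ z (k + Pi.single ρ 1 + Pi.single μ 1) h2 ν
    (by rw [low_add_single_self hk'μ h2]; exact hμν)
  rw [low_add_single_self hk'μ h2, pred'_add_single_self hk'μ h2] at e2
  rw [show k + Pi.single μ 1 + Pi.single ρ 1 = k + Pi.single ρ 1 + Pi.single μ 1 from add_right_comm _ _ _]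
  simp only [site_add_single] at e1 e2 ⊢
  rw [e2, e1]
  refine norm_foot_le (hU₀ _ _) (hU₀ _ _) (hQ _ _ _) (hP _ _ _) (hP _ _ _) (unitaryLike_defect hU₀ hU₁ z _ _) _
    ?_ ?_ ?_ ?_ ?_ ?_ hX ?_ ?_
  · exact hG ρ ν _
      (by refine inBlock_of_le _ hmax fun κ => ?_; simp only [Pi.add_apply]; omega)
      (by (try simp only [← site_add_single]); refine inBlock_of_le _ hmax fun κ => ?_; simp only [Pi.add_apply]; omega)
      (by (try simp only [← site_add_single]); refine inBlock_of_le _ hmax fun κ => ?_; simp only [Pi.add_apply]; omega)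
  · exact hs _ _ _ hneν
      (by refine inBlock_of_le _ hmax fun κ => ?_; simp only [Pi.add_apply]; omega)
      (by (try simp only [← site_add_single]); refine inBlock_of_le _ hmax fun κ => ?_; simp only [Pi.add_apply]; omega)
      (by (try simp only [← site_add_single]); refine inBlock_of_le _ hmax fun κ => ?_; simp only [Pi.add_apply]; omega)
      (by (try simp only [← site_add_single]); refine inBlock_of_le _ hmax fun κ => ?_; simp only [Pi.add_apply]; omega)
  · exact hs _ _ _ hneν
      (by (try simp only [← site_add_single]); refine inBlock_of_le _ hmax fun κ => ?_; simp only [Pi.add_apply]; omega)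
      (by (try simp only [← site_add_single]); refine inBlock_of_le _ hmax fun κ => ?_; simp only [Pi.add_apply]; omega)
      (by (try simp only [← site_add_single]); refine inBlock_of_le _ hmax fun κ => ?_; simp only [Pi.add_apply]; omega)
      (by (try simp only [← site_add_single]); refine inBlock_of_le _ hmax fun κ => ?_; simp only [Pi.add_apply]; omega)
  · exact hq₀ _ _ _ hneν
      (by (try simp only [← site_add_single]); refine inBlock_of_le _ hmax fun κ => ?_; simp only [Pi.add_apply]; omega)
      (by (try simp only [← site_add_single]); refine inBlock_of_le _ hmax fun κ => ?_; simp only [Pi.add_apply]; omega)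
      (by (try simp only [← site_add_single]); refine inBlock_of_le _ hmax fun κ => ?_; simp only [Pi.add_apply]; omega)
      (by (try simp only [← site_add_single]); refine inBlock_of_le _ hmax fun κ => ?_; simp only [Pi.add_apply]; omega)
  · exact hτ _ _
      (by (try simp only [← site_add_single]); refine inBlock_of_le _ hmax fun κ => ?_; simp only [Pi.add_apply]; omega)
      (by (try simp only [← site_add_single]); refine inBlock_of_le _ hmax fun κ => ?_; simp only [Pi.add_apply]; omega)
  · exact hγU ρ _ _
      (by refine inBlock_of_le _ hmax fun κ => ?_; simp only [Pi.add_apply]; omega)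
      (by (try simp only [← site_add_single]); refine inBlock_of_le _ hmax fun κ => ?_; simp only [Pi.add_apply]; omega)
      (by (try simp only [← site_add_single]); refine inBlock_of_le _ hmax fun κ => ?_; simp only [Pi.add_apply]; omega)
      (by (try simp only [← site_add_single]); refine inBlock_of_le _ hmax fun κ => ?_; simp only [Pi.add_apply]; omega)
  · exact hγE ρ _ _ _ hneν
      (by refine inBlock_of_le _ hmax fun κ => ?_; simp only [Pi.add_apply]; omega)
      (by (try simp only [← site_add_single]); refine inBlock_of_le _ hmax fun κ => ?_; simp only [Pi.add_apply]; omega)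
      (by (try simp only [← site_add_single]); refine inBlock_of_le _ hmax fun κ => ?_; simp only [Pi.add_apply]; omega)
      (by (try simp only [← site_add_single]); refine inBlock_of_le _ hmax fun κ => ?_; simp only [Pi.add_apply]; omega)
      (by (try simp only [← site_add_single]); refine inBlock_of_le _ hmax fun κ => ?_; simp only [Pi.add_apply]; omega)
      (by (try simp only [← site_add_single]); refine inBlock_of_le _ hmax fun κ => ?_; simp only [Pi.add_apply]; omega)
      (by (try simp only [← site_add_single]); refine inBlock_of_le _ hmax fun κ => ?_; simp only [Pi.add_apply]; omega)
      (by (try simp only [← site_add_single]); refine inBlock_of_le _ hmax fun κ => ?_; simp only [Pi.add_apply]; omega)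
  · exact hγP ρ _ _ _ hneν
      (by refine inBlock_of_le _ hmax fun κ => ?_; simp only [Pi.add_apply]; omega)
      (by (try simp only [← site_add_single]); refine inBlock_of_le _ hmax fun κ => ?_; simp only [Pi.add_apply]; omega)
      (by (try simp only [← site_add_single]); refine inBlock_of_le _ hmax fun κ => ?_; simp only [Pi.add_apply]; omega)
      (by (try simp only [← site_add_single]); refine inBlock_of_le _ hmax fun κ => ?_; simp only [Pi.add_apply]; omega)
      (by (try simp only [← site_add_single]); refine inBlock_of_le _ hmax fun κ => ?_; simp only [Pi.add_apply]; omega)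
      (by (try simp only [← site_add_single]); refine inBlock_of_le _ hmax fun κ => ?_; simp only [Pi.add_apply]; omega)
      (by (try simp only [← site_add_single]); refine inBlock_of_le _ hmax fun κ => ?_; simp only [Pi.add_apply]; omega)
      (by (try simp only [← site_add_single]); refine inBlock_of_le _ hmax fun κ => ?_; simp only [Pi.add_apply]; omega)

end Foot

/-! ## §4  UNROLLED: the mixed second difference of the comb defect on a block -/

/-- [folklore] (arith) THE SECOND-DIFFERENCE BOUND OF THE DEFECT: `secondFoot(C·s, …) + C·secondSrc(s, C·s, …)`. -/
def secondW (C s q₀ τ G γU γP γE γγU γγP γγE : ℝ) : ℝ :=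
  secondFoot (C * s) s q₀ τ G γU γP γE + C * secondSrc s (C * s) G γU γP γE γγU γγP γγE

/-- [folklore] (arith) THE SECOND-DIFFERENCE BOUND OF THE DEVIATION `D = (W − 1)·U₀`:
`secondW + 2·G·γU + C·s·γγU` (product rule). -/
def secondDev (C s q₀ τ G γU γP γE γγU γγP γγE : ℝ) : ℝ :=
  secondW C s q₀ τ G γU γP γE γγU γγP γγE + 2 * G * γU + C * s * γγU

section Arith

variable {C s q₀ τ G γU γP γE γγU γγP γγE : ℝ}

/-- [folklore] (arith) -/
theorem secondSrc_nonneg {b : ℝ} (hs : 0 ≤ s) (hb : 0 ≤ b) (hG : 0 ≤ G) (hγU : 0 ≤ γU) (hγP : 0 ≤ γP)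
    (hγE : 0 ≤ γE) (hγγU : 0 ≤ γγU) (hγγP : 0 ≤ γγP) (hγγE : 0 ≤ γγE) :
    0 ≤ secondSrc s b G γU γP γE γγU γγP γγE := by
  unfold secondSrc mapGrad mapHess devHess; positivity

/-- [folklore] (arith) -/
theorem secondFoot_nonneg {b : ℝ} (hb : 0 ≤ b) (hs : 0 ≤ s) (hq : 0 ≤ q₀) (hτ : 0 ≤ τ) (hG : 0 ≤ G)
    (hγU : 0 ≤ γU) (hγP : 0 ≤ γP) (hγE : 0 ≤ γE) : 0 ≤ secondFoot b s q₀ τ G γU γP γE := by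
  unfold secondFoot; positivity

/-- [folklore] (arith) -/
theorem secondW_nonneg (hC : 0 ≤ C) (hs : 0 ≤ s) (hq : 0 ≤ q₀) (hτ : 0 ≤ τ) (hG : 0 ≤ G) (hγU : 0 ≤ γU)
    (hγP : 0 ≤ γP) (hγE : 0 ≤ γE) (hγγU : 0 ≤ γγU) (hγγP : 0 ≤ γγP) (hγγE : 0 ≤ γγE) :
    0 ≤ secondW C s q₀ τ G γU γP γE γγU γγP γγE := by
  have h1 := secondFoot_nonneg (mul_nonneg hC hs) hs hq hτ hG hγU hγP hγE
  have h2 := secondSrc_nonneg hs (mul_nonneg hC hs) hG hγU hγP hγE hγγU hγγP hγγE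
  unfold secondW; positivity

/-- [folklore] (arith) -/
theorem secondDev_nonneg (hC : 0 ≤ C) (hs : 0 ≤ s) (hq : 0 ≤ q₀) (hτ : 0 ≤ τ) (hG : 0 ≤ G) (hγU : 0 ≤ γU)
    (hγP : 0 ≤ γP) (hγE : 0 ≤ γE) (hγγU : 0 ≤ γγU) (hγγP : 0 ≤ γγP) (hγγE : 0 ≤ γγE) :
    0 ≤ secondDev C s q₀ τ G γU γP γE γγU γγP γγE := by
  have h1 := secondW_nonneg hC hs hq hτ hG hγU hγP hγE hγγU hγγP hγγE
  unfold secondDev; positivity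

end Arith

section Unrolled

variable [NormOneClass R]

/-- [folklore] THE MIXED SECOND DIFFERENCE, UNROLLED, for `μ ≤ ρ` (induction on the cross length `crossLen k μ ν`,
one `norm_second_step_le` per square below `min(μ, ν)` — there `μ, ρ, ν` all lie above the peeling direction —, the
foot being `norm_second_foot_le` (`μ < ν`) or zero (`ν ≤ μ ≤ ρ`, `second_diff_eq_zero_of_isTree`)):
`‖Δ_μΔ_ρW(z+k)‖ ≤ secondFoot(C·s, …) + crossLen·secondSrc(s, C·s, …)`. -/
theorem norm_second_diff_le_aux {U₀ U₁ : Cfg d R} {z : Site d} {L : ℕ}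
    {s q₀ τ G γU γP γE γγU γγP γγE : ℝ}
    (hU₀ : ∀ x ν, UnitaryLike (U₀ x ν)) (hU₁ : ∀ x ν, UnitaryLike (U₁ x ν))
    (hs : PlaqSup L z (fun y ρ ν =>
      ‖(plaq (gaugeAct (combGauge U₀ U₁ z) U₁) y ρ ν : R) - plaq U₀ y ρ ν‖) s)
    (hq₀ : PlaqSup L z (fun y ρ ν => ‖(plaq U₀ y ρ ν : R) - 1‖) q₀)
    (hτ : ∀ x ρ, InBlock L z x → InBlock L z (x + e ρ) → ‖(U₀ x ρ : R) - 1‖ ≤ τ)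
    (hG : ∀ μ ν x, InBlock L z x → InBlock L z (x + e μ) → InBlock L z (x + e μ + e ν) →
      ‖(defect U₀ U₁ z (x + e μ) ν : R) - defect U₀ U₁ z x ν‖ ≤ G)
    (hγU : ∀ μ x ρ, InBlock L z x → InBlock L z (x + e ρ) → InBlock L z (x + e μ) →
      InBlock L z (x + e μ + e ρ) → ‖(U₀ (x + e μ) ρ : R) - U₀ x ρ‖ ≤ γU)
    (hγP : ∀ μ y ρ ν', ρ ≠ ν' → InBlock L z y → InBlock L z (y + e ρ) → InBlock L z (y + e ν') →
      InBlock L z (y + e ρ + e ν') → InBlock L z (y + e μ) → InBlock L z (y + e μ + e ρ) →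
      InBlock L z (y + e μ + e ν') → InBlock L z (y + e μ + e ρ + e ν') →
      ‖(plaq U₀ (y + e μ) ρ ν' : R) - plaq U₀ y ρ ν'‖ ≤ γP)
    (hγE : ∀ μ y ρ ν', ρ ≠ ν' → InBlock L z y → InBlock L z (y + e ρ) → InBlock L z (y + e ν') →
      InBlock L z (y + e ρ + e ν') → InBlock L z (y + e μ) → InBlock L z (y + e μ + e ρ) →
      InBlock L z (y + e μ + e ν') → InBlock L z (y + e μ + e ρ + e ν') →
      ‖((plaq (gaugeAct (combGauge U₀ U₁ z) U₁) (y + e μ) ρ ν' : R) - plaq U₀ (y + e μ) ρ ν') -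
          ((plaq (gaugeAct (combGauge U₀ U₁ z) U₁) y ρ ν' : R) - plaq U₀ y ρ ν')‖ ≤ γE)
    (hγγU : ∀ μ ρ x α, InBlock L z x → InBlock L z (x + e μ + e ρ + e α) →
      ‖(U₀ (x + e μ + e ρ) α : R) - U₀ (x + e μ) α - U₀ (x + e ρ) α + U₀ x α‖ ≤ γγU)
    (hγγP : ∀ μ ρ y α ν', α ≠ ν' → InBlock L z y → InBlock L z (y + e μ + e ρ + e α + e ν') →
      ‖(plaq U₀ (y + e μ + e ρ) α ν' : R) - plaq U₀ (y + e μ) α ν' - plaq U₀ (y + e ρ) α ν' +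
          plaq U₀ y α ν'‖ ≤ γγP)
    (hγγE : ∀ μ ρ y α ν', α ≠ ν' → InBlock L z y → InBlock L z (y + e μ + e ρ + e α + e ν') →
      ‖((plaq (gaugeAct (combGauge U₀ U₁ z) U₁) (y + e μ + e ρ) α ν' : R) - plaq U₀ (y + e μ + e ρ) α ν') -
          ((plaq (gaugeAct (combGauge U₀ U₁ z) U₁) (y + e μ) α ν' : R) - plaq U₀ (y + e μ) α ν') -
          ((plaq (gaugeAct (combGauge U₀ U₁ z) U₁) (y + e ρ) α ν' : R) - plaq U₀ (y + e ρ) α ν') +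
          ((plaq (gaugeAct (combGauge U₀ U₁ z) U₁) y α ν' : R) - plaq U₀ y α ν')‖ ≤ γγE)
    (hs0 : 0 ≤ s) (hq0 : 0 ≤ q₀) (hτ0 : 0 ≤ τ) (hG0 : 0 ≤ G) (hγU0 : 0 ≤ γU) (hγP0 : 0 ≤ γP) (hγE0 : 0 ≤ γE)
    {μ ρ ν : Fin d} (hμρ : (μ : ℕ) ≤ ρ) (k : Fin d → ℕ)
    (hmax : ∀ κ, (k + Pi.single μ 1 + Pi.single ρ 1 + Pi.single ν 1 : Fin d → ℕ) κ < L) :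
    ‖(defect U₀ U₁ z (site z (k + Pi.single μ 1 + Pi.single ρ 1)) ν : R) -
        defect U₀ U₁ z (site z (k + Pi.single μ 1)) ν - defect U₀ U₁ z (site z (k + Pi.single ρ 1)) ν +
        defect U₀ U₁ z (site z k) ν‖ ≤
      secondFoot (((d : ℝ) - 1) * ((L : ℝ) - 1) * s) s q₀ τ G γU γP γE +
        (crossLen k μ ν : ℝ) *
          secondSrc s (((d : ℝ) - 1) * ((L : ℝ) - 1) * s) G γU γP γE γγU γγP γγE := by
  have hd1 : (1 : ℝ) ≤ d := by have := μ.isLt; exact_mod_cast (show 1 ≤ d by omega)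
  have hL1 : (1 : ℝ) ≤ L := by have := hmax ν; exact_mod_cast (show 1 ≤ L by omega)
  have hC0 : 0 ≤ ((d : ℝ) - 1) * ((L : ℝ) - 1) := mul_nonneg (by linarith) (by linarith)
  have hfoot0 : 0 ≤ secondFoot (((d : ℝ) - 1) * ((L : ℝ) - 1) * s) s q₀ τ G γU γP γE :=
    secondFoot_nonneg (mul_nonneg hC0 hs0) hs0 hq0 hτ0 hG0 hγU0 hγP0 hγE0
  suffices H : ∀ N (k : Fin d → ℕ), crossLen k μ ν = N →
      (∀ κ, (k + Pi.single μ 1 + Pi.single ρ 1 + Pi.single ν 1 : Fin d → ℕ) κ < L) →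
      ‖(defect U₀ U₁ z (site z (k + Pi.single μ 1 + Pi.single ρ 1)) ν : R) -
          defect U₀ U₁ z (site z (k + Pi.single μ 1)) ν - defect U₀ U₁ z (site z (k + Pi.single ρ 1)) ν +
          defect U₀ U₁ z (site z k) ν‖ ≤
        secondFoot (((d : ℝ) - 1) * ((L : ℝ) - 1) * s) s q₀ τ G γU γP γE +
          (N : ℝ) * secondSrc s (((d : ℝ) - 1) * ((L : ℝ) - 1) * s) G γU γP γE γγU γγP γγE from
    H _ k rfl hmax
  intro N
  induction N with
  | zero =>
      intro k hN hmax
      have htree := eq_zero_of_crossLen_eq_zero hN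
      simp only [Nat.cast_zero, zero_mul, add_zero]
      rcases lt_or_ge (μ : ℕ) ν with hlt | hle
      · have hkμ : IsTree k μ := fun κ hκ => htree κ hκ (hκ.trans hlt)
        exact norm_second_foot_le hU₀ hU₁ hs hq₀ hτ hG hγU hγP hγE hs0 hkμ hlt hμρ hmax
      · have hkν : IsTree k ν := fun κ hκ => htree κ (lt_of_lt_of_le hκ hle) hκ
        rw [second_diff_eq_zero_of_isTree U₀ U₁ z hkν hle (hle.trans hμρ), norm_zero]
        exact hfoot0
  | succ N ih =>
      intro k hN hmax
      obtain ⟨h, hμ', hν'⟩ := low_lt_of_crossLen_ne_zero (k := k) (μ := μ) (ν := ν) (by omega)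
      have hρ' : ((low k h : Fin d) : ℕ) < ρ := lt_of_lt_of_le hμ' hμρ
      have hpN : crossLen (pred' k h) μ ν = N := by have := crossLen_eq_succ k h hμ' hν'; omega
      have hmaxp : ∀ κ, (pred' k h + Pi.single μ 1 + Pi.single ρ 1 + Pi.single ν 1 : Fin d → ℕ) κ < L :=
        fun κ => lt_of_le_of_lt (by have := pred'_le k h κ; simp only [Pi.add_apply]; omega) (hmax κ)
      have hp : ∀ κ, pred' k h κ < L := fun κ =>
        lt_of_le_of_lt (by simp only [Pi.add_apply]; omega) (hmaxp κ)
      have hpν : pred' k h ν + 1 < L := by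
        have := hmaxp ν; simp only [Pi.add_apply, Pi.single_eq_same] at this; omega
      have hb : ‖(defect U₀ U₁ z (site z (pred' k h)) ν : R) - 1‖ ≤ ((d : ℝ) - 1) * ((L : ℝ) - 1) * s :=
        (norm_defect_sub_one_le_ladderLen hU₀ hU₁ hs (pred' k h) hp ν hpν).trans
          (mul_le_mul_of_nonneg_right (ladderLen_le hp ν) hs0)
      have IH := ih (pred' k h) hpN hmaxp
      simp only [site_add_single] at IH
      calc _ ≤ _ := norm_second_step_le hU₀ hU₁ hs hG hγU hγP hγE hγγU hγγP hγγE k h hμ' hρ' hν' hmax hb IH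
        _ = _ := by push_cast; ring

/-- [folklore] **THE MIXED SECOND DIFFERENCES OF THE COMB DEFECT ON A BLOCK** (sup form; one block, unitary-like pairs; any two
directions `μ, ρ`, incl. `μ = ρ`).  For every `y ∈ B(z)` with `y + e_μ + e_ρ + e_ν ∈ B(z)`:
`‖W(y+e_μ+e_ρ) − W(y+e_μ) − W(y+e_ρ) + W(y)‖ ≤ secondW C s q₀ τ G γU γP γE γγU γγP γγE` (`‖W⟨x,·+e_ν⟩‖`-type
quantities, `C = (d−1)(L−1)`): SECOND ORDER in the data in the sense of §6.  All inputs are HYPOTHESES (block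
sups): `s` (gauge-fixed deviation), `q₀` (base curvature), `τ` (base bond deviation), `G` (first differences of the
defect — the datum of `T4RelativeCombGradient.norm_gradient_le(_raw)`), `γU, γP, γE` (first plain differences of
base bonds / base plaquettes / gauge-fixed deviation field, ALL directions) and the SECOND plain differences `γγU,
γγP, γγE`.  Nothing about covariant derivatives, Hölder quotients in Bałaban's format, or patching is asserted. -/
theorem norm_second_diff_le {U₀ U₁ : Cfg d R} {z : Site d} {L : ℕ}
    {s q₀ τ G γU γP γE γγU γγP γγE : ℝ}
    (hU₀ : ∀ x ν, UnitaryLike (U₀ x ν)) (hU₁ : ∀ x ν, UnitaryLike (U₁ x ν))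
    (hs : PlaqSup L z (fun y ρ ν =>
      ‖(plaq (gaugeAct (combGauge U₀ U₁ z) U₁) y ρ ν : R) - plaq U₀ y ρ ν‖) s)
    (hq₀ : PlaqSup L z (fun y ρ ν => ‖(plaq U₀ y ρ ν : R) - 1‖) q₀)
    (hτ : ∀ x ρ, InBlock L z x → InBlock L z (x + e ρ) → ‖(U₀ x ρ : R) - 1‖ ≤ τ)
    (hG : ∀ μ ν x, InBlock L z x → InBlock L z (x + e μ) → InBlock L z (x + e μ + e ν) →
      ‖(defect U₀ U₁ z (x + e μ) ν : R) - defect U₀ U₁ z x ν‖ ≤ G)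
    (hγU : ∀ μ x ρ, InBlock L z x → InBlock L z (x + e ρ) → InBlock L z (x + e μ) →
      InBlock L z (x + e μ + e ρ) → ‖(U₀ (x + e μ) ρ : R) - U₀ x ρ‖ ≤ γU)
    (hγP : ∀ μ y ρ ν', ρ ≠ ν' → InBlock L z y → InBlock L z (y + e ρ) → InBlock L z (y + e ν') →
      InBlock L z (y + e ρ + e ν') → InBlock L z (y + e μ) → InBlock L z (y + e μ + e ρ) →
      InBlock L z (y + e μ + e ν') → InBlock L z (y + e μ + e ρ + e ν') →
      ‖(plaq U₀ (y + e μ) ρ ν' : R) - plaq U₀ y ρ ν'‖ ≤ γP)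
    (hγE : ∀ μ y ρ ν', ρ ≠ ν' → InBlock L z y → InBlock L z (y + e ρ) → InBlock L z (y + e ν') →
      InBlock L z (y + e ρ + e ν') → InBlock L z (y + e μ) → InBlock L z (y + e μ + e ρ) →
      InBlock L z (y + e μ + e ν') → InBlock L z (y + e μ + e ρ + e ν') →
      ‖((plaq (gaugeAct (combGauge U₀ U₁ z) U₁) (y + e μ) ρ ν' : R) - plaq U₀ (y + e μ) ρ ν') -
          ((plaq (gaugeAct (combGauge U₀ U₁ z) U₁) y ρ ν' : R) - plaq U₀ y ρ ν')‖ ≤ γE)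
    (hγγU : ∀ μ ρ x α, InBlock L z x → InBlock L z (x + e μ + e ρ + e α) →
      ‖(U₀ (x + e μ + e ρ) α : R) - U₀ (x + e μ) α - U₀ (x + e ρ) α + U₀ x α‖ ≤ γγU)
    (hγγP : ∀ μ ρ y α ν', α ≠ ν' → InBlock L z y → InBlock L z (y + e μ + e ρ + e α + e ν') →
      ‖(plaq U₀ (y + e μ + e ρ) α ν' : R) - plaq U₀ (y + e μ) α ν' - plaq U₀ (y + e ρ) α ν' +
          plaq U₀ y α ν'‖ ≤ γγP)
    (hγγE : ∀ μ ρ y α ν', α ≠ ν' → InBlock L z y → InBlock L z (y + e μ + e ρ + e α + e ν') →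
      ‖((plaq (gaugeAct (combGauge U₀ U₁ z) U₁) (y + e μ + e ρ) α ν' : R) - plaq U₀ (y + e μ + e ρ) α ν') -
          ((plaq (gaugeAct (combGauge U₀ U₁ z) U₁) (y + e μ) α ν' : R) - plaq U₀ (y + e μ) α ν') -
          ((plaq (gaugeAct (combGauge U₀ U₁ z) U₁) (y + e ρ) α ν' : R) - plaq U₀ (y + e ρ) α ν') +
          ((plaq (gaugeAct (combGauge U₀ U₁ z) U₁) y α ν' : R) - plaq U₀ y α ν')‖ ≤ γγE)
    (hs0 : 0 ≤ s) (hq0 : 0 ≤ q₀) (hτ0 : 0 ≤ τ) (hG0 : 0 ≤ G) (hγU0 : 0 ≤ γU) (hγP0 : 0 ≤ γP) (hγE0 : 0 ≤ γE)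
    (hγγU0 : 0 ≤ γγU) (hγγP0 : 0 ≤ γγP) (hγγE0 : 0 ≤ γγE)
    (μ ρ ν : Fin d) (y : Site d) (hy : InBlock L z y) (hy' : InBlock L z (y + e μ + e ρ + e ν)) :
    ‖(defect U₀ U₁ z (y + e μ + e ρ) ν : R) - defect U₀ U₁ z (y + e μ) ν - defect U₀ U₁ z (y + e ρ) ν +
        defect U₀ U₁ z y ν‖ ≤
      secondW (((d : ℝ) - 1) * ((L : ℝ) - 1)) s q₀ τ G γU γP γE γγU γγP γγE := by
  obtain ⟨k, hk, rfl⟩ := exists_offset_of_inBlock hy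
  have hmax : ∀ κ, (k + Pi.single μ 1 + Pi.single ρ 1 + Pi.single ν 1 : Fin d → ℕ) κ < L := by
    rw [← site_add_single, ← site_add_single, ← site_add_single, inBlock_site_iff] at hy'; exact hy'
  have hd1 : (1 : ℝ) ≤ d := by have := μ.isLt; exact_mod_cast (show 1 ≤ d by omega)
  have hL1 : (1 : ℝ) ≤ L := by have := hmax ν; exact_mod_cast (show 1 ≤ L by omega)
  have hC0 : 0 ≤ ((d : ℝ) - 1) * ((L : ℝ) - 1) := mul_nonneg (by linarith) (by linarith)
  have hcross : ∀ μ' : Fin d, (crossLen k μ' ν : ℝ) ≤ ((d : ℝ) - 1) * ((L : ℝ) - 1) := fun μ' =>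
    (show (crossLen k μ' ν : ℝ) ≤ ladderLen k ν by exact_mod_cast crossLen_le_ladderLen k μ' ν).trans
      (ladderLen_le hk ν)
  have hsrc0 : 0 ≤ secondSrc s (((d : ℝ) - 1) * ((L : ℝ) - 1) * s) G γU γP γE γγU γγP γγE :=
    secondSrc_nonneg hs0 (mul_nonneg hC0 hs0) hG0 hγU0 hγP0 hγE0 hγγU0 hγγP0 hγγE0
  rcases le_total (μ : ℕ) ρ with hμρ | hρμ
  · have H := norm_second_diff_le_aux hU₀ hU₁ hs hq₀ hτ hG hγU hγP hγE hγγU hγγP hγγE hs0 hq0 hτ0 hG0 hγU0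
      hγP0 hγE0 hμρ k hmax
    simp only [site_add_single] at H
    refine H.trans ?_
    have := mul_le_mul_of_nonneg_right (hcross μ) hsrc0
    unfold secondW; linarith
  · have hmax' : ∀ κ, (k + Pi.single ρ 1 + Pi.single μ 1 + Pi.single ν 1 : Fin d → ℕ) κ < L := by
      intro κ; have := hmax κ; simp only [Pi.add_apply] at this ⊢; omega
    have H := norm_second_diff_le_aux hU₀ hU₁ hs hq₀ hτ hG hγU hγP hγE hγγU hγγP hγγE hs0 hq0 hτ0 hG0 hγU0
      hγP0 hγE0 hρμ k hmax'
    simp only [site_add_single] at H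
    rw [add_right_comm _ (e ρ) (e μ)] at H
    rw [sub_right_comm]
    refine H.trans ?_
    have := mul_le_mul_of_nonneg_right (hcross ρ) hsrc0
    unfold secondW; linarith

end Unrolled

/-! ## §5  THE DISCHARGE of the second-difference slot `σ` of `T4CombHolderWindow.windowData_comb_secondDiff` -/

section Discharge

variable [NormOneClass R] {L : ℕ} {z : Site d}

/-- [folklore] The master sup count at an interior bond, block form: `‖W⟨x, x+e_ν⟩ − 1‖ ≤ C·s`
(`T4RelativeComb.norm_defect_sub_one_le_ladderLen`, `ladderLen_le`). -/
theorem norm_defect_sub_one_le {U₀ U₁ : Cfg d R} {s : ℝ} (hU₀ : ∀ x ν, UnitaryLike (U₀ x ν))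
    (hU₁ : ∀ x ν, UnitaryLike (U₁ x ν))
    (hs : PlaqSup L z (fun y ρ ν =>
      ‖(plaq (gaugeAct (combGauge U₀ U₁ z) U₁) y ρ ν : R) - plaq U₀ y ρ ν‖) s) (hs0 : 0 ≤ s)
    {x : Site d} {ν : Fin d} (hx : InBlock L z x) (hxν : InBlock L z (x + e ν)) :
    ‖(defect U₀ U₁ z x ν : R) - 1‖ ≤ ((d : ℝ) - 1) * ((L : ℝ) - 1) * s := by
  obtain ⟨k, hk, rfl⟩ := exists_offset_of_inBlock hx
  have hν : k ν + 1 < L := by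
    rw [← site_add_single, inBlock_site_iff] at hxν
    simpa using hxν ν
  exact (norm_defect_sub_one_le_ladderLen hU₀ hU₁ hs k hk ν hν).trans
    (mul_le_mul_of_nonneg_right (ladderLen_le hk ν) hs0)

/-- **THE SECOND-DIFFERENCE DATUM `σ` OF THE COMB DEFECT DEVIATION, DISCHARGED** — in exactly the binder shape of the
hypothesis `hσ` of `T4CombHolderWindow.windowData_comb_secondDiff`: for the zero-extended block deviation
`D = blockDev L z g U₀ U₁`, `g` = the relative comb gauge (BY NAME), and interior `y, y+e_μ, y+e_μ+e_ν, y+e_ρ,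
y+e_ρ+e_μ, y+e_ρ+e_μ+e_ν ∈ B(z)`: `‖∂_μD(y+e_ρ; ν) − ∂_μD(y; ν)‖ ≤ secondDev C s q₀ τ G γU γP γE γγU γγP γγE`
(`D = (W − 1)·U₀`, `T4CombHolderWindow.dev_eq_defect`, product rule of §0 with the grid `(C·s, G, secondW)` of
`W − 1` and the grid `(1, γU, γγU)` of `U₀⟨·, ·+e_ν⟩`).  [folklore] -/
theorem norm_second_fdiff_blockDev_le {U₀ U₁ : Cfg d R} {s q₀ τ G γU γP γE γγU γγP γγE : ℝ}
    (hU₀ : ∀ x ν, UnitaryLike (U₀ x ν)) (hU₁ : ∀ x ν, UnitaryLike (U₁ x ν))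
    (hs : PlaqSup L z (fun y ρ ν =>
      ‖(plaq (gaugeAct (combGauge U₀ U₁ z) U₁) y ρ ν : R) - plaq U₀ y ρ ν‖) s)
    (hq₀ : PlaqSup L z (fun y ρ ν => ‖(plaq U₀ y ρ ν : R) - 1‖) q₀)
    (hτ : ∀ x ρ, InBlock L z x → InBlock L z (x + e ρ) → ‖(U₀ x ρ : R) - 1‖ ≤ τ)
    (hG : ∀ μ ν x, InBlock L z x → InBlock L z (x + e μ) → InBlock L z (x + e μ + e ν) →
      ‖(defect U₀ U₁ z (x + e μ) ν : R) - defect U₀ U₁ z x ν‖ ≤ G)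
    (hγU : ∀ μ x ρ, InBlock L z x → InBlock L z (x + e ρ) → InBlock L z (x + e μ) →
      InBlock L z (x + e μ + e ρ) → ‖(U₀ (x + e μ) ρ : R) - U₀ x ρ‖ ≤ γU)
    (hγP : ∀ μ y ρ ν', ρ ≠ ν' → InBlock L z y → InBlock L z (y + e ρ) → InBlock L z (y + e ν') →
      InBlock L z (y + e ρ + e ν') → InBlock L z (y + e μ) → InBlock L z (y + e μ + e ρ) →
      InBlock L z (y + e μ + e ν') → InBlock L z (y + e μ + e ρ + e ν') →
      ‖(plaq U₀ (y + e μ) ρ ν' : R) - plaq U₀ y ρ ν'‖ ≤ γP)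
    (hγE : ∀ μ y ρ ν', ρ ≠ ν' → InBlock L z y → InBlock L z (y + e ρ) → InBlock L z (y + e ν') →
      InBlock L z (y + e ρ + e ν') → InBlock L z (y + e μ) → InBlock L z (y + e μ + e ρ) →
      InBlock L z (y + e μ + e ν') → InBlock L z (y + e μ + e ρ + e ν') →
      ‖((plaq (gaugeAct (combGauge U₀ U₁ z) U₁) (y + e μ) ρ ν' : R) - plaq U₀ (y + e μ) ρ ν') -
          ((plaq (gaugeAct (combGauge U₀ U₁ z) U₁) y ρ ν' : R) - plaq U₀ y ρ ν')‖ ≤ γE)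
    (hγγU : ∀ μ ρ x α, InBlock L z x → InBlock L z (x + e μ + e ρ + e α) →
      ‖(U₀ (x + e μ + e ρ) α : R) - U₀ (x + e μ) α - U₀ (x + e ρ) α + U₀ x α‖ ≤ γγU)
    (hγγP : ∀ μ ρ y α ν', α ≠ ν' → InBlock L z y → InBlock L z (y + e μ + e ρ + e α + e ν') →
      ‖(plaq U₀ (y + e μ + e ρ) α ν' : R) - plaq U₀ (y + e μ) α ν' - plaq U₀ (y + e ρ) α ν' +
          plaq U₀ y α ν'‖ ≤ γγP)
    (hγγE : ∀ μ ρ y α ν', α ≠ ν' → InBlock L z y → InBlock L z (y + e μ + e ρ + e α + e ν') →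
      ‖((plaq (gaugeAct (combGauge U₀ U₁ z) U₁) (y + e μ + e ρ) α ν' : R) - plaq U₀ (y + e μ + e ρ) α ν') -
          ((plaq (gaugeAct (combGauge U₀ U₁ z) U₁) (y + e μ) α ν' : R) - plaq U₀ (y + e μ) α ν') -
          ((plaq (gaugeAct (combGauge U₀ U₁ z) U₁) (y + e ρ) α ν' : R) - plaq U₀ (y + e ρ) α ν') +
          ((plaq (gaugeAct (combGauge U₀ U₁ z) U₁) y α ν' : R) - plaq U₀ y α ν')‖ ≤ γγE)
    (hs0 : 0 ≤ s) (hq0 : 0 ≤ q₀) (hτ0 : 0 ≤ τ) (hG0 : 0 ≤ G) (hγU0 : 0 ≤ γU) (hγP0 : 0 ≤ γP) (hγE0 : 0 ≤ γE)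
    (hγγU0 : 0 ≤ γγU) (hγγP0 : 0 ≤ γγP) (hγγE0 : 0 ≤ γγE)
    (μ ν ρ : Fin d) (y : Site d) (hy : InBlock L z y) (hyμ : InBlock L z (y + e μ))
    (hyμν : InBlock L z (y + e μ + e ν)) (hyρ : InBlock L z (y + e ρ)) (hyρμ : InBlock L z (y + e ρ + e μ))
    (hyρμν : InBlock L z (y + e ρ + e μ + e ν)) :
    ‖fdiff (blockDev L z (combGauge U₀ U₁ z) U₀ U₁) μ (y + e ρ) ν -
        fdiff (blockDev L z (combGauge U₀ U₁ z) U₀ U₁) μ y ν‖ ≤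
      secondDev (((d : ℝ) - 1) * ((L : ℝ) - 1)) s q₀ τ G γU γP γE γγU γγP γγE := by
  -- the remaining corners
  have hyν : InBlock L z (y + e ν) := inBlock_add_of_add_add hy hyμν
  have hyρν : InBlock L z (y + e ρ + e ν) := inBlock_add_of_add_add hyρ hyρμν
  have hyμρ : InBlock L z (y + e μ + e ρ) := by rw [add_right_comm]; exact hyρμ
  have hyμρν : InBlock L z (y + e μ + e ρ + e ν) := by rw [add_right_comm y]; exact hyρμν
  rw [fdiff_apply, fdiff_apply, blockDev_of_inBlock _ _ _ hyρμ hyρμν, blockDev_of_inBlock _ _ _ hyρ hyρν,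
    blockDev_of_inBlock _ _ _ hyμ hyμν, blockDev_of_inBlock _ _ _ hy hyν, dev_eq_defect, dev_eq_defect,
    dev_eq_defect, dev_eq_defect, add_right_comm y (e ρ) (e μ)]
  -- the grid of `W − 1` and the grid of `U₀⟨·, ·+e_ν⟩`
  have hW : ∀ {x : Site d} {ν' : Fin d}, InBlock L z x → InBlock L z (x + e ν') →
      ‖(defect U₀ U₁ z x ν' : R) - 1‖ ≤ ((d : ℝ) - 1) * ((L : ℝ) - 1) * s :=
    fun hx hxν => norm_defect_sub_one_le hU₀ hU₁ hs hs0 hx hxν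
  have gξ : GridBnd ((defect U₀ U₁ z y ν : R) - 1) ((defect U₀ U₁ z (y + e μ) ν : R) - 1)
      ((defect U₀ U₁ z (y + e ρ) ν : R) - 1) ((defect U₀ U₁ z (y + e μ + e ρ) ν : R) - 1)
      (((d : ℝ) - 1) * ((L : ℝ) - 1) * s) G
      (secondW (((d : ℝ) - 1) * ((L : ℝ) - 1)) s q₀ τ G γU γP γE γγU γγP γγE) := by
    refine ⟨hW hy hyν, hW hyμ hyμν, hW hyρ hyρν, hW hyμρ hyμρν, ?_, ?_, ?_, ?_, ?_⟩
    · rw [sub_sub_sub_cancel_right]; exact hG μ ν y hy hyμ hyμν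
    · rw [sub_sub_sub_cancel_right, add_right_comm]; exact hG μ ν (y + e ρ) hyρ hyρμ hyρμν
    · rw [sub_sub_sub_cancel_right]; exact hG ρ ν y hy hyρ hyρν
    · rw [sub_sub_sub_cancel_right]
      exact hG ρ ν (y + e μ) hyμ hyμρ hyμρν
    · rw [show (defect U₀ U₁ z (y + e μ + e ρ) ν : R) - 1 - ((defect U₀ U₁ z (y + e μ) ν : R) - 1) -
          ((defect U₀ U₁ z (y + e ρ) ν : R) - 1) + ((defect U₀ U₁ z y ν : R) - 1) =
        (defect U₀ U₁ z (y + e μ + e ρ) ν : R) - defect U₀ U₁ z (y + e μ) ν - defect U₀ U₁ z (y + e ρ) ν +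
          defect U₀ U₁ z y ν by abel]
      exact norm_second_diff_le hU₀ hU₁ hs hq₀ hτ hG hγU hγP hγE hγγU hγγP hγγE hs0 hq0 hτ0 hG0 hγU0 hγP0 hγE0
        hγγU0 hγγP0 hγγE0 μ ρ ν y hy hyμρν
  have gu : GridBnd (U₀ y ν : R) (U₀ (y + e μ) ν) (U₀ (y + e ρ) ν) (U₀ (y + e μ + e ρ) ν) 1 γU γγU := by
    refine ⟨(hU₀ _ _).1, (hU₀ _ _).1, (hU₀ _ _).1, (hU₀ _ _).1, hγU μ y ν hy hyν hyμ hyμν, ?_,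
      hγU ρ y ν hy hyν hyρ hyρν, hγU ρ (y + e μ) ν hyμ hyμν hyμρ hyμρν, hγγU μ ρ y ν hy hyμρν⟩
    have := hγU μ (y + e ρ) ν hyρ hyρν hyρμ hyρμν
    rwa [add_right_comm _ (e ρ) (e μ)] at this
  exact (gξ.mul gu).dd'.trans (le_of_eq (by simp only [secondDev]; ring))

/-- **WINDOW DATA OF THE COMB DEFECT DEVIATION WITH THE SECOND-DIFFERENCE SLOT DISCHARGED** (interpolated Hölder
entry `(2(G + C·s·γU))^{1−β}·σ^β` with `σ := secondDev …`, `0 ≤ β ≤ 1`): `T4CombHolderWindow.windowData_comb_secondDiff`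
with its hypothesis `hσ` supplied by `norm_second_fdiff_blockDev_le`.  Inputs (block sups, HYPOTHESES): `s, q₀, τ,
G, γU, γP, γE, γγU, γγP, γγE`.  [folklore] -/
theorem windowData_comb_second {U₀ U₁ : Cfg d R} {β s q₀ τ G γU γP γE γγU γγP γγE : ℝ} (hβ0 : 0 ≤ β)
    (hβ1 : β ≤ 1) (hC : 0 ≤ ((d : ℝ) - 1) * ((L : ℝ) - 1))
    (hU₀ : ∀ x ν, UnitaryLike (U₀ x ν)) (hU₁ : ∀ x ν, UnitaryLike (U₁ x ν))
    (hs : PlaqSup L z (fun y ρ ν =>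
      ‖(plaq (gaugeAct (combGauge U₀ U₁ z) U₁) y ρ ν : R) - plaq U₀ y ρ ν‖) s)
    (hq₀ : PlaqSup L z (fun y ρ ν => ‖(plaq U₀ y ρ ν : R) - 1‖) q₀)
    (hτ : ∀ x ρ, InBlock L z x → InBlock L z (x + e ρ) → ‖(U₀ x ρ : R) - 1‖ ≤ τ)
    (hG : ∀ μ ν x, InBlock L z x → InBlock L z (x + e μ) → InBlock L z (x + e μ + e ν) →
      ‖(defect U₀ U₁ z (x + e μ) ν : R) - defect U₀ U₁ z x ν‖ ≤ G)
    (hγU : ∀ μ x ρ, InBlock L z x → InBlock L z (x + e ρ) → InBlock L z (x + e μ) →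
      InBlock L z (x + e μ + e ρ) → ‖(U₀ (x + e μ) ρ : R) - U₀ x ρ‖ ≤ γU)
    (hγP : ∀ μ y ρ ν', ρ ≠ ν' → InBlock L z y → InBlock L z (y + e ρ) → InBlock L z (y + e ν') →
      InBlock L z (y + e ρ + e ν') → InBlock L z (y + e μ) → InBlock L z (y + e μ + e ρ) →
      InBlock L z (y + e μ + e ν') → InBlock L z (y + e μ + e ρ + e ν') →
      ‖(plaq U₀ (y + e μ) ρ ν' : R) - plaq U₀ y ρ ν'‖ ≤ γP)
    (hγE : ∀ μ y ρ ν', ρ ≠ ν' → InBlock L z y → InBlock L z (y + e ρ) → InBlock L z (y + e ν') →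
      InBlock L z (y + e ρ + e ν') → InBlock L z (y + e μ) → InBlock L z (y + e μ + e ρ) →
      InBlock L z (y + e μ + e ν') → InBlock L z (y + e μ + e ρ + e ν') →
      ‖((plaq (gaugeAct (combGauge U₀ U₁ z) U₁) (y + e μ) ρ ν' : R) - plaq U₀ (y + e μ) ρ ν') -
          ((plaq (gaugeAct (combGauge U₀ U₁ z) U₁) y ρ ν' : R) - plaq U₀ y ρ ν')‖ ≤ γE)
    (hγγU : ∀ μ ρ x α, InBlock L z x → InBlock L z (x + e μ + e ρ + e α) →
      ‖(U₀ (x + e μ + e ρ) α : R) - U₀ (x + e μ) α - U₀ (x + e ρ) α + U₀ x α‖ ≤ γγU)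
    (hγγP : ∀ μ ρ y α ν', α ≠ ν' → InBlock L z y → InBlock L z (y + e μ + e ρ + e α + e ν') →
      ‖(plaq U₀ (y + e μ + e ρ) α ν' : R) - plaq U₀ (y + e μ) α ν' - plaq U₀ (y + e ρ) α ν' +
          plaq U₀ y α ν'‖ ≤ γγP)
    (hγγE : ∀ μ ρ y α ν', α ≠ ν' → InBlock L z y → InBlock L z (y + e μ + e ρ + e α + e ν') →
      ‖((plaq (gaugeAct (combGauge U₀ U₁ z) U₁) (y + e μ + e ρ) α ν' : R) - plaq U₀ (y + e μ + e ρ) α ν') -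
          ((plaq (gaugeAct (combGauge U₀ U₁ z) U₁) (y + e μ) α ν' : R) - plaq U₀ (y + e μ) α ν') -
          ((plaq (gaugeAct (combGauge U₀ U₁ z) U₁) (y + e ρ) α ν' : R) - plaq U₀ (y + e ρ) α ν') +
          ((plaq (gaugeAct (combGauge U₀ U₁ z) U₁) y α ν' : R) - plaq U₀ y α ν')‖ ≤ γγE)
    (hs0 : 0 ≤ s) (hq0 : 0 ≤ q₀) (hτ0 : 0 ≤ τ) (hG0 : 0 ≤ G) (hγU0 : 0 ≤ γU) (hγP0 : 0 ≤ γP) (hγE0 : 0 ≤ γE)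
    (hγγU0 : 0 ≤ γγU) (hγγP0 : 0 ≤ γγP) (hγγE0 : 0 ≤ γγE) :
    WindowData L z β (blockDev L z (combGauge U₀ U₁ z) U₀ U₁)
      ⟨((d : ℝ) - 1) * ((L : ℝ) - 1) * s, G + ((d : ℝ) - 1) * ((L : ℝ) - 1) * s * γU,
        (2 * (G + ((d : ℝ) - 1) * ((L : ℝ) - 1) * s * γU)) ^ (1 - β) *
          (secondDev (((d : ℝ) - 1) * ((L : ℝ) - 1)) s q₀ τ G γU γP γE γγU γγP γγE) ^ β⟩ :=
  windowData_comb_secondDiff hβ0 hβ1 hC hU₀ hU₁ hs hs0 hG hG0 hγU hγU0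
    (secondDev_nonneg hC hs0 hq0 hτ0 hG0 hγU0 hγP0 hγE0 hγγU0 hγγP0 hγγE0)
    (fun μ ν ρ y hy hyμ hyμν hyρ hyρμ hyρμν => norm_second_fdiff_blockDev_le hU₀ hU₁ hs hq₀ hτ hG hγU hγP hγE
      hγγU hγγP hγγE hs0 hq0 hτ0 hG0 hγU0 hγP0 hγE0 hγγU0 hγγP0 hγγE0 μ ν ρ y hy hyμ hyμν hyρ hyρμ hyρμν)

variable [NormedAlgebra ℂ R] {F : Type*} [NormedAddCommGroup F] [NormedSpace ℂ F] [CompleteSpace F]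
variable {Fn : Fld d R → F} {𝒦 : Set (Fld d R)} {w r A : ℝ} {β : ℝ} {κ : Win}

/-- **THE COMB INSTANCE OF THE WINDOW TRANSPORT WITH THE INTERPOLATED HÖLDER ENTRY** (`g` := the relative comb gauge,
BY NAME; `T4CombHolderWindow.block_transport_window`): gauge-invariant `Fn` with a WINDOW birth slice, unitary-like
`U₀ ∈ 𝒦`, `U₁`, the block sup data of `windowData_comb_second`, and the resulting window triple
`b = (C·s, G + C·s·γU, (2(G + C·s·γU))^{1−β}·σ^β)`, `σ = secondDev …`, inside the window `N_κ(b) ≤ w` ⟹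
`‖Fn U₁ − Fn U₀‖ ≤ (4A/r)·N_κ(b)` — a window whose Hölder slot is fed by SECOND differences (at the rate of §6),
consumed by the transport chain.  [folklore] -/
theorem block_transport_comb_window_second (hinv : GaugeInvariant (BlockRel L z) Fn)
    (hsl : BirthSlice Fn (wMove L z β) (wN L z β κ) 𝒦 w r A) (hκ : κ.Pos) (hr : 0 < r) (hA : 0 ≤ A)
    {U₀ U₁ : Cfg d R} (hU₀𝒦 : val U₀ ∈ 𝒦) {s q₀ τ G γU γP γE γγU γγP γγE : ℝ} (hβ0 : 0 ≤ β) (hβ1 : β ≤ 1)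
    (hC : 0 ≤ ((d : ℝ) - 1) * ((L : ℝ) - 1))
    (hU₀ : ∀ x ν, UnitaryLike (U₀ x ν)) (hU₁ : ∀ x ν, UnitaryLike (U₁ x ν))
    (hs : PlaqSup L z (fun y ρ ν =>
      ‖(plaq (gaugeAct (combGauge U₀ U₁ z) U₁) y ρ ν : R) - plaq U₀ y ρ ν‖) s)
    (hq₀ : PlaqSup L z (fun y ρ ν => ‖(plaq U₀ y ρ ν : R) - 1‖) q₀)
    (hτ : ∀ x ρ, InBlock L z x → InBlock L z (x + e ρ) → ‖(U₀ x ρ : R) - 1‖ ≤ τ)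
    (hG : ∀ μ ν x, InBlock L z x → InBlock L z (x + e μ) → InBlock L z (x + e μ + e ν) →
      ‖(defect U₀ U₁ z (x + e μ) ν : R) - defect U₀ U₁ z x ν‖ ≤ G)
    (hγU : ∀ μ x ρ, InBlock L z x → InBlock L z (x + e ρ) → InBlock L z (x + e μ) →
      InBlock L z (x + e μ + e ρ) → ‖(U₀ (x + e μ) ρ : R) - U₀ x ρ‖ ≤ γU)
    (hγP : ∀ μ y ρ ν', ρ ≠ ν' → InBlock L z y → InBlock L z (y + e ρ) → InBlock L z (y + e ν') →
      InBlock L z (y + e ρ + e ν') → InBlock L z (y + e μ) → InBlock L z (y + e μ + e ρ) →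
      InBlock L z (y + e μ + e ν') → InBlock L z (y + e μ + e ρ + e ν') →
      ‖(plaq U₀ (y + e μ) ρ ν' : R) - plaq U₀ y ρ ν'‖ ≤ γP)
    (hγE : ∀ μ y ρ ν', ρ ≠ ν' → InBlock L z y → InBlock L z (y + e ρ) → InBlock L z (y + e ν') →
      InBlock L z (y + e ρ + e ν') → InBlock L z (y + e μ) → InBlock L z (y + e μ + e ρ) →
      InBlock L z (y + e μ + e ν') → InBlock L z (y + e μ + e ρ + e ν') →
      ‖((plaq (gaugeAct (combGauge U₀ U₁ z) U₁) (y + e μ) ρ ν' : R) - plaq U₀ (y + e μ) ρ ν') -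
          ((plaq (gaugeAct (combGauge U₀ U₁ z) U₁) y ρ ν' : R) - plaq U₀ y ρ ν')‖ ≤ γE)
    (hγγU : ∀ μ ρ x α, InBlock L z x → InBlock L z (x + e μ + e ρ + e α) →
      ‖(U₀ (x + e μ + e ρ) α : R) - U₀ (x + e μ) α - U₀ (x + e ρ) α + U₀ x α‖ ≤ γγU)
    (hγγP : ∀ μ ρ y α ν', α ≠ ν' → InBlock L z y → InBlock L z (y + e μ + e ρ + e α + e ν') →
      ‖(plaq U₀ (y + e μ + e ρ) α ν' : R) - plaq U₀ (y + e μ) α ν' - plaq U₀ (y + e ρ) α ν' +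
          plaq U₀ y α ν'‖ ≤ γγP)
    (hγγE : ∀ μ ρ y α ν', α ≠ ν' → InBlock L z y → InBlock L z (y + e μ + e ρ + e α + e ν') →
      ‖((plaq (gaugeAct (combGauge U₀ U₁ z) U₁) (y + e μ + e ρ) α ν' : R) - plaq U₀ (y + e μ + e ρ) α ν') -
          ((plaq (gaugeAct (combGauge U₀ U₁ z) U₁) (y + e μ) α ν' : R) - plaq U₀ (y + e μ) α ν') -
          ((plaq (gaugeAct (combGauge U₀ U₁ z) U₁) (y + e ρ) α ν' : R) - plaq U₀ (y + e ρ) α ν') +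
          ((plaq (gaugeAct (combGauge U₀ U₁ z) U₁) y α ν' : R) - plaq U₀ y α ν')‖ ≤ γγE)
    (hs0 : 0 ≤ s) (hq0 : 0 ≤ q₀) (hτ0 : 0 ≤ τ) (hG0 : 0 ≤ G) (hγU0 : 0 ≤ γU) (hγP0 : 0 ≤ γP) (hγE0 : 0 ≤ γE)
    (hγγU0 : 0 ≤ γγU) (hγγP0 : 0 ≤ γγP) (hγγE0 : 0 ≤ γγE)
    (hbw : winN κ ⟨((d : ℝ) - 1) * ((L : ℝ) - 1) * s, G + ((d : ℝ) - 1) * ((L : ℝ) - 1) * s * γU,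
        (2 * (G + ((d : ℝ) - 1) * ((L : ℝ) - 1) * s * γU)) ^ (1 - β) *
          (secondDev (((d : ℝ) - 1) * ((L : ℝ) - 1)) s q₀ τ G γU γP γE γγU γγP γγE) ^ β⟩ ≤ w) :
    ‖Fn (val U₁) - Fn (val U₀)‖ ≤ 4 * A / r *
      winN κ ⟨((d : ℝ) - 1) * ((L : ℝ) - 1) * s, G + ((d : ℝ) - 1) * ((L : ℝ) - 1) * s * γU,
        (2 * (G + ((d : ℝ) - 1) * ((L : ℝ) - 1) * s * γU)) ^ (1 - β) *
          (secondDev (((d : ℝ) - 1) * ((L : ℝ) - 1)) s q₀ τ G γU γP γE γγU γγP γγE) ^ β⟩ :=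
  block_transport_window hinv hsl hκ hr hA hU₀𝒦 (unitaryLike_combGauge hU₀ hU₁ z)
    (windowData_comb_second hβ0 hβ1 hC hU₀ hU₁ hs hq₀ hτ hG hγU hγP hγE hγγU hγγP hγγE hs0 hq0 hτ0 hG0 hγU0 hγP0
      hγE0 hγγU0 hγγP0 hγγE0) hbw

end Discharge

/-! ## §6  [arith] THE RATE: under the cell's scale dictionary the discharged `σ` is `O(θ³)`, and the discharged
window sits inside a `θ`-independent multiple of the printed window -/

section Rate

variable {θ c C : ℝ}

/-- [folklore] (arith) `x ≤ cθ^i`, `i ≥ 3` ⟹ `x ≤ c⁴θ³` (`0 ≤ θ ≤ 1 ≤ c`). -/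
theorem rate_one (hθ0 : 0 ≤ θ) (hθ1 : θ ≤ 1) (hc1 : 1 ≤ c) {x : ℝ} {i : ℕ} (hx : x ≤ c * θ ^ i) (hi : 3 ≤ i) :
    x ≤ c ^ 4 * θ ^ 3 := by
  have hc0 : 0 ≤ c := by linarith
  calc x ≤ c * θ ^ i := hx
    _ = c ^ 1 * θ ^ i := by ring
    _ ≤ c ^ 4 * θ ^ 3 := mul_le_mul (pow_le_pow_right₀ hc1 (by norm_num)) (pow_le_pow_of_le_one hθ0 hθ1 hi)
        (by positivity) (by positivity)

/-- [folklore] (arith) `x ≤ cθ^i`, `0 ≤ y ≤ cθ^j`, `i + j ≥ 3` ⟹ `xy ≤ c⁴θ³`. -/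
theorem rate_two (hθ0 : 0 ≤ θ) (hθ1 : θ ≤ 1) (hc1 : 1 ≤ c) {x y : ℝ} {i j : ℕ} (hx : x ≤ c * θ ^ i)
    (hy : y ≤ c * θ ^ j) (hy0 : 0 ≤ y) (hij : 3 ≤ i + j) : x * y ≤ c ^ 4 * θ ^ 3 := by
  have hc0 : 0 ≤ c := by linarith
  calc x * y ≤ (c * θ ^ i) * (c * θ ^ j) := mul_le_mul hx hy hy0 (by positivity)
    _ = c ^ 2 * θ ^ (i + j) := by ring
    _ ≤ c ^ 4 * θ ^ 3 := mul_le_mul (pow_le_pow_right₀ hc1 (by norm_num)) (pow_le_pow_of_le_one hθ0 hθ1 hij)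
        (by positivity) (by positivity)

/-- [folklore] (arith) `Cθ ≤ c`, `x ≤ cθ^i`, `i ≥ 4` ⟹ `C·x ≤ c⁴θ³` (the master count `C ~ θ⁻¹` eats one power). -/
theorem rate_C_one (hθ0 : 0 ≤ θ) (hθ1 : θ ≤ 1) (hc1 : 1 ≤ c) (hC0 : 0 ≤ C) (hCθ : C * θ ≤ c) {x : ℝ} {i : ℕ}
    (hx : x ≤ c * θ ^ i) (hi : 4 ≤ i) : C * x ≤ c ^ 4 * θ ^ 3 := by
  have hc0 : 0 ≤ c := by linarith
  calc C * x ≤ C * (c * θ ^ i) := mul_le_mul_of_nonneg_left hx hC0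
    _ ≤ C * (c * θ ^ 4) :=
        mul_le_mul_of_nonneg_left (mul_le_mul_of_nonneg_left (pow_le_pow_of_le_one hθ0 hθ1 hi) hc0) hC0
    _ = (C * θ) * (c * θ ^ 3) := by ring
    _ ≤ c * (c * θ ^ 3) := mul_le_mul_of_nonneg_right hCθ (by positivity)
    _ = c ^ 2 * θ ^ 3 := by ring
    _ ≤ c ^ 4 * θ ^ 3 := mul_le_mul_of_nonneg_right (pow_le_pow_right₀ hc1 (by norm_num)) (by positivity)

/-- [folklore] (arith) `Cθ ≤ c`, `x ≤ cθ^i`, `0 ≤ y ≤ cθ^j`, `i + j ≥ 4` ⟹ `C·xy ≤ c⁴θ³`. -/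
theorem rate_C_two (hθ0 : 0 ≤ θ) (hθ1 : θ ≤ 1) (hc1 : 1 ≤ c) (hC0 : 0 ≤ C) (hCθ : C * θ ≤ c) {x y : ℝ}
    {i j : ℕ} (hx : x ≤ c * θ ^ i) (hy : y ≤ c * θ ^ j) (hy0 : 0 ≤ y) (hij : 4 ≤ i + j) :
    C * (x * y) ≤ c ^ 4 * θ ^ 3 := by
  have hc0 : 0 ≤ c := by linarith
  have hxy : x * y ≤ c ^ 2 * θ ^ (i + j) := (mul_le_mul hx hy hy0 (by positivity)).trans_eq (by ring)
  calc C * (x * y) ≤ C * (c ^ 2 * θ ^ (i + j)) := mul_le_mul_of_nonneg_left hxy hC0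
    _ ≤ C * (c ^ 2 * θ ^ 4) :=
        mul_le_mul_of_nonneg_left (mul_le_mul_of_nonneg_left (pow_le_pow_of_le_one hθ0 hθ1 hij) (by positivity)) hC0
    _ = (C * θ) * (c ^ 2 * θ ^ 3) := by ring
    _ ≤ c * (c ^ 2 * θ ^ 3) := mul_le_mul_of_nonneg_right hCθ (by positivity)
    _ = c ^ 3 * θ ^ 3 := by ring
    _ ≤ c ^ 4 * θ ^ 3 := mul_le_mul_of_nonneg_right (pow_le_pow_right₀ hc1 (by norm_num)) (by positivity)

/-- [folklore] (arith) `Cθ ≤ c`, `x ≤ cθ^i`, `0 ≤ y ≤ cθ^j`, `0 ≤ w ≤ cθ^l`, `i + j + l ≥ 4` ⟹ `C·xyw ≤ c⁴θ³`. -/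
theorem rate_C_three (hθ0 : 0 ≤ θ) (hθ1 : θ ≤ 1) (hc1 : 1 ≤ c) (hC0 : 0 ≤ C) (hCθ : C * θ ≤ c) {x y w : ℝ}
    {i j l : ℕ} (hx : x ≤ c * θ ^ i) (hy : y ≤ c * θ ^ j) (hw : w ≤ c * θ ^ l) (hy0 : 0 ≤ y) (hw0 : 0 ≤ w)
    (h : 4 ≤ i + j + l) : C * (x * y * w) ≤ c ^ 4 * θ ^ 3 := by
  have hc0 : 0 ≤ c := by linarith
  have hxy : x * y ≤ c ^ 2 * θ ^ (i + j) := (mul_le_mul hx hy hy0 (by positivity)).trans_eq (by ring)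
  have hxyw : x * y * w ≤ c ^ 3 * θ ^ (i + j + l) := (mul_le_mul hxy hw hw0 (by positivity)).trans_eq (by ring)
  calc C * (x * y * w) ≤ C * (c ^ 3 * θ ^ (i + j + l)) := mul_le_mul_of_nonneg_left hxyw hC0
    _ ≤ C * (c ^ 3 * θ ^ 4) :=
        mul_le_mul_of_nonneg_left (mul_le_mul_of_nonneg_left (pow_le_pow_of_le_one hθ0 hθ1 h) (by positivity)) hC0
    _ = (C * θ) * (c ^ 3 * θ ^ 3) := by ring
    _ ≤ c * (c ^ 3 * θ ^ 3) := mul_le_mul_of_nonneg_right hCθ (by positivity)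
    _ = c ^ 4 * θ ^ 3 := by ring

variable {s q₀ τ G γU γP γE γγU γγP γγE : ℝ}

/-- **THE RATE OF THE DISCHARGED SECOND-DIFFERENCE DATUM** (arith; the scale dictionary is a CELL READING of the printed
formats [Balaban1985BackgroundPropagators] (3.35)/(3.36) p. 396 and [Balaban1985RegularSpaces] (1.36) p. 82 — NOT print,
and NO claim that Bałaban's configurations satisfy it is made here).  With `θ ∈ [0, 1]` (`θ = L^{−j}`), a constant
`c ≥ 1`, the master count `C·θ ≤ c` (`C = (d−1)(L−1)`), the zeroth/first-order data `C·s, s, q₀, τ ≤ cθ`, the first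
differences `G, γU, γP ≤ cθ²`, `γE ≤ cθ³`, and the second differences `γγU, γγP ≤ cθ³`, `γγE ≤ cθ⁴`:
`σ = secondDev C s q₀ τ G γU γP γE γγU γγP γγE ≤ 73·c⁴·θ³` — the input format `h₂ : σ ≤ a₂θ³` of
`T4CombHolderWindow.interp_hol_entry` (29 monomials, each at least cubic in `θ` under the dictionary).  [folklore] -/
theorem secondDev_le_rate (hθ0 : 0 ≤ θ) (hθ1 : θ ≤ 1) (hc1 : 1 ≤ c) (hC0 : 0 ≤ C) (hs0 : 0 ≤ s) (hq0 : 0 ≤ q₀)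
    (hτ0 : 0 ≤ τ) (hγU0 : 0 ≤ γU) (hγP0 : 0 ≤ γP) (hγE0 : 0 ≤ γE) (hγγU0 : 0 ≤ γγU)
    (hγγP0 : 0 ≤ γγP) (hγγE0 : 0 ≤ γγE) (hCθ : C * θ ≤ c) (hCs : C * s ≤ c * θ) (hs : s ≤ c * θ)
    (hq : q₀ ≤ c * θ) (hτ : τ ≤ c * θ) (hG2 : G ≤ c * θ ^ 2) (hγU2 : γU ≤ c * θ ^ 2) (hγP2 : γP ≤ c * θ ^ 2)
    (hγE3 : γE ≤ c * θ ^ 3) (hγγU3 : γγU ≤ c * θ ^ 3) (hγγP3 : γγP ≤ c * θ ^ 3) (hγγE4 : γγE ≤ c * θ ^ 4) :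
    secondDev C s q₀ τ G γU γP γE γγU γγP γγE ≤ 73 * c ^ 4 * θ ^ 3 := by
  have hb0 : 0 ≤ C * s := mul_nonneg hC0 hs0
  have hb : C * s ≤ c * θ ^ 1 := by rwa [pow_one]
  have hs1 : s ≤ c * θ ^ 1 := by rwa [pow_one]
  have hq1 : q₀ ≤ c * θ ^ 1 := by rwa [pow_one]
  have hτ1 : τ ≤ c * θ ^ 1 := by rwa [pow_one]
  have m1 : C * (G * γE) ≤ c ^ 4 * θ ^ 3 := rate_C_two hθ0 hθ1 hc1 hC0 hCθ hG2 hγE3 hγE0 (by norm_num)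
  have m2 : C * (G * γP) ≤ c ^ 4 * θ ^ 3 := rate_C_two hθ0 hθ1 hc1 hC0 hCθ hG2 hγP2 hγP0 (by norm_num)
  have m3 : C * (G * γU) ≤ c ^ 4 * θ ^ 3 := rate_C_two hθ0 hθ1 hc1 hC0 hCθ hG2 hγU2 hγU0 (by norm_num)
  have m4 : C * ((C * s) * γE * γP) ≤ c ^ 4 * θ ^ 3 := rate_C_three hθ0 hθ1 hc1 hC0 hCθ hb hγE3 hγP2 hγE0 hγP0 (by norm_num)
  have m5 : C * ((C * s) * γE * γU) ≤ c ^ 4 * θ ^ 3 := rate_C_three hθ0 hθ1 hc1 hC0 hCθ hb hγE3 hγU2 hγE0 hγU0 (by norm_num)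
  have m6 : C * ((C * s) * γP * γP) ≤ c ^ 4 * θ ^ 3 := rate_C_three hθ0 hθ1 hc1 hC0 hCθ hb hγP2 hγP2 hγP0 hγP0 (by norm_num)
  have m7 : C * ((C * s) * γP * γU) ≤ c ^ 4 * θ ^ 3 := rate_C_three hθ0 hθ1 hc1 hC0 hCθ hb hγP2 hγU2 hγP0 hγU0 (by norm_num)
  have m8 : C * ((C * s) * γU * γU) ≤ c ^ 4 * θ ^ 3 := rate_C_three hθ0 hθ1 hc1 hC0 hCθ hb hγU2 hγU2 hγU0 hγU0 (by norm_num)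
  have m9 : C * ((C * s) * γγE) ≤ c ^ 4 * θ ^ 3 := rate_C_two hθ0 hθ1 hc1 hC0 hCθ hb hγγE4 hγγE0 (by norm_num)
  have m10 : C * ((C * s) * γγP) ≤ c ^ 4 * θ ^ 3 := rate_C_two hθ0 hθ1 hc1 hC0 hCθ hb hγγP3 hγγP0 (by norm_num)
  have m11 : C * ((C * s) * γγU) ≤ c ^ 4 * θ ^ 3 := rate_C_two hθ0 hθ1 hc1 hC0 hCθ hb hγγU3 hγγU0 (by norm_num)
  have m12 : C * (γE * γP) ≤ c ^ 4 * θ ^ 3 := rate_C_two hθ0 hθ1 hc1 hC0 hCθ hγE3 hγP2 hγP0 (by norm_num)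
  have m13 : C * (γE * γU) ≤ c ^ 4 * θ ^ 3 := rate_C_two hθ0 hθ1 hc1 hC0 hCθ hγE3 hγU2 hγU0 (by norm_num)
  have m14 : C * (γP * γP * s) ≤ c ^ 4 * θ ^ 3 := rate_C_three hθ0 hθ1 hc1 hC0 hCθ hγP2 hγP2 hs1 hγP0 hs0 (by norm_num)
  have m15 : C * (γP * γU * s) ≤ c ^ 4 * θ ^ 3 := rate_C_three hθ0 hθ1 hc1 hC0 hCθ hγP2 hγU2 hs1 hγU0 hs0 (by norm_num)
  have m16 : C * (γU * γU * s) ≤ c ^ 4 * θ ^ 3 := rate_C_three hθ0 hθ1 hc1 hC0 hCθ hγU2 hγU2 hs1 hγU0 hs0 (by norm_num)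
  have m17 : C * γγE ≤ c ^ 4 * θ ^ 3 := rate_C_one hθ0 hθ1 hc1 hC0 hCθ hγγE4 (by norm_num)
  have m18 : C * (γγP * s) ≤ c ^ 4 * θ ^ 3 := rate_C_two hθ0 hθ1 hc1 hC0 hCθ hγγP3 hs1 hs0 (by norm_num)
  have m19 : C * (γγU * s) ≤ c ^ 4 * θ ^ 3 := rate_C_two hθ0 hθ1 hc1 hC0 hCθ hγγU3 hs1 hs0 (by norm_num)
  have m20 : G * γU ≤ c ^ 4 * θ ^ 3 := rate_two hθ0 hθ1 hc1 hG2 hγU2 hγU0 (by norm_num)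
  have m21 : G * q₀ ≤ c ^ 4 * θ ^ 3 := rate_two hθ0 hθ1 hc1 hG2 hq1 hq0 (by norm_num)
  have m22 : G * s ≤ c ^ 4 * θ ^ 3 := rate_two hθ0 hθ1 hc1 hG2 hs1 hs0 (by norm_num)
  have m23 : G * τ ≤ c ^ 4 * θ ^ 3 := rate_two hθ0 hθ1 hc1 hG2 hτ1 hτ0 (by norm_num)
  have m24 : (C * s) * γP ≤ c ^ 4 * θ ^ 3 := rate_two hθ0 hθ1 hc1 hb hγP2 hγP0 (by norm_num)
  have m25 : (C * s) * γU ≤ c ^ 4 * θ ^ 3 := rate_two hθ0 hθ1 hc1 hb hγU2 hγU0 (by norm_num)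
  have m26 : (C * s) * γγU ≤ c ^ 4 * θ ^ 3 := rate_two hθ0 hθ1 hc1 hb hγγU3 hγγU0 (by norm_num)
  have m27 : γE ≤ c ^ 4 * θ ^ 3 := rate_one hθ0 hθ1 hc1 hγE3 (by norm_num)
  have m28 : γP * s ≤ c ^ 4 * θ ^ 3 := rate_two hθ0 hθ1 hc1 hγP2 hs1 hs0 (by norm_num)
  have m29 : γU * s ≤ c ^ 4 * θ ^ 3 := rate_two hθ0 hθ1 hc1 hγU2 hs1 hs0 (by norm_num)
  simp only [secondDev, secondW, secondFoot, secondSrc, mapGrad, mapHess, devHess]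
  linarith

/-- [folklore] (arith) THE GRADIENT ENTRY AT ITS RATE: `G + C·s·γU ≤ 2c²θ²`. -/
theorem grad_entry_le_rate (hθ0 : 0 ≤ θ) (hθ1 : θ ≤ 1) (hc1 : 1 ≤ c) (hγU0 : 0 ≤ γU) (hCs : C * s ≤ c * θ)
    (hG2 : G ≤ c * θ ^ 2) (hγU2 : γU ≤ c * θ ^ 2) : G + C * s * γU ≤ 2 * c ^ 2 * θ ^ 2 := by
  have hc0 : 0 ≤ c := by linarith
  have hcc : c * θ ^ 2 ≤ c ^ 2 * θ ^ 2 := mul_le_mul_of_nonneg_right (by nlinarith) (by positivity)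
  have h2 : C * s * γU ≤ c ^ 2 * θ ^ 2 :=
    calc C * s * γU ≤ (c * θ) * (c * θ ^ 2) := mul_le_mul hCs hγU2 hγU0 (by positivity)
      _ = c ^ 2 * θ ^ 3 := by ring
      _ ≤ c ^ 2 * θ ^ 2 := mul_le_mul_of_nonneg_left (pow_le_pow_of_le_one hθ0 hθ1 (by norm_num)) (by positivity)
  linarith

/-- **THE INTERPOLATED HÖLDER ENTRY OF THE DISCHARGED WINDOW AT THE PRINTED RATE `θ^{2+β}`** (arith, cell reading):
under the dictionary of `secondDev_le_rate` (`0 < θ ≤ 1`), `(2(G + C·s·γU))^{1−β}·σ^β ≤ (4c²)^{1−β}(73c⁴)^β·θ^{2+β}`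
(`T4CombHolderWindow.interp_hol_entry`, `interp_exponent`: `(θ²)^{1−β}(θ³)^β = θ^{2+β}`) — the Hölder slot of
[Balaban1985RegularSpaces] (1.36) `‖A‖_{1,β} < B₂(β₀)(α₀+α₁)(L^jη)^{−2−β}` in bond-variable units
(`T4CombHolderWindow.printWin`), reached WITHOUT the `θ^β` loss recorded by `T4CombHolderWindow.crude_needs`.
[folklore] -/
theorem hol_entry_second_rate {β : ℝ} (hθ : 0 < θ) (hθ1 : θ ≤ 1) (hβ0 : 0 ≤ β) (hβ1 : β ≤ 1) (hc1 : 1 ≤ c)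
    (hC0 : 0 ≤ C) (hs0 : 0 ≤ s) (hq0 : 0 ≤ q₀) (hτ0 : 0 ≤ τ) (hG0 : 0 ≤ G) (hγU0 : 0 ≤ γU) (hγP0 : 0 ≤ γP)
    (hγE0 : 0 ≤ γE) (hγγU0 : 0 ≤ γγU) (hγγP0 : 0 ≤ γγP) (hγγE0 : 0 ≤ γγE) (hCθ : C * θ ≤ c)
    (hCs : C * s ≤ c * θ) (hs : s ≤ c * θ) (hq : q₀ ≤ c * θ) (hτ : τ ≤ c * θ) (hG2 : G ≤ c * θ ^ 2)
    (hγU2 : γU ≤ c * θ ^ 2) (hγP2 : γP ≤ c * θ ^ 2) (hγE3 : γE ≤ c * θ ^ 3) (hγγU3 : γγU ≤ c * θ ^ 3)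
    (hγγP3 : γγP ≤ c * θ ^ 3) (hγγE4 : γγE ≤ c * θ ^ 4) :
    (2 * (G + C * s * γU)) ^ (1 - β) * (secondDev C s q₀ τ G γU γP γE γγU γγP γγE) ^ β ≤
      (2 * (2 * c ^ 2)) ^ (1 - β) * (73 * c ^ 4) ^ β * θ ^ (2 + β) :=
  interp_hol_entry hθ hβ0 hβ1 (by positivity)
    (secondDev_nonneg hC0 hs0 hq0 hτ0 hG0 hγU0 hγP0 hγE0 hγγU0 hγγP0 hγγE0)
    (grad_entry_le_rate hθ.le hθ1 hc1 hγU0 hCs hG2 hγU2)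
    (secondDev_le_rate hθ.le hθ1 hc1 hC0 hs0 hq0 hτ0 hγU0 hγP0 hγE0 hγγU0 hγγP0 hγγE0 hCθ hCs hs hq hτ hG2 hγU2
      hγP2 hγE3 hγγU3 hγγP3 hγγE4)

/-- **THE DISCHARGED WINDOW INSIDE A `θ`-INDEPENDENT MULTIPLE OF THE PRINTED WINDOW** (arith, cell reading): under the
dictionary of `secondDev_le_rate`, the window triple `b = (C·s, G + C·s·γU, (2(G + C·s·γU))^{1−β}σ^β)` of
`windowData_comb_second` satisfies `N_{κ(θ)}(b) ≤ a(c, β) := c + 2c² + (4c²)^{1−β}(73c⁴)^β` for the printed-format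
weights `κ(θ) = (θ, θ², θ^{2+β})` (`T4CombHolderWindow.printWin`, `winN_printWin_le_iff`), UNIFORMLY in
`θ ∈ (0, 1]` — so the window condition `hbw` of `block_transport_comb_window_second` with `κ = printWin θ β` holds as
soon as `a(c, β) ≤ w`, for every `j`.  HONEST: a statement about the SHAPE of the bookkeeping; whether Bałaban's data
obey the dictionary with a `j`-independent `c` is what the printed estimates (3.35)–(3.38), (1.36) assert about HIS
fields (in covariant / quotient form) and is NOT proved here.  [folklore] -/
theorem winN_printWin_second_le {β : ℝ} (hθ : 0 < θ) (hθ1 : θ ≤ 1) (hβ0 : 0 ≤ β) (hβ1 : β ≤ 1) (hc1 : 1 ≤ c)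
    (hC0 : 0 ≤ C) (hs0 : 0 ≤ s) (hq0 : 0 ≤ q₀) (hτ0 : 0 ≤ τ) (hG0 : 0 ≤ G) (hγU0 : 0 ≤ γU) (hγP0 : 0 ≤ γP)
    (hγE0 : 0 ≤ γE) (hγγU0 : 0 ≤ γγU) (hγγP0 : 0 ≤ γγP) (hγγE0 : 0 ≤ γγE) (hCθ : C * θ ≤ c)
    (hCs : C * s ≤ c * θ) (hs : s ≤ c * θ) (hq : q₀ ≤ c * θ) (hτ : τ ≤ c * θ) (hG2 : G ≤ c * θ ^ 2)
    (hγU2 : γU ≤ c * θ ^ 2) (hγP2 : γP ≤ c * θ ^ 2) (hγE3 : γE ≤ c * θ ^ 3) (hγγU3 : γγU ≤ c * θ ^ 3)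
    (hγγP3 : γγP ≤ c * θ ^ 3) (hγγE4 : γγE ≤ c * θ ^ 4) :
    winN (printWin θ β) ⟨C * s, G + C * s * γU,
        (2 * (G + C * s * γU)) ^ (1 - β) * (secondDev C s q₀ τ G γU γP γE γγU γγP γγE) ^ β⟩ ≤
      c + 2 * c ^ 2 + (2 * (2 * c ^ 2)) ^ (1 - β) * (73 * c ^ 4) ^ β := by
  have hc0 : 0 ≤ c := by linarith
  have h2 := grad_entry_le_rate hθ.le hθ1 hc1 hγU0 hCs hG2 hγU2
  have h3 := hol_entry_second_rate hθ hθ1 hβ0 hβ1 hc1 hC0 hs0 hq0 hτ0 hG0 hγU0 hγP0 hγE0 hγγU0 hγγP0 hγγE0 hCθ hCs hs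
    hq hτ hG2 hγU2 hγP2 hγE3 hγγU3 hγγP3 hγγE4
  have hA0 : 0 ≤ (2 * (2 * c ^ 2)) ^ (1 - β) * (73 * c ^ 4) ^ β :=
    mul_nonneg (Real.rpow_nonneg (by positivity) _) (Real.rpow_nonneg (by positivity) _)
  have hθβ : 0 ≤ θ ^ (2 + β) := Real.rpow_nonneg hθ.le _
  refine (winN_printWin_le_iff hθ).2 ⟨?_, ?_, ?_⟩
  · show C * s ≤ _
    have := mul_nonneg (show 0 ≤ 2 * c ^ 2 + (2 * (2 * c ^ 2)) ^ (1 - β) * (73 * c ^ 4) ^ β by positivity) hθ.le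
    linarith
  · show G + C * s * γU ≤ _
    have := mul_nonneg (show 0 ≤ c + (2 * (2 * c ^ 2)) ^ (1 - β) * (73 * c ^ 4) ^ β by positivity)
      (pow_nonneg hθ.le 2)
    linarith
  · show (2 * (G + C * s * γU)) ^ (1 - β) * (secondDev C s q₀ τ G γU γP γE γγU γγP γγE) ^ β ≤ _
    have := mul_nonneg (show 0 ≤ c + 2 * c ^ 2 by positivity) hθβ
    linarith

end Rate

/-! ## §7  Non-vacuity: the flat pair inhabits every hypothesis with all constants `0`, and the bound is then `0` -/

section Witness

/-- [folklore] (arith) All constants `0` give `secondDev = 0`. -/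
theorem secondDev_zero (C : ℝ) : secondDev C 0 0 0 0 0 0 0 0 0 0 = 0 := by
  simp [secondDev, secondW, secondFoot, secondSrc, mapGrad, mapHess, devHess]

/-- Non-vacuity of `norm_second_diff_le`: for the flat pair `U₀ = U₁ ≡ 1` over `ℝ` every hypothesis holds with all ten
constants `0` (the comb gauge is trivial, `T4RelativeCombGradient.combGauge_self`) and the conclusion reads
`‖Δ_μΔ_ρW‖ ≤ 0`. -/
example {d L : ℕ} (z y : Site d) (μ ρ ν : Fin d) (hy : InBlock L z y) (hy' : InBlock L z (y + e μ + e ρ + e ν)) :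
    ‖(defect (fun _ _ => (1 : ℝˣ)) (fun _ _ => 1) z (y + e μ + e ρ) ν : ℝ) -
        defect (fun _ _ => (1 : ℝˣ)) (fun _ _ => 1) z (y + e μ) ν -
        defect (fun _ _ => (1 : ℝˣ)) (fun _ _ => 1) z (y + e ρ) ν +
        defect (fun _ _ => (1 : ℝˣ)) (fun _ _ => 1) z y ν‖ ≤ 0 := by
  have hg : combGauge (fun _ _ => (1 : ℝˣ)) (fun _ _ => (1 : ℝˣ)) z = fun _ => 1 :=
    funext fun x => combGauge_self (d := d) (fun _ _ => (1 : ℝˣ)) z x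
  have h1 : UnitaryLike (1 : ℝˣ) := UnitaryLike.one
  have H := norm_second_diff_le (R := ℝ) (U₀ := fun _ _ => (1 : ℝˣ)) (U₁ := fun _ _ => (1 : ℝˣ)) (z := z) (L := L)
    (s := 0) (q₀ := 0) (τ := 0) (G := 0) (γU := 0) (γP := 0) (γE := 0) (γγU := 0) (γγP := 0) (γγE := 0)
    (fun _ _ => h1) (fun _ _ => h1)
    (by intro y ρ ν' _ _ _ _ _; simp [hg, gaugeAct, plaq])
    (by intro y ρ ν' _ _ _ _ _; simp [plaq])
    (by intro x ρ _ _; simp)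
    (by intro μ ν x _ _ _; simp [defect, hg, gaugeAct])
    (by intro μ x ρ _ _ _ _; simp)
    (by intro μ y ρ ν' _ _ _ _ _ _ _ _ _; simp [plaq])
    (by intro μ y ρ ν' _ _ _ _ _ _ _ _ _; simp [hg, gaugeAct, plaq])
    (by intro μ ρ x α _ _; simp)
    (by intro μ ρ y α ν' _ _ _; simp [plaq])
    (by intro μ ρ y α ν' _ _ _; simp [hg, gaugeAct, plaq])
    le_rfl le_rfl le_rfl le_rfl le_rfl le_rfl le_rfl le_rfl le_rfl le_rfl μ ρ ν y hy hy'
  have h0 : secondW (((d : ℝ) - 1) * ((L : ℝ) - 1)) 0 0 0 0 0 0 0 0 0 0 = 0 := by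
    simp [secondW, secondFoot, secondSrc, mapGrad, mapHess, devHess]
  rw [h0] at H
  exact H

end Witness

/-! ## §8  (v1.1, APPEND-ONLY) THE FIRST-ORDER LETTERS RE-PLUMBED BY NAME and the composed rate

The window of §5 carries the first-order letters `G` (defect gradient), `γP` (base plaquette gradient) and `γE`
(deviation gradient) as HYPOTHESES.  All three are DISCHARGED from RAW block sups by the comb lineage one level down —
`G := G_raw` (`T4CombHolderWindow.gradRaw`, `T4RelativeCombGradient.norm_gradient_le_raw`), `γP := γ₀`,
`γE := γE_raw = γ₁ + γ₀ + 2q₁(τ₀ + C·s + τ₁)` (`T4RelativeCombGradient.deviation_gradient_le`) — and this section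
plugs them in LETTER FOR LETTER (`windowData_comb_second_raw`, `block_transport_comb_window_second_raw`): the only
remaining hypotheses beyond the raw first-order block sups `s, q₀, q₁, τ₀, τ₁, γU, γ₀, γ₁` of
`T4CombHolderWindow.windowData_comb_raw` are the three SECOND-ORDER letters `γγU, γγP, γγE` (`γγE` still in its
gauge-fixed form — its raw discharge is the residual (S1) of the cell's gap record).  The [arith] part then types the
COMPOSITION as one theorem: under the PLAQUETTE-LEVEL dictionary `D₂` (`s, q₀, q₁ ≤ cθ²`, `τ₀, τ₁ ≤ cθ`,
`γU ≤ cθ²`, `γ₀, γ₁ ≤ cθ³`, `γγU, γγP ≤ cθ³`, `γγE ≤ cθ⁴`, `Cθ ≤ c`, `1 ≤ c`, `0 < θ ≤ 1` — plaquette data carry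
one more power of `θ` than bond data) `G_raw ≤ 21c⁴θ²`, `γE_raw ≤ 8c⁴θ³`, hence the dictionary of
`secondDev_le_rate` holds with the constant `c' = 21c⁴` and the raw window sits inside `a(21c⁴, β)`× the printed
window `κ(θ) = (θ, θ², θ^{2+β})`, uniformly in `θ` (constants not optimised).  HONEST as in §6: bookkeeping shape
only; that Bałaban's fields obey `D₂` with a `j`-independent `c` is what (3.35)–(3.38), (1.36) assert and is not
proved here. -/

section Raw

open T4CombHolderWindow (gradRaw gradRaw_nonneg)

variable [NormOneClass R] {L : ℕ} {z : Site d}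

/-- [folklore] THE DEVIATION-GRADIENT BOUND of `T4RelativeCombGradient.deviation_gradient_le`, named:
`γE_raw(d, L; s, q₁, τ₀, τ₁, γ₀, γ₁) = γ₁ + γ₀ + 2q₁(τ₀ + C·s + τ₁)`, `C = (d−1)(L−1)`. -/
def devGradRaw (d L : ℕ) (s q₁ τ₀ τ₁ γ₀ γ₁ : ℝ) : ℝ :=
  γ₁ + γ₀ + 2 * q₁ * (τ₀ + ((d : ℝ) - 1) * ((L : ℝ) - 1) * s + τ₁)

/-- [folklore] `γE_raw ≥ 0` for nonnegative data and `C ≥ 0`. -/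
theorem devGradRaw_nonneg {d L : ℕ} {s q₁ τ₀ τ₁ γ₀ γ₁ : ℝ} (hC : 0 ≤ ((d : ℝ) - 1) * ((L : ℝ) - 1))
    (hs0 : 0 ≤ s) (hq1 : 0 ≤ q₁) (hτ0 : 0 ≤ τ₀) (hτ1 : 0 ≤ τ₁) (hγ00 : 0 ≤ γ₀) (hγ10 : 0 ≤ γ₁) :
    0 ≤ devGradRaw d L s q₁ τ₀ τ₁ γ₀ γ₁ := by
  unfold devGradRaw; positivity

/-- **WINDOW DATA OF THE COMB DEFECT DEVIATION FROM RAW FIRST-ORDER BLOCK SUPS AND SECOND-ORDER LETTERS** (the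
first-order letters of `windowData_comb_second` DISCHARGED BY NAME: `G := G_raw` by
`T4RelativeCombGradient.norm_gradient_le_raw`, `γP := γ₀`, `γE := γE_raw` by
`T4RelativeCombGradient.deviation_gradient_le`, `τ := τ₀`): unitary-like pair, gauge-fixed relative plaquette
deviation `≤ s`, curvatures `≤ q₀, q₁`, bond deviations `≤ τ₀, τ₁`, base bond gradient `≤ γU`, raw plaquette
gradients `≤ γ₀, γ₁`, and the SECOND-ORDER letters `γγU` (base bonds), `γγP` (base plaquettes), `γγE` (gauge-fixed
deviation) on `B(z)` ⟹ window data
`(C·s, G_raw + C·s·γU, (2(G_raw + C·s·γU))^{1−β}·σ_raw^β)`,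
`σ_raw = secondDev C s q₀ τ₀ G_raw γU γ₀ γE_raw γγU γγP γγE`, `0 ≤ β ≤ 1`.  [folklore] -/
theorem windowData_comb_second_raw {U₀ U₁ : Cfg d R} {β s q₀ q₁ τ₀ τ₁ γU γ₀ γ₁ γγU γγP γγE : ℝ} (hβ0 : 0 ≤ β)
    (hβ1 : β ≤ 1) (hC : 0 ≤ ((d : ℝ) - 1) * ((L : ℝ) - 1))
    (hU₀ : ∀ x ν, UnitaryLike (U₀ x ν)) (hU₁ : ∀ x ν, UnitaryLike (U₁ x ν))
    (hs : PlaqSup L z (fun y ρ ν =>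
      ‖(plaq (gaugeAct (combGauge U₀ U₁ z) U₁) y ρ ν : R) - plaq U₀ y ρ ν‖) s)
    (hq₀ : PlaqSup L z (fun y ρ ν => ‖(plaq U₀ y ρ ν : R) - 1‖) q₀)
    (hq₁ : PlaqSup L z (fun y ρ ν => ‖(plaq U₁ y ρ ν : R) - 1‖) q₁)
    (hτ₀ : ∀ x ρ, InBlock L z x → InBlock L z (x + e ρ) → ‖(U₀ x ρ : R) - 1‖ ≤ τ₀)
    (hτ₁ : ∀ x ρ, InBlock L z x → InBlock L z (x + e ρ) → ‖(U₁ x ρ : R) - 1‖ ≤ τ₁)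
    (hγU : ∀ μ x ρ, InBlock L z x → InBlock L z (x + e ρ) → InBlock L z (x + e μ) →
      InBlock L z (x + e μ + e ρ) → ‖(U₀ (x + e μ) ρ : R) - U₀ x ρ‖ ≤ γU)
    (hγ₀ : ∀ μ y ρ ν', ρ ≠ ν' → InBlock L z y → InBlock L z (y + e ρ) → InBlock L z (y + e ν') →
      InBlock L z (y + e ρ + e ν') → InBlock L z (y + e μ) → InBlock L z (y + e μ + e ρ) →
      InBlock L z (y + e μ + e ν') → InBlock L z (y + e μ + e ρ + e ν') →
      ‖(plaq U₀ (y + e μ) ρ ν' : R) - plaq U₀ y ρ ν'‖ ≤ γ₀)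
    (hγ₁ : ∀ μ y ρ ν', ρ ≠ ν' → InBlock L z y → InBlock L z (y + e ρ) → InBlock L z (y + e ν') →
      InBlock L z (y + e ρ + e ν') → InBlock L z (y + e μ) → InBlock L z (y + e μ + e ρ) →
      InBlock L z (y + e μ + e ν') → InBlock L z (y + e μ + e ρ + e ν') →
      ‖(plaq U₁ (y + e μ) ρ ν' : R) - plaq U₁ y ρ ν'‖ ≤ γ₁)
    (hγγU : ∀ μ ρ x α, InBlock L z x → InBlock L z (x + e μ + e ρ + e α) →
      ‖(U₀ (x + e μ + e ρ) α : R) - U₀ (x + e μ) α - U₀ (x + e ρ) α + U₀ x α‖ ≤ γγU)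
    (hγγP : ∀ μ ρ y α ν', α ≠ ν' → InBlock L z y → InBlock L z (y + e μ + e ρ + e α + e ν') →
      ‖(plaq U₀ (y + e μ + e ρ) α ν' : R) - plaq U₀ (y + e μ) α ν' - plaq U₀ (y + e ρ) α ν' +
          plaq U₀ y α ν'‖ ≤ γγP)
    (hγγE : ∀ μ ρ y α ν', α ≠ ν' → InBlock L z y → InBlock L z (y + e μ + e ρ + e α + e ν') →
      ‖((plaq (gaugeAct (combGauge U₀ U₁ z) U₁) (y + e μ + e ρ) α ν' : R) - plaq U₀ (y + e μ + e ρ) α ν') -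
          ((plaq (gaugeAct (combGauge U₀ U₁ z) U₁) (y + e μ) α ν' : R) - plaq U₀ (y + e μ) α ν') -
          ((plaq (gaugeAct (combGauge U₀ U₁ z) U₁) (y + e ρ) α ν' : R) - plaq U₀ (y + e ρ) α ν') +
          ((plaq (gaugeAct (combGauge U₀ U₁ z) U₁) y α ν' : R) - plaq U₀ y α ν')‖ ≤ γγE)
    (hs0 : 0 ≤ s) (hq0 : 0 ≤ q₀) (hq1 : 0 ≤ q₁) (hτ0 : 0 ≤ τ₀) (hτ1 : 0 ≤ τ₁) (hγU0 : 0 ≤ γU)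
    (hγ00 : 0 ≤ γ₀) (hγ10 : 0 ≤ γ₁) (hγγU0 : 0 ≤ γγU) (hγγP0 : 0 ≤ γγP) (hγγE0 : 0 ≤ γγE) :
    WindowData L z β (blockDev L z (combGauge U₀ U₁ z) U₀ U₁)
      ⟨((d : ℝ) - 1) * ((L : ℝ) - 1) * s,
        gradRaw d L s q₀ q₁ τ₀ τ₁ γU γ₀ γ₁ + ((d : ℝ) - 1) * ((L : ℝ) - 1) * s * γU,
        (2 * (gradRaw d L s q₀ q₁ τ₀ τ₁ γU γ₀ γ₁ + ((d : ℝ) - 1) * ((L : ℝ) - 1) * s * γU)) ^ (1 - β) *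
          (secondDev (((d : ℝ) - 1) * ((L : ℝ) - 1)) s q₀ τ₀ (gradRaw d L s q₀ q₁ τ₀ τ₁ γU γ₀ γ₁) γU γ₀
            (devGradRaw d L s q₁ τ₀ τ₁ γ₀ γ₁) γγU γγP γγE) ^ β⟩ :=
  windowData_comb_second hβ0 hβ1 hC hU₀ hU₁ hs hq₀ hτ₀
    (fun μ ν x hx hxμ hxμν => T4RelativeCombGradient.norm_gradient_le_raw (μ := μ) (ν := ν) hU₀ hU₁ hs hq₀ hq₁
      hτ₀ hτ₁ (hγU μ) (hγ₀ μ) (hγ₁ μ) hs0 hq0 hq1 hτ0 hτ1 hγU0 hγ00 hγ10 x hx hxμ hxμν)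
    hγU hγ₀ (fun μ => T4RelativeCombGradient.deviation_gradient_le hU₀ hU₁ hs hq₁ hτ₀ hτ₁ (hγ₀ μ) (hγ₁ μ) hs0)
    hγγU hγγP hγγE hs0 hq0 hτ0 (gradRaw_nonneg hC hs0 hq0 hq1 hτ0 hτ1 hγU0 hγ00 hγ10) hγU0 hγ00
    (devGradRaw_nonneg hC hs0 hq1 hτ0 hτ1 hγ00 hγ10) hγγU0 hγγP0 hγγE0

variable [NormedAlgebra ℂ R] {F : Type*} [NormedAddCommGroup F] [NormedSpace ℂ F] [CompleteSpace F]
variable {Fn : Fld d R → F} {𝒦 : Set (Fld d R)} {w r A : ℝ} {β : ℝ} {κ : Win}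

/-- **THE COMB INSTANCE OF THE WINDOW TRANSPORT FED BY RAW FIRST-ORDER BLOCK SUPS AND SECOND-ORDER LETTERS**
(`T4CombHolderWindow.block_transport_window` on `windowData_comb_second_raw`): gauge-invariant `Fn` with a WINDOW
birth slice, unitary-like `U₀ ∈ 𝒦`, `U₁`, the raw block sup data, and the window triple
`b = (C·s, G_raw + C·s·γU, (2(G_raw + C·s·γU))^{1−β}·σ_raw^β)` inside the window `N_κ(b) ≤ w` ⟹
`‖Fn U₁ − Fn U₀‖ ≤ (4A/r)·N_κ(b)`.  [folklore] -/
theorem block_transport_comb_window_second_raw (hinv : GaugeInvariant (BlockRel L z) Fn)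
    (hsl : BirthSlice Fn (wMove L z β) (wN L z β κ) 𝒦 w r A) (hκ : κ.Pos) (hr : 0 < r) (hA : 0 ≤ A)
    {U₀ U₁ : Cfg d R} (hU₀𝒦 : val U₀ ∈ 𝒦) {s q₀ q₁ τ₀ τ₁ γU γ₀ γ₁ γγU γγP γγE : ℝ} (hβ0 : 0 ≤ β)
    (hβ1 : β ≤ 1) (hC : 0 ≤ ((d : ℝ) - 1) * ((L : ℝ) - 1))
    (hU₀ : ∀ x ν, UnitaryLike (U₀ x ν)) (hU₁ : ∀ x ν, UnitaryLike (U₁ x ν))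
    (hs : PlaqSup L z (fun y ρ ν =>
      ‖(plaq (gaugeAct (combGauge U₀ U₁ z) U₁) y ρ ν : R) - plaq U₀ y ρ ν‖) s)
    (hq₀ : PlaqSup L z (fun y ρ ν => ‖(plaq U₀ y ρ ν : R) - 1‖) q₀)
    (hq₁ : PlaqSup L z (fun y ρ ν => ‖(plaq U₁ y ρ ν : R) - 1‖) q₁)
    (hτ₀ : ∀ x ρ, InBlock L z x → InBlock L z (x + e ρ) → ‖(U₀ x ρ : R) - 1‖ ≤ τ₀)
    (hτ₁ : ∀ x ρ, InBlock L z x → InBlock L z (x + e ρ) → ‖(U₁ x ρ : R) - 1‖ ≤ τ₁)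
    (hγU : ∀ μ x ρ, InBlock L z x → InBlock L z (x + e ρ) → InBlock L z (x + e μ) →
      InBlock L z (x + e μ + e ρ) → ‖(U₀ (x + e μ) ρ : R) - U₀ x ρ‖ ≤ γU)
    (hγ₀ : ∀ μ y ρ ν', ρ ≠ ν' → InBlock L z y → InBlock L z (y + e ρ) → InBlock L z (y + e ν') →
      InBlock L z (y + e ρ + e ν') → InBlock L z (y + e μ) → InBlock L z (y + e μ + e ρ) →
      InBlock L z (y + e μ + e ν') → InBlock L z (y + e μ + e ρ + e ν') →
      ‖(plaq U₀ (y + e μ) ρ ν' : R) - plaq U₀ y ρ ν'‖ ≤ γ₀)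
    (hγ₁ : ∀ μ y ρ ν', ρ ≠ ν' → InBlock L z y → InBlock L z (y + e ρ) → InBlock L z (y + e ν') →
      InBlock L z (y + e ρ + e ν') → InBlock L z (y + e μ) → InBlock L z (y + e μ + e ρ) →
      InBlock L z (y + e μ + e ν') → InBlock L z (y + e μ + e ρ + e ν') →
      ‖(plaq U₁ (y + e μ) ρ ν' : R) - plaq U₁ y ρ ν'‖ ≤ γ₁)
    (hγγU : ∀ μ ρ x α, InBlock L z x → InBlock L z (x + e μ + e ρ + e α) →
      ‖(U₀ (x + e μ + e ρ) α : R) - U₀ (x + e μ) α - U₀ (x + e ρ) α + U₀ x α‖ ≤ γγU)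
    (hγγP : ∀ μ ρ y α ν', α ≠ ν' → InBlock L z y → InBlock L z (y + e μ + e ρ + e α + e ν') →
      ‖(plaq U₀ (y + e μ + e ρ) α ν' : R) - plaq U₀ (y + e μ) α ν' - plaq U₀ (y + e ρ) α ν' +
          plaq U₀ y α ν'‖ ≤ γγP)
    (hγγE : ∀ μ ρ y α ν', α ≠ ν' → InBlock L z y → InBlock L z (y + e μ + e ρ + e α + e ν') →
      ‖((plaq (gaugeAct (combGauge U₀ U₁ z) U₁) (y + e μ + e ρ) α ν' : R) - plaq U₀ (y + e μ + e ρ) α ν') -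
          ((plaq (gaugeAct (combGauge U₀ U₁ z) U₁) (y + e μ) α ν' : R) - plaq U₀ (y + e μ) α ν') -
          ((plaq (gaugeAct (combGauge U₀ U₁ z) U₁) (y + e ρ) α ν' : R) - plaq U₀ (y + e ρ) α ν') +
          ((plaq (gaugeAct (combGauge U₀ U₁ z) U₁) y α ν' : R) - plaq U₀ y α ν')‖ ≤ γγE)
    (hs0 : 0 ≤ s) (hq0 : 0 ≤ q₀) (hq1 : 0 ≤ q₁) (hτ0 : 0 ≤ τ₀) (hτ1 : 0 ≤ τ₁) (hγU0 : 0 ≤ γU)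
    (hγ00 : 0 ≤ γ₀) (hγ10 : 0 ≤ γ₁) (hγγU0 : 0 ≤ γγU) (hγγP0 : 0 ≤ γγP) (hγγE0 : 0 ≤ γγE)
    (hbw : winN κ ⟨((d : ℝ) - 1) * ((L : ℝ) - 1) * s,
        gradRaw d L s q₀ q₁ τ₀ τ₁ γU γ₀ γ₁ + ((d : ℝ) - 1) * ((L : ℝ) - 1) * s * γU,
        (2 * (gradRaw d L s q₀ q₁ τ₀ τ₁ γU γ₀ γ₁ + ((d : ℝ) - 1) * ((L : ℝ) - 1) * s * γU)) ^ (1 - β) *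
          (secondDev (((d : ℝ) - 1) * ((L : ℝ) - 1)) s q₀ τ₀ (gradRaw d L s q₀ q₁ τ₀ τ₁ γU γ₀ γ₁) γU γ₀
            (devGradRaw d L s q₁ τ₀ τ₁ γ₀ γ₁) γγU γγP γγE) ^ β⟩ ≤ w) :
    ‖Fn (val U₁) - Fn (val U₀)‖ ≤ 4 * A / r *
      winN κ ⟨((d : ℝ) - 1) * ((L : ℝ) - 1) * s,
        gradRaw d L s q₀ q₁ τ₀ τ₁ γU γ₀ γ₁ + ((d : ℝ) - 1) * ((L : ℝ) - 1) * s * γU,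
        (2 * (gradRaw d L s q₀ q₁ τ₀ τ₁ γU γ₀ γ₁ + ((d : ℝ) - 1) * ((L : ℝ) - 1) * s * γU)) ^ (1 - β) *
          (secondDev (((d : ℝ) - 1) * ((L : ℝ) - 1)) s q₀ τ₀ (gradRaw d L s q₀ q₁ τ₀ τ₁ γU γ₀ γ₁) γU γ₀
            (devGradRaw d L s q₁ τ₀ τ₁ γ₀ γ₁) γγU γγP γγE) ^ β⟩ :=
  block_transport_window hinv hsl hκ hr hA hU₀𝒦 (unitaryLike_combGauge hU₀ hU₁ z)
    (windowData_comb_second_raw hβ0 hβ1 hC hU₀ hU₁ hs hq₀ hq₁ hτ₀ hτ₁ hγU hγ₀ hγ₁ hγγU hγγP hγγE hs0 hq0 hq1 hτ0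
      hτ1 hγU0 hγ00 hγ10 hγγU0 hγγP0 hγγE0) hbw

end Raw

/-! ### [arith] the composed rate under the plaquette-level dictionary `D₂` -/

section RawRate

open T4CombHolderWindow (gradRaw)

variable {θ c C : ℝ}

/-- [folklore] (arith) `x ≤ cθ^i`, `i ≥ n` ⟹ `x ≤ c⁴θⁿ` (`0 ≤ θ ≤ 1 ≤ c`). -/
theorem rate_one' (hθ0 : 0 ≤ θ) (hθ1 : θ ≤ 1) (hc1 : 1 ≤ c) {x : ℝ} {i n : ℕ} (hx : x ≤ c * θ ^ i) (hi : n ≤ i) :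
    x ≤ c ^ 4 * θ ^ n := by
  have hc0 : 0 ≤ c := by linarith
  calc x ≤ c * θ ^ i := hx
    _ = c ^ 1 * θ ^ i := by ring
    _ ≤ c ^ 4 * θ ^ n := mul_le_mul (pow_le_pow_right₀ hc1 (by norm_num)) (pow_le_pow_of_le_one hθ0 hθ1 hi)
        (by positivity) (by positivity)

/-- [folklore] (arith) `x ≤ cθ^i`, `0 ≤ y ≤ cθ^j`, `i + j ≥ n` ⟹ `xy ≤ c⁴θⁿ`. -/
theorem rate_two' (hθ0 : 0 ≤ θ) (hθ1 : θ ≤ 1) (hc1 : 1 ≤ c) {x y : ℝ} {i j n : ℕ} (hx : x ≤ c * θ ^ i)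
    (hy : y ≤ c * θ ^ j) (hy0 : 0 ≤ y) (hij : n ≤ i + j) : x * y ≤ c ^ 4 * θ ^ n := by
  have hc0 : 0 ≤ c := by linarith
  calc x * y ≤ (c * θ ^ i) * (c * θ ^ j) := mul_le_mul hx hy hy0 (by positivity)
    _ = c ^ 2 * θ ^ (i + j) := by ring
    _ ≤ c ^ 4 * θ ^ n := mul_le_mul (pow_le_pow_right₀ hc1 (by norm_num)) (pow_le_pow_of_le_one hθ0 hθ1 hij)
        (by positivity) (by positivity)

/-- [folklore] (arith) `Cθ ≤ c`, `x ≤ cθ^i`, `i ≥ n + 1` ⟹ `C·x ≤ c⁴θⁿ`. -/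
theorem rate_C_one' (hθ0 : 0 ≤ θ) (hθ1 : θ ≤ 1) (hc1 : 1 ≤ c) (hC0 : 0 ≤ C) (hCθ : C * θ ≤ c) {x : ℝ} {i n : ℕ}
    (hx : x ≤ c * θ ^ i) (hi : n + 1 ≤ i) : C * x ≤ c ^ 4 * θ ^ n := by
  have hc0 : 0 ≤ c := by linarith
  calc C * x ≤ C * (c * θ ^ i) := mul_le_mul_of_nonneg_left hx hC0
    _ ≤ C * (c * θ ^ (n + 1)) :=
        mul_le_mul_of_nonneg_left (mul_le_mul_of_nonneg_left (pow_le_pow_of_le_one hθ0 hθ1 hi) hc0) hC0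
    _ = (C * θ) * (c * θ ^ n) := by ring
    _ ≤ c * (c * θ ^ n) := mul_le_mul_of_nonneg_right hCθ (by positivity)
    _ = c ^ 2 * θ ^ n := by ring
    _ ≤ c ^ 4 * θ ^ n := mul_le_mul_of_nonneg_right (pow_le_pow_right₀ hc1 (by norm_num)) (by positivity)

/-- [folklore] (arith) `Cθ ≤ c`, `x ≤ cθ^i`, `0 ≤ y ≤ cθ^j`, `i + j ≥ n + 1` ⟹ `C·xy ≤ c⁴θⁿ`. -/
theorem rate_C_two' (hθ0 : 0 ≤ θ) (hθ1 : θ ≤ 1) (hc1 : 1 ≤ c) (hC0 : 0 ≤ C) (hCθ : C * θ ≤ c) {x y : ℝ}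
    {i j n : ℕ} (hx : x ≤ c * θ ^ i) (hy : y ≤ c * θ ^ j) (hy0 : 0 ≤ y) (hij : n + 1 ≤ i + j) :
    C * (x * y) ≤ c ^ 4 * θ ^ n := by
  have hc0 : 0 ≤ c := by linarith
  have hxy : x * y ≤ c ^ 2 * θ ^ (i + j) := (mul_le_mul hx hy hy0 (by positivity)).trans_eq (by ring)
  calc C * (x * y) ≤ C * (c ^ 2 * θ ^ (i + j)) := mul_le_mul_of_nonneg_left hxy hC0
    _ ≤ C * (c ^ 2 * θ ^ (n + 1)) :=
        mul_le_mul_of_nonneg_left (mul_le_mul_of_nonneg_left (pow_le_pow_of_le_one hθ0 hθ1 hij) (by positivity)) hC0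
    _ = (C * θ) * (c ^ 2 * θ ^ n) := by ring
    _ ≤ c * (c ^ 2 * θ ^ n) := mul_le_mul_of_nonneg_right hCθ (by positivity)
    _ = c ^ 3 * θ ^ n := by ring
    _ ≤ c ^ 4 * θ ^ n := mul_le_mul_of_nonneg_right (pow_le_pow_right₀ hc1 (by norm_num)) (by positivity)

/-- [folklore] (arith) `Cθ ≤ c`, `x ≤ cθ^i`, `0 ≤ y ≤ cθ^j`, `i + j ≥ n + 2` ⟹ `C·(C·xy) ≤ c⁴θⁿ` (two master
counts eat two powers). -/
theorem rate_CC_two' (hθ0 : 0 ≤ θ) (hθ1 : θ ≤ 1) (hc1 : 1 ≤ c) (hC0 : 0 ≤ C) (hCθ : C * θ ≤ c) {x y : ℝ}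
    {i j n : ℕ} (hx : x ≤ c * θ ^ i) (hy : y ≤ c * θ ^ j) (hy0 : 0 ≤ y) (hij : n + 2 ≤ i + j) :
    C * (C * (x * y)) ≤ c ^ 4 * θ ^ n := by
  have hc0 : 0 ≤ c := by linarith
  have hxy : x * y ≤ c ^ 2 * θ ^ (i + j) := (mul_le_mul hx hy hy0 (by positivity)).trans_eq (by ring)
  calc C * (C * (x * y)) ≤ C * (C * (c ^ 2 * θ ^ (i + j))) :=
        mul_le_mul_of_nonneg_left (mul_le_mul_of_nonneg_left hxy hC0) hC0
    _ ≤ C * (C * (c ^ 2 * θ ^ (n + 2))) :=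
        mul_le_mul_of_nonneg_left (mul_le_mul_of_nonneg_left
          (mul_le_mul_of_nonneg_left (pow_le_pow_of_le_one hθ0 hθ1 hij) (by positivity)) hC0) hC0
    _ = (C * θ) * (C * θ) * (c ^ 2 * θ ^ n) := by ring
    _ ≤ c * c * (c ^ 2 * θ ^ n) :=
        mul_le_mul_of_nonneg_right (mul_le_mul hCθ hCθ (by positivity) hc0) (by positivity)
    _ = c ^ 4 * θ ^ n := by ring

/-- [folklore] (arith) `G_raw` as a polynomial in an ABSTRACT comb count `C` (for the rate bookkeeping). -/
def gradPoly (C s q₀ q₁ τ₀ τ₁ γU γ₀ γ₁ : ℝ) : ℝ :=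
  s * (1 + C * (2 * q₀ + s + 2 * τ₀)) +
    C * (2 * γU * (C * s + s) + (γ₁ + γ₀ + 2 * q₁ * (τ₀ + C * s + τ₁)) + γ₀ * (2 * (C * s) + s))

/-- [folklore] (arith) `γE_raw` as a polynomial in an abstract `C`. -/
def devGradPoly (C s q₁ τ₀ τ₁ γ₀ γ₁ : ℝ) : ℝ :=
  γ₁ + γ₀ + 2 * q₁ * (τ₀ + C * s + τ₁)

/-- [folklore] `G_raw(d, L; …) = gradPoly ((d−1)(L−1)) …` (definitional). -/
theorem gradRaw_eq_gradPoly (d L : ℕ) (s q₀ q₁ τ₀ τ₁ γU γ₀ γ₁ : ℝ) :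
    gradRaw d L s q₀ q₁ τ₀ τ₁ γU γ₀ γ₁ = gradPoly (((d : ℝ) - 1) * ((L : ℝ) - 1)) s q₀ q₁ τ₀ τ₁ γU γ₀ γ₁ := rfl

/-- [folklore] `γE_raw(d, L; …) = devGradPoly ((d−1)(L−1)) …` (definitional). -/
theorem devGradRaw_eq_devGradPoly (d L : ℕ) (s q₁ τ₀ τ₁ γ₀ γ₁ : ℝ) :
    devGradRaw d L s q₁ τ₀ τ₁ γ₀ γ₁ = devGradPoly (((d : ℝ) - 1) * ((L : ℝ) - 1)) s q₁ τ₀ τ₁ γ₀ γ₁ := rfl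

variable {s q₀ q₁ τ₀ τ₁ γU γ₀ γ₁ γγU γγP γγE : ℝ}

/-- **`G_raw = O(θ²)` UNDER THE PLAQUETTE-LEVEL DICTIONARY `D₂`** (arith, cell reading): `0 ≤ θ ≤ 1 ≤ c`,
`Cθ ≤ c`, plaquette data `s, q₀, q₁ ≤ cθ²`, bond data `τ₀, τ₁ ≤ cθ`, base bond gradient `γU ≤ cθ²`, plaquette
gradients `γ₀, γ₁ ≤ cθ³` ⟹ `gradPoly C … ≤ 21·c⁴·θ²` — the gradient entry of the raw window at the printed rate `θ²`
(thirteen monomials, each `≤ c⁴θ²`; constants not optimised).  [folklore] -/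
theorem gradPoly_le_rate (hθ0 : 0 ≤ θ) (hθ1 : θ ≤ 1) (hc1 : 1 ≤ c) (hC0 : 0 ≤ C) (hs0 : 0 ≤ s) (hq0 : 0 ≤ q₀)
    (hτ0 : 0 ≤ τ₀) (hτ1 : 0 ≤ τ₁) (hCθ : C * θ ≤ c) (hs : s ≤ c * θ ^ 2) (hq₀ : q₀ ≤ c * θ ^ 2) (hq₁ : q₁ ≤ c * θ ^ 2) (hτ₀ : τ₀ ≤ c * θ)
    (hτ₁ : τ₁ ≤ c * θ) (hγU : γU ≤ c * θ ^ 2) (hγ₀ : γ₀ ≤ c * θ ^ 3) (hγ₁ : γ₁ ≤ c * θ ^ 3) :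
    gradPoly C s q₀ q₁ τ₀ τ₁ γU γ₀ γ₁ ≤ 21 * c ^ 4 * θ ^ 2 := by
  have hτ₀' : τ₀ ≤ c * θ ^ 1 := by rwa [pow_one]
  have hτ₁' : τ₁ ≤ c * θ ^ 1 := by rwa [pow_one]
  have m1 : s ≤ c ^ 4 * θ ^ 2 := rate_one' hθ0 hθ1 hc1 hs le_rfl
  have m2 : C * (s * q₀) ≤ c ^ 4 * θ ^ 2 := rate_C_two' hθ0 hθ1 hc1 hC0 hCθ hs hq₀ hq0 (by norm_num)
  have m3 : C * (s * s) ≤ c ^ 4 * θ ^ 2 := rate_C_two' hθ0 hθ1 hc1 hC0 hCθ hs hs hs0 (by norm_num)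
  have m4 : C * (s * τ₀) ≤ c ^ 4 * θ ^ 2 := rate_C_two' hθ0 hθ1 hc1 hC0 hCθ hs hτ₀' hτ0 (by norm_num)
  have m5 : C * (C * (γU * s)) ≤ c ^ 4 * θ ^ 2 := rate_CC_two' hθ0 hθ1 hc1 hC0 hCθ hγU hs hs0 (by norm_num)
  have m6 : C * (γU * s) ≤ c ^ 4 * θ ^ 2 := rate_C_two' hθ0 hθ1 hc1 hC0 hCθ hγU hs hs0 (by norm_num)
  have m7 : C * γ₁ ≤ c ^ 4 * θ ^ 2 := rate_C_one' hθ0 hθ1 hc1 hC0 hCθ hγ₁ (by norm_num)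
  have m8 : C * γ₀ ≤ c ^ 4 * θ ^ 2 := rate_C_one' hθ0 hθ1 hc1 hC0 hCθ hγ₀ (by norm_num)
  have m9 : C * (q₁ * τ₀) ≤ c ^ 4 * θ ^ 2 := rate_C_two' hθ0 hθ1 hc1 hC0 hCθ hq₁ hτ₀' hτ0 (by norm_num)
  have m10 : C * (C * (q₁ * s)) ≤ c ^ 4 * θ ^ 2 := rate_CC_two' hθ0 hθ1 hc1 hC0 hCθ hq₁ hs hs0 (by norm_num)
  have m11 : C * (q₁ * τ₁) ≤ c ^ 4 * θ ^ 2 := rate_C_two' hθ0 hθ1 hc1 hC0 hCθ hq₁ hτ₁' hτ1 (by norm_num)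
  have m12 : C * (C * (γ₀ * s)) ≤ c ^ 4 * θ ^ 2 := rate_CC_two' hθ0 hθ1 hc1 hC0 hCθ hγ₀ hs hs0 (by norm_num)
  have m13 : C * (γ₀ * s) ≤ c ^ 4 * θ ^ 2 := rate_C_two' hθ0 hθ1 hc1 hC0 hCθ hγ₀ hs hs0 (by norm_num)
  have e : gradPoly C s q₀ q₁ τ₀ τ₁ γU γ₀ γ₁ = s + 2 * (C * (s * q₀)) + C * (s * s) + 2 * (C * (s * τ₀)) +
      2 * (C * (C * (γU * s))) + 2 * (C * (γU * s)) + C * γ₁ + C * γ₀ + 2 * (C * (q₁ * τ₀)) +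
      2 * (C * (C * (q₁ * s))) + 2 * (C * (q₁ * τ₁)) + 2 * (C * (C * (γ₀ * s))) + C * (γ₀ * s) := by
    unfold gradPoly; ring
  rw [e]; linarith

/-- **`γE_raw = O(θ³)` UNDER `D₂`** (arith): `γ₀, γ₁ ≤ cθ³`, `q₁ ≤ cθ²`, `τ₀, τ₁ ≤ cθ`, `s ≤ cθ²`, `Cθ ≤ c` ⟹
`devGradPoly C … ≤ 8·c⁴·θ³`.  [folklore] -/
theorem devGradPoly_le_rate (hθ0 : 0 ≤ θ) (hθ1 : θ ≤ 1) (hc1 : 1 ≤ c) (hC0 : 0 ≤ C) (hs0 : 0 ≤ s) (hτ0 : 0 ≤ τ₀)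
    (hτ1 : 0 ≤ τ₁) (hCθ : C * θ ≤ c) (hs : s ≤ c * θ ^ 2)
    (hq₁ : q₁ ≤ c * θ ^ 2) (hτ₀ : τ₀ ≤ c * θ) (hτ₁ : τ₁ ≤ c * θ) (hγ₀ : γ₀ ≤ c * θ ^ 3) (hγ₁ : γ₁ ≤ c * θ ^ 3) :
    devGradPoly C s q₁ τ₀ τ₁ γ₀ γ₁ ≤ 8 * c ^ 4 * θ ^ 3 := by
  have hτ₀' : τ₀ ≤ c * θ ^ 1 := by rwa [pow_one]
  have hτ₁' : τ₁ ≤ c * θ ^ 1 := by rwa [pow_one]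
  have m1 : γ₁ ≤ c ^ 4 * θ ^ 3 := rate_one' hθ0 hθ1 hc1 hγ₁ le_rfl
  have m2 : γ₀ ≤ c ^ 4 * θ ^ 3 := rate_one' hθ0 hθ1 hc1 hγ₀ le_rfl
  have m3 : q₁ * τ₀ ≤ c ^ 4 * θ ^ 3 := rate_two' hθ0 hθ1 hc1 hq₁ hτ₀' hτ0 (by norm_num)
  have m4 : C * (q₁ * s) ≤ c ^ 4 * θ ^ 3 := rate_C_two' hθ0 hθ1 hc1 hC0 hCθ hq₁ hs hs0 (by norm_num)
  have m5 : q₁ * τ₁ ≤ c ^ 4 * θ ^ 3 := rate_two' hθ0 hθ1 hc1 hq₁ hτ₁' hτ1 (by norm_num)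
  have e : devGradPoly C s q₁ τ₀ τ₁ γ₀ γ₁ =
      γ₁ + γ₀ + 2 * (q₁ * τ₀) + 2 * (C * (q₁ * s)) + 2 * (q₁ * τ₁) := by
    unfold devGradPoly; ring
  rw [e]; linarith

/-- [folklore] (arith) `gradPoly ≥ 0` for nonnegative data. -/
theorem gradPoly_nonneg (hC0 : 0 ≤ C) (hs0 : 0 ≤ s) (hq0 : 0 ≤ q₀) (hq1 : 0 ≤ q₁) (hτ0 : 0 ≤ τ₀) (hτ1 : 0 ≤ τ₁)
    (hγU0 : 0 ≤ γU) (hγ00 : 0 ≤ γ₀) (hγ10 : 0 ≤ γ₁) : 0 ≤ gradPoly C s q₀ q₁ τ₀ τ₁ γU γ₀ γ₁ := by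
  unfold gradPoly; positivity

/-- [folklore] (arith) `devGradPoly ≥ 0` for nonnegative data. -/
theorem devGradPoly_nonneg (hC0 : 0 ≤ C) (hs0 : 0 ≤ s) (hq1 : 0 ≤ q₁) (hτ0 : 0 ≤ τ₀) (hτ1 : 0 ≤ τ₁)
    (hγ00 : 0 ≤ γ₀) (hγ10 : 0 ≤ γ₁) : 0 ≤ devGradPoly C s q₁ τ₀ τ₁ γ₀ γ₁ := by
  unfold devGradPoly; positivity

/-- **THE RAW SECOND-DIFFERENCE DATUM IS `O(θ³)` UNDER `D₂`** (arith, cell reading; the COMPOSITION typed as one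
theorem): under `D₂` (`0 ≤ θ ≤ 1 ≤ c`, `Cθ ≤ c`, `s, q₀, q₁ ≤ cθ²`, `τ₀, τ₁ ≤ cθ`, `γU ≤ cθ²`, `γ₀, γ₁ ≤ cθ³`,
`γγU, γγP ≤ cθ³`, `γγE ≤ cθ⁴`) the dictionary of `secondDev_le_rate` holds with the constant `c' = 21c⁴`
(`G_raw ≤ 21c⁴θ²` by `gradPoly_le_rate`, `γE_raw ≤ 8c⁴θ³ ≤ c'θ³` by `devGradPoly_le_rate`, the other letters
lifted from `c` to `c'`), hence
`σ_raw = secondDev C s q₀ τ₀ G_raw γU γ₀ γE_raw γγU γγP γγE ≤ 73·(21c⁴)⁴·θ³`.  [folklore] -/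
theorem secondDev_raw_le_rate (hθ0 : 0 ≤ θ) (hθ1 : θ ≤ 1) (hc1 : 1 ≤ c) (hC0 : 0 ≤ C) (hs0 : 0 ≤ s)
    (hq0 : 0 ≤ q₀) (hq1 : 0 ≤ q₁) (hτ0 : 0 ≤ τ₀) (hτ1 : 0 ≤ τ₁) (hγU0 : 0 ≤ γU) (hγ00 : 0 ≤ γ₀) (hγ10 : 0 ≤ γ₁)
    (hγγU0 : 0 ≤ γγU) (hγγP0 : 0 ≤ γγP) (hγγE0 : 0 ≤ γγE) (hCθ : C * θ ≤ c) (hs : s ≤ c * θ ^ 2)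
    (hq₀ : q₀ ≤ c * θ ^ 2) (hq₁ : q₁ ≤ c * θ ^ 2) (hτ₀ : τ₀ ≤ c * θ) (hτ₁ : τ₁ ≤ c * θ) (hγU : γU ≤ c * θ ^ 2)
    (hγ₀ : γ₀ ≤ c * θ ^ 3) (hγ₁ : γ₁ ≤ c * θ ^ 3) (hγγU3 : γγU ≤ c * θ ^ 3) (hγγP3 : γγP ≤ c * θ ^ 3)
    (hγγE4 : γγE ≤ c * θ ^ 4) :
    secondDev C s q₀ τ₀ (gradPoly C s q₀ q₁ τ₀ τ₁ γU γ₀ γ₁) γU γ₀ (devGradPoly C s q₁ τ₀ τ₁ γ₀ γ₁) γγU γγP γγE ≤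
      73 * (21 * c ^ 4) ^ 4 * θ ^ 3 := by
  have hc0 : 0 ≤ c := by linarith
  have hθ2 : θ ^ 2 ≤ θ := by nlinarith
  have hθ3 : θ ^ 3 ≤ θ ^ 2 := pow_le_pow_of_le_one hθ0 hθ1 (by norm_num)
  have hc4 : c ≤ c ^ 4 := le_self_pow₀ hc1 (by norm_num)
  have hcc : c ≤ 21 * c ^ 4 := by linarith
  have hc1' : 1 ≤ 21 * c ^ 4 := le_trans hc1 hcc
  have lift : ∀ {x : ℝ} {k : ℕ}, x ≤ c * θ ^ k → x ≤ 21 * c ^ 4 * θ ^ k := fun {x k} hx =>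
    hx.trans (mul_le_mul_of_nonneg_right hcc (pow_nonneg hθ0 k))
  have hCθ' : C * θ ≤ 21 * c ^ 4 := hCθ.trans hcc
  have hCs' : C * s ≤ 21 * c ^ 4 * θ := by
    calc C * s ≤ C * (c * θ ^ 2) := mul_le_mul_of_nonneg_left hs hC0
      _ = (C * θ) * (c * θ) := by ring
      _ ≤ c * (c * θ) := mul_le_mul_of_nonneg_right hCθ (by positivity)
      _ = c ^ 2 * θ := by ring
      _ ≤ 21 * c ^ 4 * θ := mul_le_mul_of_nonneg_right (by nlinarith) hθ0
  have hs' : s ≤ 21 * c ^ 4 * θ :=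
    (hs.trans (mul_le_mul_of_nonneg_left hθ2 hc0)).trans (mul_le_mul_of_nonneg_right hcc hθ0)
  have hq₀' : q₀ ≤ 21 * c ^ 4 * θ :=
    (hq₀.trans (mul_le_mul_of_nonneg_left hθ2 hc0)).trans (mul_le_mul_of_nonneg_right hcc hθ0)
  have hτ₀' : τ₀ ≤ 21 * c ^ 4 * θ := hτ₀.trans (mul_le_mul_of_nonneg_right hcc hθ0)
  have hG' : gradPoly C s q₀ q₁ τ₀ τ₁ γU γ₀ γ₁ ≤ 21 * c ^ 4 * θ ^ 2 :=
    gradPoly_le_rate hθ0 hθ1 hc1 hC0 hs0 hq0 hτ0 hτ1 hCθ hs hq₀ hq₁ hτ₀ hτ₁ hγU hγ₀ hγ₁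
  have hγU' : γU ≤ 21 * c ^ 4 * θ ^ 2 := lift hγU
  have hγ₀' : γ₀ ≤ 21 * c ^ 4 * θ ^ 2 :=
    (hγ₀.trans (mul_le_mul_of_nonneg_left hθ3 hc0)).trans (mul_le_mul_of_nonneg_right hcc (pow_nonneg hθ0 2))
  have hγE' : devGradPoly C s q₁ τ₀ τ₁ γ₀ γ₁ ≤ 21 * c ^ 4 * θ ^ 3 := by
    have h8 := devGradPoly_le_rate hθ0 hθ1 hc1 hC0 hs0 hτ0 hτ1 hCθ hs hq₁ hτ₀ hτ₁ hγ₀ hγ₁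
    have : 8 * c ^ 4 * θ ^ 3 ≤ 21 * c ^ 4 * θ ^ 3 := by
      have := mul_nonneg (pow_nonneg hc0 4) (pow_nonneg hθ0 3); nlinarith
    exact h8.trans this
  exact secondDev_le_rate hθ0 hθ1 hc1' hC0 hs0 hq0 hτ0 hγU0 hγ00
    (devGradPoly_nonneg hC0 hs0 hq1 hτ0 hτ1 hγ00 hγ10) hγγU0 hγγP0 hγγE0 hCθ' hCs' hs' hq₀' hτ₀' hG' hγU' hγ₀' hγE'
    (lift hγγU3) (lift hγγP3) (lift hγγE4)

/-- **THE RAW WINDOW INSIDE A `θ`-INDEPENDENT MULTIPLE OF THE PRINTED WINDOW** (arith, cell reading; the composed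
form of `winN_printWin_second_le`): under `D₂` with `0 < θ ≤ 1`, `0 ≤ β ≤ 1`, the raw window triple
`b = (C·s, G_raw + C·s·γU, (2(G_raw + C·s·γU))^{1−β}·σ_raw^β)` of `windowData_comb_second_raw` (with `G_raw`,
`γE_raw` read through `gradRaw_eq_gradPoly`, `devGradRaw_eq_devGradPoly`) satisfies
`N_{κ(θ)}(b) ≤ a(21c⁴, β) = 21c⁴ + 2(21c⁴)² + (4(21c⁴)²)^{1−β}(73(21c⁴)⁴)^β` for the printed weights
`κ(θ) = (θ, θ², θ^{2+β})`, UNIFORMLY in `θ` — every slot at its printed rate, the Hölder slot at `θ^{2+β}`.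
[folklore] -/
theorem winN_printWin_second_raw_le {β : ℝ} (hθ : 0 < θ) (hθ1 : θ ≤ 1) (hβ0 : 0 ≤ β) (hβ1 : β ≤ 1)
    (hc1 : 1 ≤ c) (hC0 : 0 ≤ C) (hs0 : 0 ≤ s) (hq0 : 0 ≤ q₀) (hq1 : 0 ≤ q₁) (hτ0 : 0 ≤ τ₀) (hτ1 : 0 ≤ τ₁)
    (hγU0 : 0 ≤ γU) (hγ00 : 0 ≤ γ₀) (hγ10 : 0 ≤ γ₁) (hγγU0 : 0 ≤ γγU) (hγγP0 : 0 ≤ γγP) (hγγE0 : 0 ≤ γγE)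
    (hCθ : C * θ ≤ c) (hs : s ≤ c * θ ^ 2) (hq₀ : q₀ ≤ c * θ ^ 2) (hq₁ : q₁ ≤ c * θ ^ 2) (hτ₀ : τ₀ ≤ c * θ)
    (hτ₁ : τ₁ ≤ c * θ) (hγU : γU ≤ c * θ ^ 2) (hγ₀ : γ₀ ≤ c * θ ^ 3) (hγ₁ : γ₁ ≤ c * θ ^ 3)
    (hγγU3 : γγU ≤ c * θ ^ 3) (hγγP3 : γγP ≤ c * θ ^ 3) (hγγE4 : γγE ≤ c * θ ^ 4) :
    winN (printWin θ β) ⟨C * s, gradPoly C s q₀ q₁ τ₀ τ₁ γU γ₀ γ₁ + C * s * γU,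
        (2 * (gradPoly C s q₀ q₁ τ₀ τ₁ γU γ₀ γ₁ + C * s * γU)) ^ (1 - β) *
          (secondDev C s q₀ τ₀ (gradPoly C s q₀ q₁ τ₀ τ₁ γU γ₀ γ₁) γU γ₀ (devGradPoly C s q₁ τ₀ τ₁ γ₀ γ₁)
            γγU γγP γγE) ^ β⟩ ≤
      21 * c ^ 4 + 2 * (21 * c ^ 4) ^ 2 + (2 * (2 * (21 * c ^ 4) ^ 2)) ^ (1 - β) * (73 * (21 * c ^ 4) ^ 4) ^ β := by
  have hθ0 := hθ.le
  have hc0 : 0 ≤ c := by linarith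
  have hθ2 : θ ^ 2 ≤ θ := by nlinarith
  have hθ3 : θ ^ 3 ≤ θ ^ 2 := pow_le_pow_of_le_one hθ0 hθ1 (by norm_num)
  have hc4 : c ≤ c ^ 4 := le_self_pow₀ hc1 (by norm_num)
  have hcc : c ≤ 21 * c ^ 4 := by linarith
  have hc1' : 1 ≤ 21 * c ^ 4 := le_trans hc1 hcc
  have lift : ∀ {x : ℝ} {k : ℕ}, x ≤ c * θ ^ k → x ≤ 21 * c ^ 4 * θ ^ k := fun {x k} hx =>
    hx.trans (mul_le_mul_of_nonneg_right hcc (pow_nonneg hθ0 k))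
  have hCθ' : C * θ ≤ 21 * c ^ 4 := hCθ.trans hcc
  have hCs' : C * s ≤ 21 * c ^ 4 * θ := by
    calc C * s ≤ C * (c * θ ^ 2) := mul_le_mul_of_nonneg_left hs hC0
      _ = (C * θ) * (c * θ) := by ring
      _ ≤ c * (c * θ) := mul_le_mul_of_nonneg_right hCθ (by positivity)
      _ = c ^ 2 * θ := by ring
      _ ≤ 21 * c ^ 4 * θ := mul_le_mul_of_nonneg_right (by nlinarith) hθ0
  have hs' : s ≤ 21 * c ^ 4 * θ :=
    (hs.trans (mul_le_mul_of_nonneg_left hθ2 hc0)).trans (mul_le_mul_of_nonneg_right hcc hθ0)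
  have hq₀' : q₀ ≤ 21 * c ^ 4 * θ :=
    (hq₀.trans (mul_le_mul_of_nonneg_left hθ2 hc0)).trans (mul_le_mul_of_nonneg_right hcc hθ0)
  have hτ₀' : τ₀ ≤ 21 * c ^ 4 * θ := hτ₀.trans (mul_le_mul_of_nonneg_right hcc hθ0)
  have hG' : gradPoly C s q₀ q₁ τ₀ τ₁ γU γ₀ γ₁ ≤ 21 * c ^ 4 * θ ^ 2 :=
    gradPoly_le_rate hθ0 hθ1 hc1 hC0 hs0 hq0 hτ0 hτ1 hCθ hs hq₀ hq₁ hτ₀ hτ₁ hγU hγ₀ hγ₁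
  have hγU' : γU ≤ 21 * c ^ 4 * θ ^ 2 := lift hγU
  have hγ₀' : γ₀ ≤ 21 * c ^ 4 * θ ^ 2 :=
    (hγ₀.trans (mul_le_mul_of_nonneg_left hθ3 hc0)).trans (mul_le_mul_of_nonneg_right hcc (pow_nonneg hθ0 2))
  have hγE' : devGradPoly C s q₁ τ₀ τ₁ γ₀ γ₁ ≤ 21 * c ^ 4 * θ ^ 3 := by
    have h8 := devGradPoly_le_rate hθ0 hθ1 hc1 hC0 hs0 hτ0 hτ1 hCθ hs hq₁ hτ₀ hτ₁ hγ₀ hγ₁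
    have : 8 * c ^ 4 * θ ^ 3 ≤ 21 * c ^ 4 * θ ^ 3 := by
      have := mul_nonneg (pow_nonneg hc0 4) (pow_nonneg hθ0 3); nlinarith
    exact h8.trans this
  exact winN_printWin_second_le hθ hθ1 hβ0 hβ1 hc1' hC0 hs0 hq0 hτ0
    (gradPoly_nonneg hC0 hs0 hq0 hq1 hτ0 hτ1 hγU0 hγ00 hγ10) hγU0 hγ00
    (devGradPoly_nonneg hC0 hs0 hq1 hτ0 hτ1 hγ00 hγ10) hγγU0 hγγP0 hγγE0 hCθ' hCs' hs' hq₀' hτ₀' hG' hγU' hγ₀'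
    hγE' (lift hγγU3) (lift hγγP3) (lift hγγE4)

end RawRate

end Literature.MathematicalPhysics.QuantumFieldTheory.Balaban1983to89.T4CombSecondDifference
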